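import Literature.MathematicalPhysics.QuantumFieldTheory.Balaban1983to89.B9SectBGWordDeltaAY
import Literature.MathematicalPhysics.QuantumFieldTheory.Balaban1983to89.B9SectBGWordDiffY
import Literature.MathematicalPhysics.QuantumFieldTheory.Balaban1983to89.B9SectBCodedChainR3
import Literature.MathematicalPhysics.QuantumFieldTheory.Balaban1983to89.B9SectBGReadCodedY
import Literature.MathematicalPhysics.QuantumFieldTheory.Balaban1983to89.B9SectBCodedClassR
import Literature.MathematicalPhysics.QuantumFieldTheory.Balaban1983to89.B9SectBKerLettersY
import Literature.MathematicalPhysics.QuantumFieldTheory.Balaban1983to89.B9SectBKerFrameV3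
import Literature.MathematicalPhysics.QuantumFieldTheory.Balaban1983to89.B9Thm39ReadingAtLetters
import Literature.MathematicalPhysics.QuantumFieldTheory.Balaban1983to89.B9SectBKerFrameCodedY
import Literature.MathematicalPhysics.QuantumFieldTheory.Balaban1983to89.B9SectBQVariationY
import Literature.MathematicalPhysics.QuantumFieldTheory.Balaban1983to89.B9SectBGFrameV5
import Literature.MathematicalPhysics.QuantumFieldTheory.Balaban1983to89.Node00.OpsYRead342CrossB
import Literature.MathematicalPhysics.QuantumFieldTheory.Balaban1983to89.B9Thm31SiteCurvatureCommutatorsY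
import Literature.MathematicalPhysics.QuantumFieldTheory.Balaban1983to89.B9SectBGFrameCodedY
import Literature.MathematicalPhysics.QuantumFieldTheory.Balaban1983to89.B9SectBH1GReadWriteY
import Literature.MathematicalPhysics.QuantumFieldTheory.Balaban1983to89.B9SectBH1GProbesY
import Literature.MathematicalPhysics.QuantumFieldTheory.Balaban1983to89.B9SectBH1GUndiffY
import Literature.MathematicalPhysics.QuantumFieldTheory.Balaban1983to89.B9SectBH1GFrameV6
import Literature.MathematicalPhysics.QuantumFieldTheory.Balaban1983to89.B9SectBH1GFrameCodedY
import Literature.MathematicalPhysics.QuantumFieldTheory.Balaban1983to89.B9Eq340TaxiContourLocalityY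
import Literature.MathematicalPhysics.QuantumFieldTheory.Balaban1983to89.B9Eq340HolderLipParBY
import Literature.MathematicalPhysics.QuantumFieldTheory.Balaban1983to89.B9SectBCodedChainR2
import Literature.MathematicalPhysics.QuantumFieldTheory.Balaban1983to89.B9SectBL2StepAtLettersV2Second
import Literature.MathematicalPhysics.QuantumFieldTheory.Balaban1983to89.B9SectBL2StepAtLettersV2Mixed
import Literature.MathematicalPhysics.QuantumFieldTheory.Balaban1983to89.B9GeoNormsKLevelModelSignsV1
import Literature.MathematicalPhysics.QuantumFieldTheory.Balaban1983to89.B9SectBL2StepCodedOn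

/-!
# `Balaban1983to89.B9SectBCodedChainR4` — CASCADE-R BUNDLE 4∕7 (director-ym №279 GO-R; №277 (3) `hunitA` cure): the class-parametric twins
# `B9SectBGReadCodedYR`, `B9SectBKerFrameCodedYR`, `B9SectBGFrameCodedYR`, `B9SectBH1GReadWriteYR`, `B9SectBH1GFrameCodedYR`, `B9Eq340HolderLipParBYR`, `B9SectBL2StepCodedOnR`

statement-level skeleton of published theorems with citation tags; proofs where landed; nothing here is a claim about the
Yang–Mills mass gap

WHY A BUNDLE.  The minimal R-sub-path of №279 (3) is a 47-module dependency chain; post-accept olean builds are the latency of record today, so the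
chain is filed as 7 layered modules instead of 47.  This module is the VERBATIM concatenation, in dependency order, of the 7 generated twin files
named above (each keeps its own namespace `…<Original>R`, its own honest twin header and a pointer to the original module documentation; consumers `open` the
namespaces exactly as they would the per-file twins).  Generated by dag-n06-c g16 (`mkbundle.py`, HOME `pub-ymgap-dag-n06-c/lean/g16/`).

v1.1 — DOC-ONLY EDITION (№288 (4) HEADER AUDIT; ref-E READ-9 HEADER-NIT; lit-balaban-r06 numerals).  No Lean token outside comments changes (every declaration byte-identical to v1).  The generator sentence «specialises definitionally ∕ VERBATIM» was FALSE for the declarations carrying the №277 re-keyed `hunitA` — here: `B9SectBGFrameCodedYR`: `gFrame₅CodedOn`, `stepEPos_KACU_frame_on`; `B9SectBH1GFrameCodedYR`: `h1GFrame₆CodedOn`, `stepH1Pos_KACU_frame_on`; `B9Eq340HolderLipParBYR`: `stepH1Pos_KACU_frame_parBY_on` — (weaker hypothesis: the twin IMPLIES the original at `P := extraY 𝔸 G` via `fun j α₀ U hU => hunitA j U hU.1.1`); their twin headers now say so, the others (`B9SectBGReadCodedYR`, `B9SectBKerFrameCodedYR`, `B9SectBH1GReadWriteYR`, `B9SectBL2StepCodedOnR`)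 mark the clause idle.  CAVEAT OF RECORD (LOCATED-18, director-ym №290 (1)): that class-keyed `hunitA` has no α₀-threshold and is uninhabitable at `SU(N)` as typed (certificate `B9Thm311ClassKeyedHunitANotInhabited`); the GUARDED twins `B9SectBCodedChainRG1∕RG2` ∕ `B9SectBStepUGuardedR` are the consumable objects.  Page numerals corrected per the [B9] page owner's receipt: «(3.57)–(3.59) p. 402» → «(3.57)–(3.59) pp. 401–402» (×1); «(3.57)–(3.59) p.402» → «(3.57)–(3.59) pp.401–402» (×2); «(3.80)–(3.86) p. 407» → «(3.80)–(3.81) p. 406, (3.82)–(3.86) p. 407» (×1); «(3.80)–(3.86) p.407» → «(3.80)–(3.81) p.406, (3.82)–(3.86) p.407» (×1).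

HONEST SCOPE.  Re-typing bookkeeping; nothing of [B9] asserted beyond the originals; COUNT-NEUTRAL; N06 NOT discharged; nothing continuum ∕ OS ∕ mass gap ∕ Clay.
-/

/-!
# `Balaban1983to89.B9SectBGReadCodedYR` — THE CLASS-PARAMETRIC TWIN of `B9SectBGReadCodedY` (CASCADE-R, director-ym №279 GO-R; №277 (3) `hunitA` cure; dag-n06-d SOCKET-(α) class question)

statement-level skeleton of published theorems with citation tags; proofs where landed; nothing here is a claim about the
Yang–Mills mass gap

WHAT THIS FILE IS.  The original module `B9SectBGReadCodedY` types its objects over MODULE 3's member carrier `bg9Y 𝔸 G x` (MODULE 2's small-cube class (3.35)).  This file RE-DECLARES, with UNCHANGED NAMES inside the namespace `…B9SectBGReadCodedYR`, exactly its 2 class-dependent declarations over the CLASS-PARAMETRIC carrier `B9SectBCodedClassR.bg9YC 𝔸 G P x` (`P : RegExtraY …` = the two cube conditions of (3.35)∕(3.36) as a parameter; `bg9Y 𝔸 G x = bg9YC 𝔸 G (extraY 𝔸 G) x` by `rfl`, so every declaration here specialises definitionally to its original; at the record's reading of PRINT's class, `P := extraYPb 𝔸 G`, the displayed laws `hreg335P`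 ((3.35) on plaquettes) and the class-keyed `hunitA` become theorems).  The text is the original's VERBATIM under the token surgery `bg9Y 𝔸 G ↦ bg9YC 𝔸 G P`, `NAME ↦ NAME P` for the class-dependent names (P the first explicit argument), and — №277 — the binder `hunitA` re-keyed from «all G-valued U» to «all (3.35)-regular U of the carrier» (`∀ j α₀ U, (bg9YC 𝔸 G P (f j)).Reg335 c35 α₀ U → IsUnit (deltaAY …)`) — a clause IDLE in this twin (no `hunitA` here; v1.1).  Class-free declarations of the original are NOT copied: they are imported and used BY NAME (`open … hiding` the re-declared ones).  Generated by dag-n06-c g16's `gen.py` (HOME `pub-ymgap-dag-n06-c/lean/g16/`); the ORIGINAL MODULE DOCUMENTATION FOLLOWS VERBATIM and describes the mathematics.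

HONEST SCOPE.  Re-typing bookkeeping; nothing of [B9] asserted beyond the original; COUNT-NEUTRAL; N06 NOT discharged; nothing continuum ∕ OS ∕ mass gap ∕ Clay.  Cell `pub-ymgap` (D-0062), Track A node N06 [B9], seat `pub-ymgap-dag-n06-c` g16, 2026-08-29.
-/

/-!
# Balaban [B9], Thm 3.3 p. 399 with (3.42) p. 397, Thm 3.4 p. 400, [4] (2.51) p. 232 — THE (3.42) READ ∕ WRITE FIELDS OF THE ROW-13 G FRAME AT
# NODE 00's LETTERS: gen 12's `B9SectBGReadY.readG342Y_KACU ∕ writeG342Y_KACU` (bond carrier `FBondY × ι`) TRANSPORTED to r06's carrier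
# `(κ × SiteY) × ι` and r06's difference letters `diffLetter (bT shiftY) (bU V) η⁻¹ k` — ★★ `readG342_GbC`, ★★ `writeG342_GbC`
# (pub-ymgap N06 G-side plan, Route L, L-5: the fields `readG342 ∕ writeG342` of `B9SectBGFrameV4.GFrame₄` for the instance `gFrame₄CodedOn`)

T. Bałaban, *Propagators for lattice gauge theories in a background field*, Commun. Math. Phys. **99** (1985) 389–434
[`Balaban1985BackgroundPropagators`, "B9"]; [4] = T. Bałaban, *Propagators and renormalization transformations for lattice gauge
theories. II*, Commun. Math. Phys. **96** (1984) 223–250 [`Balaban1984PropagatorsII`].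

statement-level skeleton of published theorems with citation tags; proofs where landed; nothing here is a claim about the
Yang–Mills mass gap

THE PRINTED LOCI.  (3.42) p. 397 (the four entries `G`, `∇_UG`, `G∇*_U`, `Δ_UG` of Theorem 3.3 p. 399); Theorem 3.4 p. 400; [4] (2.51) p. 232 (block majorants).

WHY THIS FILE (seat dag-n06-c gen 13).  The G frame reads the (3.42) block of the family `GA` at a regular base into block majorants of its four bond letters
`Gb U`, `conj b (diffLetter (bT T) (bU (coord U)) η⁻¹ k) * Gb U`, `Gb U * conj b (diffLetter … k)`, `LapB U * Gb U` on the carrier `(κ × S) × ι` with the block map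
`blk ∘ snd ∘ fst` (field `readG342`), and writes such majorants at a class product back into the (3.42) block (field `writeG342`).  Gen 12 proved both
dictionaries for NODE 00's coded bond reading `KACU G x OA parB C37 C38` on def-Y's own carrier `FBondY × ι` with the block map `ι_B ∘ blkV1 ∘ fst` and def-Y's
letters `cdBₗ ∕ cdsBₗ ∕ lapBₗ` (`B9SectBGReadY`).  THIS FILE moves them: §1 a block-majorant transport along a reindexing of the carrier (`hasMajorant_reindex`,
`hasMajorant_neg_iff`); §2 the bond reindexing `bondReindexY` (def-Y's `bondCoordsY × id`), its block compatibility (`blkC_bondReindexY`, by `rfl`) and the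
conjugation formula `conj_bondOpCoordsRY_apply`; §3 def-Y's difference letters ARE r06's up to the sign of `c_f` (`bondOpCoordsRY_cdBₗ ∕ _cdsBₗ` from gen 13's
`B9SectBGWordDiffY`, `diffLetter_neg`, `diffLetter_abs_eq`); §4 ★★ `readG342_GbC` and ★★ `writeG342_GbC` — the two fields for the letters `GbC ∕ LapBC` of
`B9SectBGWordDeltaAY` with `OA := GAY parS parB (GpY parS)`, reading constant `c_RG = M₂Σ_j‖b_j‖`, writing function `w_BG(B, δ) = M₂Σ_j‖b_j‖·B + 1`, same rate.

HONEST SCOPE.  Transport of landed dictionaries; no new estimate; nothing of [B9] asserted; count-neutral; N06 NOT discharged; nothing continuum ∕ OS ∕ mass-gap ∕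
Clay.  One definition (`bondReindexY`, an `Equiv`); no `sorry`, no `axiom`, no `instance`, no `notation`.  `--supports stmt-QuantumFields-27364`.

RELATED IN THE TREE, NOT DUPLICATED: `B9SectBGReadY` (gen 12 — USED), `B9SectBGWordDiffY` ∕ `B9SectBGWordDeltaAY` (gen 13 — USED), `B9SectBGpFrameCodedY.read342Y_KSC`
(the G′ twin), `B9SectBGpTransferInY.eBlock_mono`.
-/

noncomputable section

namespace Literature.MathematicalPhysics.QuantumFieldTheory.Balaban1983to89.B9SectBGReadCodedYR

open Literature.MathematicalPhysics.QuantumFieldTheory.Balaban1983to89.B9SectBCodedClassR (RegExtraY bg9YC)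
open Literature.MathematicalPhysics.QuantumFieldTheory.Balaban1983to89.B9SectBGReadCodedY hiding readG342_GbC_printed writeG342_GbC

open Literature.MathematicalPhysics.QuantumFieldTheory.Balaban1983to89
open Literature.MathematicalPhysics.QuantumFieldTheory.Balaban1983to89.Node00 (SiteY BlkY FBondY IBondY CfgY SiteParY BondParY UboxY shiftY cdB cdsB GAY GpY
  bondCoordsY bondFunCoordsY bondFunCoordsY_apply bondCoordsY_apply bondCoordsY_symm_mk)
open Literature.MathematicalPhysics.QuantumFieldTheory.Balaban1983to89.B6GlobalChartV1 (blkV1)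
open Literature.MathematicalPhysics.QuantumFieldTheory.Balaban1983to89.B6Ineq2142KLevelV1 (β)
open Literature.MathematicalPhysics.QuantumFieldTheory.Balaban1983to89.B6KLevelCensusIndexV1 (KIdx kGeo)
open Literature.MathematicalPhysics.QuantumFieldTheory.Balaban1983to89.B6RandomWalk (HasMajorant BlockSupp hasMajorant_mono)
open Literature.MathematicalPhysics.QuantumFieldTheory.Balaban1983to89.B9Thm34Ext (toB6)
open Literature.MathematicalPhysics.QuantumFieldTheory.Balaban1983to89.B9FromB6 (EBlock)
open Literature.MathematicalPhysics.QuantumFieldTheory.Balaban1983to89.B9GeoNormsKLevelV1 (geo9K)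
open Literature.MathematicalPhysics.QuantumFieldTheory.Balaban1983to89.B9Eq352DivFormLetters (conj coordEquiv conj_apply conj_neg gradLetterF_apply gradLetterB_apply)
open Literature.MathematicalPhysics.QuantumFieldTheory.Balaban1983to89.B9Eq352GradLetters (diffLetter diffLetter_inl diffLetter_inr)
open Literature.MathematicalPhysics.QuantumFieldTheory.Balaban1983to89.B9Eq371GradLetters (bT bU)
open Literature.MathematicalPhysics.QuantumFieldTheory.Balaban1983to89.B9CoReadingCoords (cdBₗ cdsBₗ lapBₗ cdBₗ_apply cdsBₗ_apply lapBₗ_apply)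
open Literature.MathematicalPhysics.QuantumFieldTheory.Balaban1983to89.B9PinMembersKLevelV1 (MemberY geo9Y bg9Y)
open Literature.MathematicalPhysics.QuantumFieldTheory.Balaban1983to89.B9Eq360DeltaPrimeAY (AfldY)
open Literature.MathematicalPhysics.QuantumFieldTheory.Balaban1983to89.B9SectBGpFrameCodedYR (codingYx)
open Literature.MathematicalPhysics.QuantumFieldTheory.Balaban1983to89.B9SectBGpLettersY (GVal decY decY_base decY_prod coordC blkC)
open Literature.MathematicalPhysics.QuantumFieldTheory.Balaban1983to89.B9SectBL2DictionaryY (coordC_base_eq)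
open Literature.MathematicalPhysics.QuantumFieldTheory.Balaban1983to89.B9SectBCodedCarrier (CCfg)
open Literature.MathematicalPhysics.QuantumFieldTheory.Balaban1983to89.B9SectBCodedReadingsUR (KACU)
open Literature.MathematicalPhysics.QuantumFieldTheory.Balaban1983to89.B9SectBGReadYR (readG342Y_KACU writeG342Y_KACU)
open Literature.MathematicalPhysics.QuantumFieldTheory.Balaban1983to89.B9SectBGpTransferInY (eBlock_mono)
open Literature.MathematicalPhysics.QuantumFieldTheory.Balaban1983to89.B9SectBGWordDiffY (bondFunCoordsY_cdB bondFunCoordsY_cdsB_inr)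
open Literature.MathematicalPhysics.QuantumFieldTheory.Balaban1983to89.B9SectBGWordDeltaAY (bondOpCoordsRY bondOpCoordsRY_apply restrictScalars_bondOpCoordsY GbC LapBC
  restrictScalars_mul')

variable {d ℓ : ℕ} {hd : 1 ≤ d + 1} {hL : Odd (ℓ + 1) ∧ 1 < ℓ + 1} {b₀ b₁ : ℝ} {Mstar : ℕ}
variable {𝔸 : Type} [NormedRing 𝔸] (P : RegExtraY d ℓ hd hL b₀ b₁ Mstar 𝔸) [NormedAlgebra ℂ 𝔸] [CompleteSpace 𝔸]
variable {ι : Type} [Fintype ι]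

/-! ## §1 Block majorants along a reindexing of the carrier -/

section Reindex

variable {g : B6.Geometry} {X X' : Type}

end Reindex

/-! ## §2 The bond reindexing `FBondY × ι ≃ (κ × SiteY) × ι` and the conjugation formula -/

section Bond

variable (i : KIdx d ℓ hd hL b₀ b₁) (b : Module.Basis ι ℝ 𝔸)

variable {Rr : ℝ} {Hp : Prop} [Fintype (geo9K i).Site]

end Bond

/-! ## §3 def-Y's difference letters ARE r06's, up to the sign of `c_f` -/

section Letters

variable (i : KIdx d ℓ hd hL b₀ b₁)

variable (b : Module.Basis ι ℝ 𝔸) {Rr : ℝ} {Hp : Prop} [Fintype (geo9K i).Site] (ιB : BlkY i → IBondY i)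

end Letters

/-! ## §4 ★★ The fields `readG342` ∕ `writeG342` of the G frame at the letters `GbC`, `LapBC` -/

section Fields

variable (G : Subgroup 𝔸ˣ) (x : MemberY d ℓ hd hL b₀ b₁ Mstar) (parS : SiteParY 𝔸 x.toKIdx) (parB : BondParY 𝔸 x.toKIdx)
  (b : Module.Basis ι ℝ 𝔸) (ιB : BlkY x.toKIdx → IBondY x.toKIdx) (C37 C38 : ℝ → CfgY 𝔸 x.toKIdx → AfldY 𝔸 x.toKIdx → Prop)
  [Fintype (geo9Y x).Site] {Rr : ℝ} {Hp : Prop}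

/-- ★★ **FIELD `readG342` OF THE G FRAME AT NODE 00's LETTERS** (at a `G`-valued base `U`; the instance destructures the coded (3.35) hypothesis to it):
the (3.42) block of `KACU G x (GAY parS parB (GpY parS)) parB C37 C38` at `base U` with `(B₀, δ)` gives r06's block majorants of `GbC (base U)`, of
`conj b (diffLetter (bT shiftY) (bU (coordC (base U))) η⁻¹ k) * GbC` for the PRINTED `k = inl ν`, of `GbC * conj b (diffLetter … k)` for the PRINTED `k = inr ν`,
and of `LapBC (base U) * GbC (base U)`, on `(κ × SiteY) × ι` with `(M₂Σ_j‖b_j‖·B₀, δ)` and the profiles `ℓ², ℓ, ℓ, 1`.  (The cross products `k = inr ν` on the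
left ∕ `k = inl ν` on the right are NOT print's (3.42) entries; they are supplied separately.)
[cite: Balaban1985BackgroundPropagators, Thm 3.3 p.399 with (3.42) p.397, Thm 3.4 p.400; Balaban1984PropagatorsII, (2.51) p.232] -/
theorem readG342_GbC_printed (hι : ∀ s, β x.toKIdx.hN x.toKIdx.D x.toKIdx.hk (ιB s) = s)
    {M₂ : ℝ} (hM₂ : 0 ≤ M₂) (hrepr : ∀ (v : 𝔸) (j : ι), |b.repr v j| ≤ M₂ * ‖v‖) (U : CfgY 𝔸 x.toKIdx) (hUG : GVal G x.toKIdx U)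
    {B₀ δ : ℝ} (hB₀ : 0 ≤ B₀) (hE : EBlock (KACU P G x (GAY x.toKIdx parS parB (GpY x.toKIdx parS)) parB C37 C38) B₀ δ (.base U)) :
    HasMajorant (g := toB6 (geo9Y x) Rr Hp) (fun q : (Fin (d + 1) × SiteY x.toKIdx) × ι => blkC x.toKIdx ιB q.1.2) (GbC x.toKIdx parS parB b (.base U))
        (fun a a' => M₂ * (∑ j, ‖b j‖) * B₀ * (geo9Y x).len a ^ 2 * Real.exp (-(δ * (geo9Y x).dist a a'))) ∧
      (∀ ν : Fin (d + 1), HasMajorant (g := toB6 (geo9Y x) Rr Hp) (fun q : (Fin (d + 1) × SiteY x.toKIdx) × ι => blkC x.toKIdx ιB q.1.2)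
        (conj b (diffLetter (bT (shiftY x.toKIdx)) (bU (coordC G x.toKIdx (.base U))) ((((geo9Y x).eta : ℂ))⁻¹) (Sum.inl ν)) *
          GbC x.toKIdx parS parB b (.base U))
        (fun a a' => M₂ * (∑ j, ‖b j‖) * B₀ * (geo9Y x).len a * Real.exp (-(δ * (geo9Y x).dist a a')))) ∧
      (∀ ν : Fin (d + 1), HasMajorant (g := toB6 (geo9Y x) Rr Hp) (fun q : (Fin (d + 1) × SiteY x.toKIdx) × ι => blkC x.toKIdx ιB q.1.2)
        (GbC x.toKIdx parS parB b (.base U) *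
          conj b (diffLetter (bT (shiftY x.toKIdx)) (bU (coordC G x.toKIdx (.base U))) ((((geo9Y x).eta : ℂ))⁻¹) (Sum.inr ν)))
        (fun a a' => M₂ * (∑ j, ‖b j‖) * B₀ * (geo9Y x).len a * Real.exp (-(δ * (geo9Y x).dist a a')))) ∧
      HasMajorant (g := toB6 (geo9Y x) Rr Hp) (fun q : (Fin (d + 1) × SiteY x.toKIdx) × ι => blkC x.toKIdx ιB q.1.2)
        (LapBC x.toKIdx b (.base U) * GbC x.toKIdx parS parB b (.base U))
        (fun a a' => M₂ * (∑ j, ‖b j‖) * B₀ * 1 * Real.exp (-(δ * (geo9Y x).dist a a'))) := by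
  letI : Fintype (geo9K x.toKIdx).Site := ‹Fintype (geo9Y x).Site›
  obtain ⟨h0, h1, h2, h3⟩ := readG342Y_KACU P (Rr := Rr) (Hp := Hp) b G x (GAY x.toKIdx parS parB (GpY x.toKIdx parS)) parB C37 C38 ιB hι hM₂ hrepr hB₀ hE
  have hco : coordC G x.toKIdx (.base U) = UboxY x.toKIdx U := coordC_base_eq G x hUG
  have hη : ((((geo9Y x).eta : ℂ)))⁻¹ = ((|x.toKIdx.cf| : ℝ) : ℂ) := eta_inv_eq_abs_cf x.toKIdx
  have hGb := GbC_eq_conj_bondOpCoordsRY x parS parB b (.base U)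
  rw [decY_base] at hGb
  have hK : ∀ (w : IBondY x.toKIdx → ℝ) {T : Module.End ℝ ((Fin (d + 1) × SiteY x.toKIdx) × ι → ℝ)},
      HasMajorant (g := toB6 (geo9Y x) Rr Hp) (fun q : (Fin (d + 1) × SiteY x.toKIdx) × ι => blkC x.toKIdx ιB q.1.2) T
        (fun a a' => M₂ * (∑ j, ‖b j‖) * (B₀ * w a * Real.exp (-(δ * (geo9Y x).dist a a')))) →
      HasMajorant (g := toB6 (geo9Y x) Rr Hp) (fun q : (Fin (d + 1) × SiteY x.toKIdx) × ι => blkC x.toKIdx ιB q.1.2) T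
        (fun a a' => M₂ * (∑ j, ‖b j‖) * B₀ * w a * Real.exp (-(δ * (geo9Y x).dist a a'))) :=
    fun w T h => hasMajorant_mono _ h fun a a' => le_of_eq (by ring)
  refine ⟨?_, fun ν => ?_, fun ν => ?_, ?_⟩
  · exact hK (fun a => (geo9Y x).len a ^ 2) (hasMajorant_of_eq x.toKIdx hGb (hasMajorant_conj_bondOpCoordsRY x.toKIdx b ιB _ h0))
  · refine hK (fun a => (geo9Y x).len a) (hasMajorant_of_eq x.toKIdx (by rw [hco, hη, hGb]) ?_)
    exact hasMajorant_diffLetter_inl_mul x.toKIdx b ιB U ν _ (h1 ν)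
  · refine hK (fun a => (geo9Y x).len a) (hasMajorant_of_eq x.toKIdx (by rw [hco, hη, hGb]) ?_)
    exact hasMajorant_mul_diffLetter_inr x.toKIdx b ιB U ν _ (h2 ν)
  · have h := hasMajorant_conj_bondOpCoordsRY x.toKIdx b ιB _ h3
    refine hK (fun _ => (1 : ℝ)) (hasMajorant_of_eq x.toKIdx (T := conj b _) ?_ h)
    rw [hGb, LapBC, decY_base, ← B9Eq352DivFormLetters.conj_mul, ← bondOpCoordsRY_mul]
    rfl

/-- ★★ **FIELD `writeG342` OF THE G FRAME AT NODE 00's LETTERS**: at a (base `U`, multiplier `a`) pair with `U` `G`-valued, r06's four block majorants at the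
product (`GbC (prod U a)`, the left products for the printed `k = inl ν`, the right products for the printed `k = inr ν`, `LapBC (base U) * GbC (prod U a)`;
difference letters and Laplacian at the BASE) with `(B, δ)` give the (3.42) block of `KACU` at the coded product with `(M₂Σ_j‖b_j‖·B, δ)` — gen 12's writer
`writeG342Y_KACU` transported. [cite: Balaban1985BackgroundPropagators, Thm 3.4 p.400 with (3.42) p.397, p.403; Balaban1984PropagatorsII, (2.51) p.232] -/
theorem writeG342_GbC (hι : ∀ s, β x.toKIdx.hN x.toKIdx.D x.toKIdx.hk (ιB s) = s)
    {M₂ : ℝ} (hM₂ : 0 ≤ M₂) (hrepr : ∀ (v : 𝔸) (j : ι), |b.repr v j| ≤ M₂ * ‖v‖) (U : CfgY 𝔸 x.toKIdx) (hUG : GVal G x.toKIdx U)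
    (a : AfldY 𝔸 x.toKIdx) {B δ : ℝ} (hB : 0 ≤ B)
    (h0 : HasMajorant (g := toB6 (geo9Y x) Rr Hp) (fun q : (Fin (d + 1) × SiteY x.toKIdx) × ι => blkC x.toKIdx ιB q.1.2)
      (GbC x.toKIdx parS parB b (.prod U a)) (fun a a' => B * (geo9Y x).len a ^ 2 * Real.exp (-(δ * (geo9Y x).dist a a'))))
    (h1 : ∀ ν : Fin (d + 1), HasMajorant (g := toB6 (geo9Y x) Rr Hp) (fun q : (Fin (d + 1) × SiteY x.toKIdx) × ι => blkC x.toKIdx ιB q.1.2)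
      (conj b (diffLetter (bT (shiftY x.toKIdx)) (bU (coordC G x.toKIdx (.base U))) ((((geo9Y x).eta : ℂ))⁻¹) (Sum.inl ν)) *
        GbC x.toKIdx parS parB b (.prod U a))
      (fun a a' => B * (geo9Y x).len a * Real.exp (-(δ * (geo9Y x).dist a a'))))
    (h2 : ∀ ν : Fin (d + 1), HasMajorant (g := toB6 (geo9Y x) Rr Hp) (fun q : (Fin (d + 1) × SiteY x.toKIdx) × ι => blkC x.toKIdx ιB q.1.2)
      (GbC x.toKIdx parS parB b (.prod U a) *
        conj b (diffLetter (bT (shiftY x.toKIdx)) (bU (coordC G x.toKIdx (.base U))) ((((geo9Y x).eta : ℂ))⁻¹) (Sum.inr ν)))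
      (fun a a' => B * (geo9Y x).len a * Real.exp (-(δ * (geo9Y x).dist a a'))))
    (h3 : HasMajorant (g := toB6 (geo9Y x) Rr Hp) (fun q : (Fin (d + 1) × SiteY x.toKIdx) × ι => blkC x.toKIdx ιB q.1.2)
      (LapBC x.toKIdx b (.base U) * GbC x.toKIdx parS parB b (.prod U a)) (fun a a' => B * 1 * Real.exp (-(δ * (geo9Y x).dist a a')))) :
    EBlock (KACU P G x (GAY x.toKIdx parS parB (GpY x.toKIdx parS)) parB C37 C38) (M₂ * (∑ j, ‖b j‖) * B) δ (.prod U a) := by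
  letI : Fintype (geo9K x.toKIdx).Site := ‹Fintype (geo9Y x).Site›
  have hco : coordC G x.toKIdx (.base U) = UboxY x.toKIdx U := coordC_base_eq G x hUG
  have hη : ((((geo9Y x).eta : ℂ)))⁻¹ = ((|x.toKIdx.cf| : ℝ) : ℂ) := eta_inv_eq_abs_cf x.toKIdx
  set W := decY x.toKIdx (.prod U a) with hW
  have hGb := GbC_eq_conj_bondOpCoordsRY x parS parB b (.prod U a)
  refine writeG342Y_KACU P (Rr := Rr) (Hp := Hp) b G x (GAY x.toKIdx parS parB (GpY x.toKIdx parS)) parB C37 C38 ιB hι hM₂ hrepr U a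
    ((GAY x.toKIdx parS parB (GpY x.toKIdx parS) W).restrictScalars ℝ) (fun Λ => rfl)
    (fun ν => cdBₗ x.toKIdx U ν) (fun ν => cdsBₗ x.toKIdx U ν) (fun ν Λ => cdBₗ_apply x.toKIdx U ν Λ) (fun ν Λ => cdsBₗ_apply x.toKIdx U ν Λ)
    (lapBₗ x.toKIdx U) (fun Λ => lapBₗ_apply x.toKIdx U Λ) hB ?_ (fun ν => ?_) (fun ν => ?_) ?_
  · exact hasMajorant_conj_of_bondOpCoordsRY x.toKIdx b ιB _ (hasMajorant_of_eq x.toKIdx hGb.symm h0)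
  · refine hasMajorant_cdBₗ_comp_of x.toKIdx b ιB U ν _ (hasMajorant_of_eq x.toKIdx ?_ (h1 ν))
    rw [hco, hη, hGb]
  · refine hasMajorant_comp_cdsBₗ_of x.toKIdx b ιB U ν _ (hasMajorant_of_eq x.toKIdx ?_ (h2 ν))
    rw [hco, hη, hGb]
  · rw [← B9Eq352DivFormLetters.conj_mul]
    refine hasMajorant_conj_of_bondOpCoordsRY x.toKIdx b ιB _ (hasMajorant_of_eq x.toKIdx ?_ h3)
    rw [hGb, LapBC, decY_base, ← B9Eq352DivFormLetters.conj_mul, ← bondOpCoordsRY_mul]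

end Fields

end Literature.MathematicalPhysics.QuantumFieldTheory.Balaban1983to89.B9SectBGReadCodedYR

end

/-!
# `Balaban1983to89.B9SectBKerFrameCodedYR` — THE CLASS-PARAMETRIC TWIN of `B9SectBKerFrameCodedY` (CASCADE-R, director-ym №279 GO-R; №277 (3) `hunitA` cure; dag-n06-d SOCKET-(α) class question)

statement-level skeleton of published theorems with citation tags; proofs where landed; nothing here is a claim about the
Yang–Mills mass gap

WHAT THIS FILE IS.  The original module `B9SectBKerFrameCodedY` types its objects over MODULE 3's member carrier `bg9Y 𝔸 G x` (MODULE 2's small-cube class (3.35)).  This file RE-DECLARES, with UNCHANGED NAMES inside the namespace `…B9SectBKerFrameCodedYR`, exactly its 6 class-dependent declarations over the CLASS-PARAMETRIC carrier `B9SectBCodedClassR.bg9YC 𝔸 G P x` (`P : RegExtraY …` = the two cube conditions of (3.35)∕(3.36) as a parameter; `bg9Y 𝔸 G x = bg9YC 𝔸 G (extraY 𝔸 G) x` by `rfl`, so every declaration here specialises definitionally to its original; at the record's reading of PRINT's class, `P := extraYPb 𝔸 G`, the displayed laws `hreg335P` ((3.35) on plaquettes) and the class-keyed `hunitA` become theorems).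  The text is the original's VERBATIM under the token surgery `bg9Y 𝔸 G ↦ bg9YC 𝔸 G P`, `NAME ↦ NAME P` for the class-dependent names (P the first explicit argument), and — №277 — the binder `hunitA` re-keyed from «all G-valued U» to «all (3.35)-regular U of the carrier» (`∀ j α₀ U, (bg9YC 𝔸 G P (f j)).Reg335 c35 α₀ U → IsUnit (deltaAY …)`) — a clause IDLE in this twin (no `hunitA` here; v1.1).  Class-free declarations of the original are NOT copied: they are imported and used BY NAME (`open … hiding` the re-declared ones).  Generated by dag-n06-c g16's `gen.py` (HOME `pub-ymgap-dag-n06-c/lean/g16/`); the ORIGINAL MODULE DOCUMENTATION FOLLOWS VERBATIM and describes the mathematics.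

HONEST SCOPE.  Re-typing bookkeeping; nothing of [B9] asserted beyond the original; COUNT-NEUTRAL; N06 NOT discharged; nothing continuum ∕ OS ∕ mass gap ∕ Clay.  Cell `pub-ymgap` (D-0062), Track A node N06 [B9], seat `pub-ymgap-dag-n06-c` g16, 2026-08-29.
-/

/-!
# Balaban [B9], Thm 3.2 (3.48) p. 398 + (3.65)–(3.67) p. 403 — ★★★ THE C⁻¹ = (Q′G′²Q′*)⁻¹ MEMBER OF THE SECT.-B STEP OF RECORD (R13-U1) OVER THE CODED
# CARRIERS OF NODE 00: the (3.48) kernel READ ∕ WRITE dictionary (§1), the (3.57)∕(3.59) variation letters under the transporter-variation law `VarParY` (§2),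
# discharged from g7's `CplxLettersY` (§2b), the instance ★★ `cinvFrame₃CodedOn` of `B9SectBKerFrameV3.CinvFrame₃` and the steps ★★ `stepKerPos_KSC_cinv_on`, ★★★ `stepKerPos_KSCU_on` (§3)
# (pub-ymgap N06 row 13: the (3.48) member of `B9SectBCodedReadingsU.SectBStepU`, G′ side, at the record's kernel `Cinv := CinvY`)

T. Bałaban, *Propagators for lattice gauge theories in a background field*, Commun. Math. Phys. **99** (1985) 389–434
[`Balaban1985BackgroundPropagators`, "B9"]; [4] = T. Bałaban, *Propagators and renormalization transformations for lattice gauge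
theories. II*, Commun. Math. Phys. **96** (1984) 223–250 [`Balaban1984PropagatorsII`].

statement-level skeleton of published theorems with citation tags; proofs where landed; nothing here is a claim about the
Yang–Mills mass gap

THE PRINTED LOCI.  Theorem 3.2 (3.48) p. 398 (*«|(Q′G′²Q′*)⁻¹(U; y, y′)| ≦ B₁(Lʲη)⁻⁴(L^{j′}η)^{−d}e^{−δd(y,y′)}»* — here `d` of print = `d + 1` of the tree,
the space-time dimension); (3.19)–(3.21) pp. 393–394; (3.57)–(3.59) pp. 401–402; p. 403 (*«The inverse satisfies Theorem 3.2»*); [4] (2.51) p. 232, (2.69) p. 235.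

WHAT.  For a subfamily `f : J → MemberY` of node00-def-Y's members, site transporters `par j`, a real basis `b` of `𝔸` (coordinate bound `M₂`) and block
labellings `ι_B j` (sections of `β`):
* §1 `kerCY x par U y y′ := sup_{|E| ≦ 1} ‖(CY par (GpY par) U)(δ_{βy′} ⊗ E)(βy)‖` — BY `rfl` the record's `B9.SiteKernel` reading `siteKernelOfOp … (CY …) β β`
  (`Node00.OpsYOfLetters`; `kerCY_eq`, `pullS_CinvY_ker`); `len_ιB`, ★ `cWtY_mul_len_pow` (`cWtY(s)·(L^{j(s)}η)^{d+1} = η⁻⁴`: the (3.48) reading weight against the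
  scale length); `norm_XinvY_deltaY_basis_le`; ★★ `hasMajorant_CopC_base` — READING: the record's bound `kerCY U ≦ B₁(Lʲη)⁻⁴(L^{j′}η)^{−(d+1)}e^{−δd}` gives the
  block majorant `|ι|·M₂Σ‖b‖·B₁·(Lʲη)⁻⁴e^{−δd}` of the letter `CopC (base U)` for the block map `ι_B ∘ fst` (r06's `B9Thm34InvBlk.hasMajorant_blk_of_entry_le`, fibre
  multiplicity `|ι|`); `XinvY_eq_smul_symm_CopC`, `blockSupp_coordEquiv_deltaY`; ★★ `kerCY_le_of_hasMajorant_CopC` — WRITING: a block majorant `B(Lʲη)⁻⁴e^{−δd}` of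
  `CopC V` bounds `kerCY (dec V) ≦ M₂Σ‖b‖·B·(Lʲη)⁻⁴(L^{j′}η)^{−(d+1)}e^{−δd}` (`len_label` ∕ `dist_label` move the reading from `ι_B(βy)` to `y`).
* §2 the law `VarParY i par c_var β′ U a` ((3.58)∕(3.59): along every block contour the adjoint action of the transporter of `e^{iηa}U` differs from
  that of `U` by `≦ c_var·β′` in operator norm, both for `τ` and `τ⁻¹`), the tools `norm_R_sub_R_le` ∕ `norm_R_sub_R_le_of_var` (for its discharge),
  `QpY_sub_apply`, and ★ `hasMajorantHom_FcC` ∕ `hasMajorantHom_FcsC`: under the law the (3.57) letters `FcC ∕ FcsC (base U) (mult a)` are block-local with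
  `M₂Σ‖b‖·c_var·β′·𝟙[a = a′]` (field `hF`); §2b ★★ `varParY_of_cplxLettersY`: the law at `(C_q, β′)` from g7's `CplxLettersY` (its `kF ∕ sF` conjuncts) for
  transporter tables with `U(Γ_{z,w}) = U(Γ_{w,z})⁻¹`.
* §3 `CinvY f G par j` (the record's kernel family); ★★ `cinvFrame₃CodedOn` — `CinvFrame₃` over the coded carriers for g7's coded readings `KSC`, block carrier
  `BlkY × ι` ∕ `ι_B ∘ fst`, `dB := d + 1`, the letters of `B9SectBKerLettersY`, the family `pullS 𝔠 (CinvY j)`; root `gpFrame₂CodedOn` with `read342Y_KSC` ∕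
  `write342Y_KSC`; DISPLAYED beyond the root frame's data: `hunitX` (`(Q′G′²Q′*)(U)` is a unit at `G`-valued `U` — Thm 3.2 ∕ 3.11's regime; at the record
  `B9Thm311PosAtRecordV4.isUnit_XY_parSymY`) and the reversal law `hsym` (`U(Γ_{z,w}) = U(Γ_{w,z})⁻¹`; at the record `Node00.parSymY_inv_symm`) — the
  variation law itself is DISCHARGED from g7's `hC37` by §2b ★★ `varParY_of_cplxLettersY`; ★★ `stepKerPos_KSC_cinv_on` (`stepKerPos_of_cinvFrame₃`); ★★★ `stepKerPos_KSCU_on` —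
  `StepKerPos (d+1) c35 (geo9Y∘f) (codingYx…).bg (KSCU∘f) (KACU∘f) (pullS 𝔠 (CinvY j)) (pullS 𝔠 (CinvY j))`, THE (3.48) MEMBER OF `SectBStepU` at `Cinv := CinvY`
  (input transfer `hin_KSCU_on_pos`, identity output).

HONEST FRAMING.  r06's uniform clauses (`thm34_Gp_uniform` R1, `thm34_Cinv_uniform_blk`) do the analysis; this file is their instance at def-Y's letters plus
two dictionaries.  DISPLAYED beyond the root frame's binders: the invertibility `hunitX` (a theorem at the record's `parSymY` for the matrix algebra —
`B9Thm311PosAtRecordV4.isUnit_XY_parSymY` — not re-proved here for a general `𝔸`, `par`) and the reversal law `hsym` (definitional for `parSymY`); the (3.59)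
variation law `VarParY` is NOT displayed: it follows from g7's `hC37` (`varParY_of_cplxLettersY`).  Count-neutral; no summit ∕ sub-problem statement is proved; N06 is not discharged by this file; nothing continuum ∕ OS ∕ mass-gap ∕
Clay.  No `sorry`, no `axiom`, no `… : Prop` fact beyond the displayed law `VarParY` (a definition with parameters), no `instance`, no `notation`.
Seat dag-n06-c g12, 2026-08-28; `--supports stmt-QuantumFields-27364`.

RELATED IN THE TREE, NOT DUPLICATED.  `B9SectBKerFrameV3` (the frame), `B9SectBKerLettersY` (the letters), `B9SectBKerStepRecordReduction` (g11: the OLD-reader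
record step reduced to the coded `KSC` step — superseded under R13-U1 by `stepKerPos_KSCU_on` here, same transfer pattern), `B9SectBStepsKSCU` (`hin_KSCU_on_pos`),
pv `B9Thm39CinvSandwichQ` ∕ r03 `B9Thm39ReadingAtLetters` (`CY_deltaY_apply`), dag-n06 `B9Ineq349SiteComposite` (`cWtY_mul_W`), g7 `B9SectBGpReadingsY`
(`len_label`, `dist_label`, `etaS_eq_eta`).
-/

noncomputable section

namespace Literature.MathematicalPhysics.QuantumFieldTheory.Balaban1983to89.B9SectBKerFrameCodedYR

open Literature.MathematicalPhysics.QuantumFieldTheory.Balaban1983to89.B9SectBCodedClassR (RegExtraY bg9YC)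
open Literature.MathematicalPhysics.QuantumFieldTheory.Balaban1983to89.B9SectBKerFrameCodedY hiding kerCY_eq CinvY pullS_CinvY_ker cinvFrame₃CodedOn stepKerPos_KSC_cinv_on stepKerPos_KSCU_on

open Literature.MathematicalPhysics.QuantumFieldTheory.Balaban1983to89.B6RandomWalk (HasMajorant BlockSupp hasMajorant_mono)
open Literature.MathematicalPhysics.QuantumFieldTheory.Balaban1983to89.B6RandomWalkHom (HasMajorantHom hasMajorantHom_mono)
open Literature.MathematicalPhysics.QuantumFieldTheory.Balaban1983to89.B9Thm34Ext (toB6)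
open Literature.MathematicalPhysics.QuantumFieldTheory.Balaban1983to89.B9Thm34Inv (entry)
open Literature.MathematicalPhysics.QuantumFieldTheory.Balaban1983to89.B9Thm34InvBlk (hasMajorant_blk_of_entry_le)
open Literature.MathematicalPhysics.QuantumFieldTheory.Balaban1983to89.B9Eq39Adjoint (R fluct)
open Literature.MathematicalPhysics.QuantumFieldTheory.Balaban1983to89.B9Eq352DivFormLetters (conj conj_apply coordEquiv coordEquiv_apply coordEquiv_symm_apply
  norm_coordSymm_apply_le)
open Literature.MathematicalPhysics.QuantumFieldTheory.Balaban1983to89.B6KLevelCensusIndexV1 (KIdx kGeo)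
open Literature.MathematicalPhysics.QuantumFieldTheory.Balaban1983to89.B6Ineq2142KLevelV1 (β beta_level lvl)
open Literature.MathematicalPhysics.QuantumFieldTheory.Balaban1983to89.B6Ineq268MultiLevelBox (W W_eq W_pos)
open Literature.MathematicalPhysics.QuantumFieldTheory.Balaban1983to89.B9SectBCodedCarrier (CCfg pullS)
open Literature.MathematicalPhysics.QuantumFieldTheory.Balaban1983to89.B9Eq360DeltaPrimeAY (AfldY blkY blkY_apply mulY kFY kQY sFY sQY Rclm Rclm_apply)
open Literature.MathematicalPhysics.QuantumFieldTheory.Balaban1983to89.B9PinMembersKLevelV1 (MemberY geo9Y bg9Y)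
open Literature.MathematicalPhysics.QuantumFieldTheory.Balaban1983to89.B9SectBGpLettersY (decY decY_base GVal blkC GopC norm_le_one_and_inv_of_mem kFC sFC wC)
open Literature.MathematicalPhysics.QuantumFieldTheory.Balaban1983to89.B9Thm311ReadingAtLetters (wB wB_pos)
open Literature.MathematicalPhysics.QuantumFieldTheory.Balaban1983to89.B9SectBGpFrameCodedYR (codingYx)
open Literature.MathematicalPhysics.QuantumFieldTheory.Balaban1983to89.B9SectBGpFrameCodedY (CplxLettersY)
open Literature.MathematicalPhysics.QuantumFieldTheory.Balaban1983to89.B9SectBCodedChainOnSubfamilyR (gpFrame₂CodedOn)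
open Literature.MathematicalPhysics.QuantumFieldTheory.Balaban1983to89.B9SectBGpReadingsYR (read342Y_KSC write342Y_KSC)
open Literature.MathematicalPhysics.QuantumFieldTheory.Balaban1983to89.B9SectBCodedReadingsUR (KSCU KACU)
open Literature.MathematicalPhysics.QuantumFieldTheory.Balaban1983to89.B9SectBStepsKSCUR (hin_KSCU_on_pos)
open Literature.MathematicalPhysics.QuantumFieldTheory.Balaban1983to89.B9SectBStepPosFamilyTransfer (stepKerPos_of_family_pos)
open Literature.MathematicalPhysics.QuantumFieldTheory.Balaban1983to89.B9SectBStepWhole (StepKerPos)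
open Literature.MathematicalPhysics.QuantumFieldTheory.Balaban1983to89.B9SectBKerFrameV3 (CinvFrame₃ stepKerPos_of_cinvFrame₃)
open Literature.MathematicalPhysics.QuantumFieldTheory.Balaban1983to89.B9SectBGpReadingsYR (KSC)
open Literature.MathematicalPhysics.QuantumFieldTheory.Balaban1983to89.B9SectBGpReadingsY (etaS_eq_eta len_label dist_label)
open Literature.MathematicalPhysics.QuantumFieldTheory.Balaban1983to89.B9Ineq349SiteComposite (cWtY_mul_W cWtY_pos)
open Literature.MathematicalPhysics.QuantumFieldTheory.Balaban1983to89.B9GeoLemma21KLevelV1 (geo9Y_len_pos geo9K_eta_pos)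
open Literature.MathematicalPhysics.QuantumFieldTheory.Balaban1983to89.B9Thm39ReadingAtLetters (CY_deltaY_apply)
open Literature.MathematicalPhysics.QuantumFieldTheory.Balaban1983to89.B9SectBKerLettersY (QcC QcsC CopC FcC FcsC entry_CopC norm_apply_deltaY_basis_le
  bddAbove_norm_apply_deltaY copC_eq XC_mul_CopC qcC_prod qcsC_prod hasMajorantHom_QcC_base hasMajorantHom_QcsC_base)
open Literature.MathematicalPhysics.QuantumFieldTheory.Balaban1983to89.B9Thm39CinvSandwichQ (sum_abs_qpK_le_one QpY_apply_eq_zero_of QpsY_apply)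
open Literature.MathematicalPhysics.QuantumFieldTheory.Balaban1983to89.B9Eq3104CutoffCommutatorSizes (qpK_ne_zero_imp)
open Literature.MathematicalPhysics.QuantumFieldTheory.Balaban1983to89.B9Eq376POneLetters (conjHom conjHom_apply)
open Literature.MathematicalPhysics.QuantumFieldTheory.Balaban1983to89.B9GeoNormsKLevelV1 (geo9K)
open Literature.MathematicalPhysics.QuantumFieldTheory.Balaban1983to89.Node00 (SiteY BlkY IBondY CfgY BallY SiteParY BondOpY BondParY GpY QpY QpsY XY XinvY CY
  cWtY etaS deltaY siteKernelOfOp qpK qpT blkCornerY trLiftY trLiftY_apply deltaPrimeAY)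

variable {d ℓ : ℕ} {hd : 1 ≤ d + 1} {hL : Odd (ℓ + 1) ∧ 1 < ℓ + 1} {b₀ b₁ : ℝ} {Mstar : ℕ}
variable {𝔸 : Type} [NormedRing 𝔸] (P : RegExtraY d ℓ hd hL b₀ b₁ Mstar 𝔸) [NormedAlgebra ℂ 𝔸] [CompleteSpace 𝔸]

/-! ## §1 The (3.48) kernel of the record READ ∕ WRITTEN against block majorants of `CopC` -/

section Kernel

variable (x : MemberY d ℓ hd hL b₀ b₁ Mstar) (par : SiteParY 𝔸 x.toKIdx) {ι : Type} [Fintype ι] (b : Module.Basis ι ℝ 𝔸)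
  (ιB : BlkY x.toKIdx → IBondY x.toKIdx) {Rr : ℝ} {Hp : Prop}

/-- the record's two-point kernel IS `kerCY`. [cite: Balaban1985BackgroundPropagators, (3.48) p.398, bookkeeping] -/
theorem kerCY_eq (G : Subgroup 𝔸ˣ) (U : CfgY 𝔸 x.toKIdx) (y y' : IBondY x.toKIdx) :
    (siteKernelOfOp x.toKIdx (bg9YC 𝔸 G P x) (fun U => U) (CY x.toKIdx par (GpY x.toKIdx par))
        (β x.toKIdx.hN x.toKIdx.D x.toKIdx.hk) (β x.toKIdx.hN x.toKIdx.D x.toKIdx.hk)).ker U y y' = kerCY x par U y y' := rfl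

end Kernel

/-! ## §2 The (3.57)∕(3.59) variation letters under a DISPLAYED transporter-variation law -/

section Variation

variable (i : KIdx d ℓ hd hL b₀ b₁) (par : SiteParY 𝔸 i) {ι : Type} [Fintype ι] (b : Module.Basis ι ℝ 𝔸) (ιB : BlkY i → IBondY i) {Rr : ℝ} {Hp : Prop}

end Variation

/-! ## §2b The variation law DISCHARGED from g7's (3.37)-letters `CplxLettersY` for transporter tables with `U(Γ_{z,w}) = U(Γ_{w,z})⁻¹` -/

section Discharge

variable (G : Subgroup 𝔸ˣ) (x : MemberY d ℓ hd hL b₀ b₁ Mstar) (par : SiteParY 𝔸 x.toKIdx) (ιB : BlkY x.toKIdx → IBondY x.toKIdx)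

end Discharge

/-! ## §3 The instance of `CinvFrame₃` over the coded carriers of a subfamily, and the (3.48) block-steps for `KSC` and ★★★ `KSCU` -/

section Instance

variable [NormOneClass 𝔸] [FiniteDimensional ℝ 𝔸] {J : Type} (f : J → MemberY d ℓ hd hL b₀ b₁ Mstar)
  [∀ x : MemberY d ℓ hd hL b₀ b₁ Mstar, Fintype (geo9Y x).Site]
  [instDS : ∀ x : MemberY d ℓ hd hL b₀ b₁ Mstar, DecidableEq (geo9Y x).Site] [instNE : ∀ x : MemberY d ℓ hd hL b₀ b₁ Mstar, Nonempty (geo9Y x).Site]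
  (c35 : ℝ) (G : Subgroup 𝔸ˣ) (par : ∀ j : J, SiteParY 𝔸 (f j).toKIdx) (OA : ∀ j : J, BondOpY 𝔸 (f j).toKIdx)
  (parB : ∀ j : J, BondParY 𝔸 (f j).toKIdx) {ι : Type} [Fintype ι] [DecidableEq ι] (b : Module.Basis ι ℝ 𝔸)
  (ιB : ∀ j : J, BlkY (f j).toKIdx → IBondY (f j).toKIdx)
  (C37 C38 : ∀ j : J, ℝ → CfgY 𝔸 (f j).toKIdx → AfldY 𝔸 (f j).toKIdx → Prop)

/-- **THE RECORD's (3.48) KERNEL FAMILY OF THE LETTER `C = CY par (GpY par)` AT THE CARRIER BLOCKS** on the subfamily: the `siteKernelOfOp` reading of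
`Node00.OpsYOfLetters` (`= (operatorLayerYOfLetters …).Cinv` at the record, whose `𝔏.C = CY (parS) (Gp)`); the `Cinv` slot of `B9SectBCodedReadingsU.SectBStepU`.
[cite: Balaban1985BackgroundPropagators, Thm 3.2 (3.48) p.398, (3.21) p.394] -/
def CinvY (j : J) : B9.SiteKernel (geo9Y (f j)) (bg9YC 𝔸 G P (f j)) :=
  siteKernelOfOp (f j).toKIdx (bg9YC 𝔸 G P (f j)) (fun U => U) (CY (f j).toKIdx (par j) (GpY (f j).toKIdx (par j)))
    (β (f j).toKIdx.hN (f j).toKIdx.D (f j).toKIdx.hk) (β (f j).toKIdx.hN (f j).toKIdx.D (f j).toKIdx.hk)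

omit [NormOneClass 𝔸] [FiniteDimensional ℝ 𝔸] [∀ x : MemberY d ℓ hd hL b₀ b₁ Mstar, Fintype (geo9Y x).Site] instDS instNE [DecidableEq ι] in
/-- the record's kernel read along the decoding IS `kerCY` at the decoded configuration (`rfl`). [cite: Balaban1985BackgroundPropagators, (3.48) p.398, bookkeeping] -/
theorem pullS_CinvY_ker (j : J) (c : (codingYx P G (f j) (C37 j) (C38 j)).bg.Cfg) (y y' : IBondY (f j).toKIdx) :
    (pullS (codingYx P G (f j) (C37 j) (C38 j)) (CinvY P f G par j)).ker c y y' = kerCY (f j) (par j) (decY (f j).toKIdx c) y y' := by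
  cases c <;> rfl

/-- ★★ **THE LETTERS DICTIONARY `CinvFrame₃` OVER THE CODED CARRIERS OF A SUBFAMILY, INHABITED** for g7's coded readings `KSC` of G′, the block carrier
`P j := BlkY × ι` with block map `ι_B ∘ fst`, the letters `QcC ∕ QcsC ∕ CopC ∕ FcC ∕ FcsC` of `B9SectBKerLettersY`, kernel dimension `dB := d + 1`, and the family
`pullS 𝔠 (CinvY j)` (the record's (3.48) kernel of `C = CY par (GpY par)` read along the decoding).  Root = `gpFrame₂CodedOn` (dictionaries `read342Y_KSC` ∕
`write342Y_KSC`).  Fields: `hQc ∕ hQcs` = §3 of `B9SectBKerLettersY` (contractive transporters at a (3.35)-regular, hence `G`-valued, base); `cop_eq` = `copC_eq`;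
`reg_cinv` = `XC_mul_CopC` under the DISPLAYED invertibility `hunitX` of `(Q′G′²Q′*)(U)` at `G`-valued `U` (Thm 3.2 ∕ 3.11's regime; at the record
`B9Thm311PosAtRecordV4.isUnit_XY_parSymY`); `q_mul` = `qcC_prod ∕ qcsC_prod`; `hF` = §2 with the law supplied by §2b from `hC37` under the reversal law `hsym`; `readKer` ∕
`writeKer` = §1.  Constants: `κ_Q = M₂Σ‖b‖`, `c_F = M₂Σ‖b‖·C_q + 1`, `c_K = |ι|·M₂Σ‖b‖`, `w_K(B, δ) = M₂Σ‖b‖·B + 1`, `w_Kδ(δ) = δ`.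
[cite: Balaban1985BackgroundPropagators, Thm 3.2 (3.48) p.398, (3.19)–(3.21) pp.393–394, (3.57)–(3.59) pp.401–402, (3.65)–(3.67) p.403, Thm 3.11 p.416; Balaban1984PropagatorsII, (2.51) p.232, (2.69) p.235] -/
noncomputable def cinvFrame₃CodedOn (hι : ∀ (j : J) (s : BlkY (f j).toKIdx), β (f j).toKIdx.hN (f j).toKIdx.D (f j).toKIdx.hk (ιB j s) = s)
    (hG1 : ∀ u : 𝔸ˣ, u ∈ G → ‖(u : 𝔸)‖ ≤ 1) (hpar : ∀ j (U : CfgY 𝔸 (f j).toKIdx), GVal G (f j).toKIdx U → ∀ z w, par j U z w ∈ G)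
    (hunit : ∀ j (U : CfgY 𝔸 (f j).toKIdx), GVal G (f j).toKIdx U → IsUnit (deltaPrimeAY (f j).toKIdx (par j) U))
    (M₂ : ℝ) (hM₂ : 0 ≤ M₂) (hrepr : ∀ (v : 𝔸) (j : ι), |b.repr v j| ≤ M₂ * ‖v‖) (hcR : 0 < M₂ * ∑ j, ‖b j‖)
    (Cq : ℝ) (hCq : 0 ≤ Cq) (hC37 : ∀ j β' U a, C37 j β' U a → GVal G (f j).toKIdx U ∧ CplxLettersY G (f j) (par j) (ιB j) Cq β' U a)
    (MInv aInv aW : ℝ) (hMInv : 0 < MInv) (haInv : 0 < aInv) (haW : 0 < aW)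
    (hunitX : ∀ j (U : CfgY 𝔸 (f j).toKIdx), GVal G (f j).toKIdx U → IsUnit (XY (f j).toKIdx (par j) (GpY (f j).toKIdx (par j)) U))
    (hsym : ∀ j (U : CfgY 𝔸 (f j).toKIdx) (z w : SiteY (f j).toKIdx), par j U z w = (par j U w z)⁻¹) :
    CinvFrame₃ c35 (fun j => geo9Y (f j)) (fun j => (codingYx P G (f j) (C37 j) (C38 j)).bg) (fun j => KSC P G (f j) (par j) (C37 j) (C38 j)) b (Fin (d + 1))
      (fun j => SiteY (f j).toKIdx) (fun j => BlkY (f j).toKIdx × ι) (fun j => pullS (codingYx P G (f j) (C37 j) (C38 j)) (CinvY P f G par j)) :=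
  { gpFrame₂CodedOn P f c35 G b C37 C38 par ιB (fun j => KSC P G (f j) (par j) (C37 j) (C38 j)) hι hG1 hpar hunit (d + 1) M₂ hM₂ hrepr Cq hCq hC37
      (M₂ * ∑ j, ‖b j‖) hcR (fun B _ => (M₂ * ∑ j, ‖b j‖) * B + 1) (fun B _ hB _ => by positivity) (fun δ => δ) (fun δ hδ => hδ)
      MInv aInv aW hMInv haInv haW (fun j => read342Y_KSC P G (f j) (par j) b (ιB j) (C37 j) (C38 j) (hι j) M₂ hM₂ hrepr c35 MInv aInv)
      (fun j => write342Y_KSC P G (f j) (par j) b (ιB j) (C37 j) (C38 j) (hι j) M₂ hM₂ hrepr aW fun β' U a h => (hC37 j β' U a h).1) with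
    blkP := fun j q => ιB j q.1
    κQ := M₂ * ∑ j, ‖b j‖
    cF := (M₂ * ∑ j, ‖b j‖) * Cq + 1
    cK := (Fintype.card ι : ℝ) * (M₂ * ∑ j, ‖b j‖)
    wK := fun B _ => (M₂ * ∑ j, ‖b j‖) * B + 1
    wKδ := fun δ => δ
    κQ_pos := hcR
    cF_pos := by positivity
    cK_pos := by
      have hne : Nonempty ι := by
        by_contra h
        rw [not_nonempty_iff] at h
        simp at hcR
      exact mul_pos (Nat.cast_pos.2 Fintype.card_pos) hcR
    wK_pos := fun B δ hB _ => by positivity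
    wKδ_pos := fun δ hδ => hδ
    Qc := fun j c => QcC (f j).toKIdx (par j) b c
    Qcs := fun j c => QcsC (f j).toKIdx (par j) b c
    Cop := fun j c => CopC (f j).toKIdx (par j) b c
    Fc := fun j c c' => FcC (f j).toKIdx (par j) b c c'
    Fcs := fun j c c' => FcsC (f j).toKIdx (par j) b c c'
    hQc := fun j α₀ c _ _ _ hreg => by
      letI : Fintype (geo9K (f j).toKIdx).Site := ‹∀ x : MemberY d ℓ hd hL b₀ b₁ Mstar, Fintype (geo9Y x).Site› (f j)
      letI : DecidableEq (geo9K (f j).toKIdx).Site := instDS (f j)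
      obtain ⟨U, rfl, hU⟩ := (codingYx P G (f j) (C37 j) (C38 j)).exists_of_bg_Reg335 hreg
      refine hasMajorantHom_mono _ _ (hasMajorantHom_QcC_base (f j).toKIdx (par j) b (ιB j)
        (fun z w => norm_le_one_and_inv_of_mem G hG1 (hpar j U hU.1.1 z w)) hM₂ hrepr) fun a a' => ?_
      split_ifs <;> simp_all
    hQcs := fun j α₀ c _ _ _ hreg => by
      letI : Fintype (geo9K (f j).toKIdx).Site := ‹∀ x : MemberY d ℓ hd hL b₀ b₁ Mstar, Fintype (geo9Y x).Site› (f j)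
      letI : DecidableEq (geo9K (f j).toKIdx).Site := instDS (f j)
      obtain ⟨U, rfl, hU⟩ := (codingYx P G (f j) (C37 j) (C38 j)).exists_of_bg_Reg335 hreg
      refine hasMajorantHom_mono _ _ (hasMajorantHom_QcsC_base (f j).toKIdx (par j) b (ιB j)
        (fun z w => norm_le_one_and_inv_of_mem G hG1 (hpar j U hU.1.1 z w)) hM₂ hrepr) fun a a' => ?_
      split_ifs <;> simp_all
    cop_eq := fun j c D X hD hXD hDX => copC_eq (f j).toKIdx (par j) b c D X hD hDX hXD
    reg_cinv := fun j α₀ c _ _ _ hreg => by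
      obtain ⟨U, rfl, hU⟩ := (codingYx P G (f j) (C37 j) (C38 j)).exists_of_bg_Reg335 hreg
      exact (XC_mul_CopC (f j).toKIdx (par j) b (.base U) (hunitX j U hU.1.1)).1
    q_mul := fun j α₁ c c' _ h37 => by
      obtain ⟨U, a, rfl, rfl, _⟩ := (codingYx P G (f j) (C37 j) (C38 j)).exists_of_bg_Cplx337 h37
      exact ⟨qcC_prod (f j).toKIdx (par j) b U a, qcsC_prod (f j).toKIdx (par j) b U a⟩
    hF := fun j α₁ c c' hα₁ h37 => by
      letI : Fintype (geo9K (f j).toKIdx).Site := ‹∀ x : MemberY d ℓ hd hL b₀ b₁ Mstar, Fintype (geo9Y x).Site› (f j)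
      letI : DecidableEq (geo9K (f j).toKIdx).Site := instDS (f j)
      obtain ⟨U, a, rfl, rfl, hC⟩ := (codingYx P G (f j) (C37 j) (C38 j)).exists_of_bg_Cplx337 h37
      have hv : VarParY (f j).toKIdx (par j) Cq α₁ U a := varParY_of_cplxLettersY G (f j) (par j) (ιB j) (hι j) (hsym j) (hC37 j α₁ U a hC).2
      have h1 : (M₂ * ∑ j, ‖b j‖) * Cq * α₁ ≤ ((M₂ * ∑ j, ‖b j‖) * Cq + 1) * α₁ := by nlinarith [hα₁.le]
      constructor
      · refine hasMajorantHom_mono _ _ (hasMajorantHom_FcC (f j).toKIdx (par j) b (ιB j) (hι j) hCq hα₁.le hv hM₂ hrepr) fun y y' => ?_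
        split_ifs <;> simp_all
      · refine hasMajorantHom_mono _ _ (hasMajorantHom_FcsC (f j).toKIdx (par j) b (ιB j) hCq hα₁.le hv hM₂ hrepr) fun y y' => ?_
        split_ifs <;> simp_all
    readKer := fun j α₀ c B₁ δ _ _ _ hreg hB₁ _ hker => by
      obtain ⟨U, rfl, hU⟩ := (codingYx P G (f j) (C37 j) (C38 j)).exists_of_bg_Reg335 hreg
      exact hasMajorant_CopC_base (f j) (par j) b (ιB j) (hι j) hM₂ hrepr U hB₁.le fun y y' => (le_abs_self _).trans (hker y y')
    writeKer := fun j c c' α₁ B δ _ _ h37 hB _ hmaj y y' => by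
      obtain ⟨U, a, rfl, rfl, _⟩ := (codingYx P G (f j) (C37 j) (C38 j)).exists_of_bg_Cplx337 h37
      have hpos := geo9Y_len_pos (f j) y
      have hpos' := geo9Y_len_pos (f j) y'
      have h := kerCY_le_of_hasMajorant_CopC (f j) (par j) b (ιB j) (hι j) hM₂ hrepr (.prod U a) hmaj y y'
      rw [pullS_CinvY_ker, abs_of_nonneg (kerCY_nonneg (f j) (par j) _ y y')]
      exact h.trans (mul_le_mul_of_nonneg_right (mul_le_mul_of_nonneg_right (mul_le_mul_of_nonneg_right (by linarith)
        (Real.rpow_nonneg hpos.le _)) (Real.rpow_nonneg hpos'.le _)) (Real.exp_pos _).le) }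

/-- ★★ **`StepKerPos` OF THE CODED FAMILY `KSC` WITH THE RECORD's (3.48) KERNEL OF `C = CY par (GpY par)`** over the coded carriers of a subfamily (any shared
`GA`): `stepKerPos_of_cinvFrame₃` on `cinvFrame₃CodedOn` — r06's block-carrier C⁻¹ clause at def-Y's letters.  Displayed: the root frame's structural data, the
invertibility `hunitX`, the reversal law `hsym`. [cite: Balaban1985BackgroundPropagators, Thm 3.4 p.400, Thm 3.2 (3.48) p.398, (3.65)–(3.67) p.403, (3.57)–(3.59) pp.401–402; Balaban1984PropagatorsII, Lemma 2.1 p.234, (2.51) p.232] -/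
theorem stepKerPos_KSC_cinv_on (hι : ∀ (j : J) (s : BlkY (f j).toKIdx), β (f j).toKIdx.hN (f j).toKIdx.D (f j).toKIdx.hk (ιB j s) = s)
    (hG1 : ∀ u : 𝔸ˣ, u ∈ G → ‖(u : 𝔸)‖ ≤ 1) (hpar : ∀ j (U : CfgY 𝔸 (f j).toKIdx), GVal G (f j).toKIdx U → ∀ z w, par j U z w ∈ G)
    (hunit : ∀ j (U : CfgY 𝔸 (f j).toKIdx), GVal G (f j).toKIdx U → IsUnit (deltaPrimeAY (f j).toKIdx (par j) U))
    (M₂ : ℝ) (hM₂ : 0 ≤ M₂) (hrepr : ∀ (v : 𝔸) (j : ι), |b.repr v j| ≤ M₂ * ‖v‖) (hcR : 0 < M₂ * ∑ j, ‖b j‖)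
    (Cq : ℝ) (hCq : 0 ≤ Cq) (hC37 : ∀ j β' U a, C37 j β' U a → GVal G (f j).toKIdx U ∧ CplxLettersY G (f j) (par j) (ιB j) Cq β' U a)
    (MInv aInv aW : ℝ) (hMInv : 0 < MInv) (haInv : 0 < aInv) (haW : 0 < aW)
    (hunitX : ∀ j (U : CfgY 𝔸 (f j).toKIdx), GVal G (f j).toKIdx U → IsUnit (XY (f j).toKIdx (par j) (GpY (f j).toKIdx (par j)) U))
    (hsym : ∀ j (U : CfgY 𝔸 (f j).toKIdx) (z w : SiteY (f j).toKIdx), par j U z w = (par j U w z)⁻¹)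
    (GA : ∀ j : J, B9.KernelFamily (geo9Y (f j)) (codingYx P G (f j) (C37 j) (C38 j)).bg) :
    StepKerPos (d + 1) c35 (fun j => geo9Y (f j)) (fun j => (codingYx P G (f j) (C37 j) (C38 j)).bg) (fun j => KSC P G (f j) (par j) (C37 j) (C38 j)) GA
      (fun j => pullS (codingYx P G (f j) (C37 j) (C38 j)) (CinvY P f G par j)) (fun j => pullS (codingYx P G (f j) (C37 j) (C38 j)) (CinvY P f G par j)) :=
  stepKerPos_of_cinvFrame₃ _ _ _ _ _ _ _ _
    (cinvFrame₃CodedOn P f c35 G par b ιB C37 C38 hι hG1 hpar hunit M₂ hM₂ hrepr hcR Cq hCq hC37 MInv aInv aW hMInv haInv haW hunitX hsym) GA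

/-- ★★★ **THE (3.48) MEMBER OF `SectBStepU` (R13-U1): `StepKerPos` OF `(KSCU, KACU, C⁻¹)` OVER THE CODED CARRIERS** — input families the U-letter readings
`KSCU`, `KACU` and the record's (3.48) kernel of `C = CY par (GpY par)` read along the decoding, output the same kernel at the product `U′U`:
`stepKerPos_KSC_cinv_on` transported by `B9SectBStepPosFamilyTransfer.stepKerPos_of_family_pos` (`hin_KSCU_on_pos`; identity output, the kernel is shared).
Displayed: the root frame's structural data (as `stepEPos_KSCU_on`), `hunitX`, `hsym`. [cite: Balaban1985BackgroundPropagators, Thm 3.4 p.400, Thm 3.2 (3.48) p.398, (3.65)–(3.67) p.403, p.403 l.1–9, (3.35)–(3.37) p.396; Balaban1984PropagatorsII, Lemma 2.1 p.234, (2.51) p.232] -/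
theorem stepKerPos_KSCU_on (hι : ∀ (j : J) (s : BlkY (f j).toKIdx), β (f j).toKIdx.hN (f j).toKIdx.D (f j).toKIdx.hk (ιB j s) = s)
    (hG1 : ∀ u : 𝔸ˣ, u ∈ G → ‖(u : 𝔸)‖ ≤ 1) (hpar : ∀ j (U : CfgY 𝔸 (f j).toKIdx), GVal G (f j).toKIdx U → ∀ z w, par j U z w ∈ G)
    (hunit : ∀ j (U : CfgY 𝔸 (f j).toKIdx), GVal G (f j).toKIdx U → IsUnit (deltaPrimeAY (f j).toKIdx (par j) U))
    (M₂ : ℝ) (hM₂ : 0 ≤ M₂) (hrepr : ∀ (v : 𝔸) (j : ι), |b.repr v j| ≤ M₂ * ‖v‖) (hcR : 0 < M₂ * ∑ j, ‖b j‖)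
    (Cq : ℝ) (hCq : 0 ≤ Cq) (hC37 : ∀ j β' U a, C37 j β' U a → GVal G (f j).toKIdx U ∧ CplxLettersY G (f j) (par j) (ιB j) Cq β' U a)
    (MInv aInv aW : ℝ) (hMInv : 0 < MInv) (haInv : 0 < aInv) (haW : 0 < aW)
    (hunitX : ∀ j (U : CfgY 𝔸 (f j).toKIdx), GVal G (f j).toKIdx U → IsUnit (XY (f j).toKIdx (par j) (GpY (f j).toKIdx (par j)) U))
    (hsym : ∀ j (U : CfgY 𝔸 (f j).toKIdx) (z w : SiteY (f j).toKIdx), par j U z w = (par j U w z)⁻¹) :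
    StepKerPos (d + 1) c35 (fun j => geo9Y (f j)) (fun j => (codingYx P G (f j) (C37 j) (C38 j)).bg)
      (fun j => KSCU P G (f j) (par j) (C37 j) (C38 j)) (fun j => KACU P G (f j) (OA j) (parB j) (C37 j) (C38 j))
      (fun j => pullS (codingYx P G (f j) (C37 j) (C38 j)) (CinvY P f G par j)) (fun j => pullS (codingYx P G (f j) (C37 j) (C38 j)) (CinvY P f G par j)) :=
  stepKerPos_of_family_pos (d + 1) c35 (fun j => geo9Y (f j)) (fun j => (codingYx P G (f j) (C37 j) (C38 j)).bg)
    (fun j => KSC P G (f j) (par j) (C37 j) (C38 j)) (fun j => KSCU P G (f j) (par j) (C37 j) (C38 j))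
    (fun j => KACU P G (f j) (OA j) (parB j) (C37 j) (C38 j)) (fun j => KACU P G (f j) (OA j) (parB j) (C37 j) (C38 j))
    (fun j => pullS (codingYx P G (f j) (C37 j) (C38 j)) (CinvY P f G par j))
    (hin_KSCU_on_pos P f c35 G par OA parB b ιB C37 C38 (CinvY P f G par) hι hG1 hM₂ hrepr (d + 1))
    (fun j => pullS (codingYx P G (f j) (C37 j) (C38 j)) (CinvY P f G par j)) (fun j => pullS (codingYx P G (f j) (C37 j) (C38 j)) (CinvY P f G par j))
    (fun B δ a hB hδ ha => ⟨0, 1, a, B, δ, one_pos, ha, le_rfl, hB, hδ, fun _ _ _ _ _ _ _ _ _ _ _ _ hK => hK⟩)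
    (stepKerPos_KSC_cinv_on P f c35 G par b ιB C37 C38 hι hG1 hpar hunit M₂ hM₂ hrepr hcR Cq hCq hC37 MInv aInv aW hMInv haInv haW hunitX hsym _)

end Instance

end Literature.MathematicalPhysics.QuantumFieldTheory.Balaban1983to89.B9SectBKerFrameCodedYR

/-!
# `Balaban1983to89.B9SectBGFrameCodedYR` — THE CLASS-PARAMETRIC TWIN of `B9SectBGFrameCodedY` (CASCADE-R, director-ym №279 GO-R; №277 (3) `hunitA` cure; dag-n06-d SOCKET-(α) class question)

statement-level skeleton of published theorems with citation tags; proofs where landed; nothing here is a claim about the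
Yang–Mills mass gap

WHAT THIS FILE IS.  The original module `B9SectBGFrameCodedY` types its objects over MODULE 3's member carrier `bg9Y 𝔸 G x` (MODULE 2's small-cube class (3.35)).  This file RE-DECLARES, with UNCHANGED NAMES inside the namespace `…B9SectBGFrameCodedYR`, exactly its 5 class-dependent declarations over the CLASS-PARAMETRIC carrier `B9SectBCodedClassR.bg9YC 𝔸 G P x` (`P : RegExtraY …` = the two cube conditions of (3.35)∕(3.36) as a parameter; `bg9Y 𝔸 G x = bg9YC 𝔸 G (extraY 𝔸 G) x` by `rfl`, so every declaration here WITHOUT the `hunitA` binder specialises definitionally to its original; EXCEPTION (v1.1, №288 (4), ref-E READ-9 HEADER-NIT): `gFrame₅CodedOn`, `stepEPos_KACU_frame_on` carry the №277 RE-KEYED `hunitA` (WEAKER hypothesis), so at `P := extraY 𝔸 G` they IMPLY the originals via `fun j α₀ U hU => hunitA j U hU.1.1` (ref-E K3), NOT a definitional specialisation; CAVEAT (LOCATED-18, №290 (1)): no α₀-threshold ⇒ still uninhabitable at `SU(N)` — consumers use the GUARDED `…RG` twin; at the record's reading of PRINT's class, `P := extraYPb 𝔸 G`, the displayed laws `hreg335P`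 ((3.35) on plaquettes) and the class-keyed `hunitA` become theorems).  The text is the original's VERBATIM under the token surgery `bg9Y 𝔸 G ↦ bg9YC 𝔸 G P`, `NAME ↦ NAME P` for the class-dependent names (P the first explicit argument), and — №277 — the binder `hunitA` re-keyed from «all G-valued U» to «all (3.35)-regular U of the carrier» (`∀ j α₀ U, (bg9YC 𝔸 G P (f j)).Reg335 c35 α₀ U → IsUnit (deltaAY …)`) with its use sites (`hunitA j U hU ↦ hunitA j α₀ U hU`) — NOT verbatim for the declarations named above.  Class-free declarations of the original are NOT copied: they are imported and used BY NAME (`open … hiding` the re-declared ones).  Generated by dag-n06-c g16's `gen.py` (HOME `pub-ymgap-dag-n06-c/lean/g16/`); the ORIGINAL MODULE DOCUMENTATION FOLLOWS VERBATIM and describes the mathematics.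

HONEST SCOPE.  Re-typing bookkeeping; nothing of [B9] asserted beyond the original; COUNT-NEUTRAL; N06 NOT discharged; nothing continuum ∕ OS ∕ mass gap ∕ Clay.  Cell `pub-ymgap` (D-0062), Track A node N06 [B9], seat `pub-ymgap-dag-n06-c` g16, 2026-08-29.
-/

/-!
# Balaban [B9], Thm 3.4 p. 400, Thm 3.3 p. 399, (3.26)–(3.27) p. 395, (3.42) p. 397, (3.80)–(3.81) p. 406, (3.82)–(3.86) p. 407 — ★★★ THE G FRAME OF ROW 13 INSTANTIATED AT
# NODE 00's LETTERS: `gFrame₅CodedOn : GFrame₅ …` over the coded carriers of a subfamily for the bond family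
# `KACU G x (GAY parS parB (GpY parS)) parB C37 C38` (pub-ymgap N06 G-side plan, Route L, L-5c), and its (3.42) step ★★ `stepEPos_KACU_frame_on`

T. Bałaban, *Propagators for lattice gauge theories in a background field*, Commun. Math. Phys. **99** (1985) 389–434
[`Balaban1985BackgroundPropagators`, "B9"]; [4] = T. Bałaban, *Propagators and renormalization transformations for lattice gauge
theories. II*, Commun. Math. Phys. **96** (1984) 223–250 [`Balaban1984PropagatorsII`].

statement-level skeleton of published theorems with citation tags; proofs where landed; nothing here is a claim about the
Yang–Mills mass gap

WHY THIS FILE (seat dag-n06-c gen 13).  r06's Sect.-B chain for the bond sector is the hypothesis frame `GFrame₅` (V5: `B9SectBGFrameV5`, the inhabitable head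
after LOCATED-12∕13) over gen 12's `CinvFrame₃` instance `B9SectBKerFrameCodedY.cinvFrame₃CodedOn`.  THIS FILE inhabits its 40 further fields at NODE 00's
letters, each by a landed∕typed lemma of gen 12–13: letters `GbC ∕ QbC ∕ QsbC ∕ abC ∕ F₂C ∕ F₂sC ∕ LapBC` and the laws `reg_ginv` ∕ `gb_eq_cplx` ∕ `qb_mul`
(`B9SectBGWordDeltaAY` — DESIGN POINT 2: `Δ_a(U)` IS the frame's word), `hQb ∕ hQsb ∕ ha324 ∕ hF₂` (`B9SectBQSizesY`, print's split of the block volume),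
structure + stencils (`B9SectBGClassLettersY`, `B9SectBKerLettersY.repY`), `readG342 ∕ writeG342` (`B9SectBGReadCodedY`: gen 12's dictionaries transported);
DISPLAYED beyond the parent's binders, all print-intrinsic and each with a record-level discharge route (header of `B9SectBGClassLettersY`): `hunitA` (Thm 3.1:
`Δ_a(U)` invertible at G-valued bases), `hparB` (the averaging transporters take values in `G`), `hb₁` (`0 ≤ b₁`), `hreg335P` ((3.35) on plaquettes),
`hC37G` (the seven (3.37) letter bounds), `hvarB` (the (3.80)–(3.81) transporter variation), `hMd : 2(d+1) < MInv` and a neighbour count `m_N` (`hnbr`) — the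
CROSS (3.42) read entries `∇*·G`, `G·∇` are DISCHARGED from node00-def-Y's `OpsYRead342CrossB` (★★ `crossReadY_KACU`, rate-dependent constant `cXY δ`, LOCATED-13).  §3: the (3.42) step `StepEPos` of the coded bond family by `stepEPos_of_gFrame₅`.

HONEST SCOPE.  An instance of a hypothesis frame at defined letters + one conditional step theorem; the displayed laws are hypotheses, not discharged here;
nothing of [B9]'s analysis asserted beyond r06's landed clauses; count-neutral; N06 NOT discharged; nothing continuum ∕ OS ∕ mass-gap ∕ Clay.  No `sorry`, no
`axiom`, no `instance`, no `notation`; one `def … : Prop` with parameters (`CrossReadY`, a named hypothesis).  `--supports stmt-QuantumFields-27364`.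
-/

noncomputable section

namespace Literature.MathematicalPhysics.QuantumFieldTheory.Balaban1983to89.B9SectBGFrameCodedYR

open Literature.MathematicalPhysics.QuantumFieldTheory.Balaban1983to89.B9SectBCodedClassR (RegExtraY bg9YC)
open Literature.MathematicalPhysics.QuantumFieldTheory.Balaban1983to89.B9SectBGFrameCodedY hiding CrossReadY readG342_base crossReadY_KACU gFrame₅CodedOn stepEPos_KACU_frame_on

open Literature.MathematicalPhysics.QuantumFieldTheory.Balaban1983to89
open Literature.MathematicalPhysics.QuantumFieldTheory.Balaban1983to89.Node00 (SiteY BlkY FBondY IBondY CfgY SiteParY BondOpY BondParY UboxY shiftY GpY GAY XY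
  deltaAY deltaPrimeAY bondCoordsY bondFunCoordsY)
open Literature.MathematicalPhysics.QuantumFieldTheory.Balaban1983to89.B6Ineq2142KLevelV1 (β)
open Literature.MathematicalPhysics.QuantumFieldTheory.Balaban1983to89.B6KLevelCensusIndexV1 (KIdx kGeo)
open Literature.MathematicalPhysics.QuantumFieldTheory.Balaban1983to89.B6RandomWalk (HasMajorant hasMajorant_mono Ineq261)
open Literature.MathematicalPhysics.QuantumFieldTheory.Balaban1983to89.B9Thm34Ext (toB6)
open Literature.MathematicalPhysics.QuantumFieldTheory.Balaban1983to89.B9FromB6 (EBlock)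
open Literature.MathematicalPhysics.QuantumFieldTheory.Balaban1983to89.B9GeoNormsKLevelV1 (geo9K geo9K_dist_nonneg)
open Literature.MathematicalPhysics.QuantumFieldTheory.Balaban1983to89.B9Eq39Adjoint (covD covDstar prodCfg plaqU)
open Literature.MathematicalPhysics.QuantumFieldTheory.Balaban1983to89.B9Eq352DivFormLetters (conj)
open Literature.MathematicalPhysics.QuantumFieldTheory.Balaban1983to89.B9Eq352GradLetters (diffLetter)
open Literature.MathematicalPhysics.QuantumFieldTheory.Balaban1983to89.B9Eq371GradLetters (bT bU)
open Literature.MathematicalPhysics.QuantumFieldTheory.Balaban1983to89.B9Eq372RemLetters (lapDDLetter)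
open Literature.MathematicalPhysics.QuantumFieldTheory.Balaban1983to89.B9Eq382V3Letters (dPrimeLetter)
open Literature.MathematicalPhysics.QuantumFieldTheory.Balaban1983to89.B9Eq376POneLetters (conjHom gradLin divLin)
open Literature.MathematicalPhysics.QuantumFieldTheory.Balaban1983to89.B9Eq386Neumann (deltaA)
open Literature.MathematicalPhysics.QuantumFieldTheory.Balaban1983to89.B9Eq360DeltaPrimeAY (AfldY)
open Literature.MathematicalPhysics.QuantumFieldTheory.Balaban1983to89.B9PinMembersKLevelV1 (MemberY geo9Y bg9Y)
open Literature.MathematicalPhysics.QuantumFieldTheory.Balaban1983to89.B9SectBGpLettersY (decY decY_base decY_prod GVal blkC coordC expAC GopC norm_le_one_and_inv_of_mem)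
open Literature.MathematicalPhysics.QuantumFieldTheory.Balaban1983to89.B9SectBL2DictionaryY (coordC_base_eq)
open Literature.MathematicalPhysics.QuantumFieldTheory.Balaban1983to89.B9SectBKerLettersY (QcC QcsC CopC repY blkC_repY repY_injective)
open Literature.MathematicalPhysics.QuantumFieldTheory.Balaban1983to89.B9SectBGpFrameCodedYR (codingYx)
open Literature.MathematicalPhysics.QuantumFieldTheory.Balaban1983to89.B9SectBGpFrameCodedY (CplxLettersY)
open Literature.MathematicalPhysics.QuantumFieldTheory.Balaban1983to89.B9SectBKerFrameCodedYR (cinvFrame₃CodedOn CinvY)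
open Literature.MathematicalPhysics.QuantumFieldTheory.Balaban1983to89.B9SectBCodedCarrier (CCfg pullS)
open Literature.MathematicalPhysics.QuantumFieldTheory.Balaban1983to89.B9SectBCodedReadingsUR (KACU)
open Literature.MathematicalPhysics.QuantumFieldTheory.Balaban1983to89.B9SectBGpReadingsYR (KSC)
open Literature.MathematicalPhysics.QuantumFieldTheory.Balaban1983to89.B9SectBGpTransferInY (eBlock_mono)
open Literature.MathematicalPhysics.QuantumFieldTheory.Balaban1983to89.B9SectBStepWhole (StepEPos)
open Literature.MathematicalPhysics.QuantumFieldTheory.Balaban1983to89.B9SectBGFrameV5 (GFrame₅ stepEPos_of_gFrame₅)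
open Literature.MathematicalPhysics.QuantumFieldTheory.Balaban1983to89.B9SectBGWordDeltaAY (GbC QbC QsbC abC F₂C F₂sC LapBC word_mul_GbC GbC_eq_of_two_sided
  qbC_prod qsbC_prod)
open Literature.MathematicalPhysics.QuantumFieldTheory.Balaban1983to89.B9SectBGReadCodedYR (readG342_GbC_printed writeG342_GbC)
open Literature.MathematicalPhysics.QuantumFieldTheory.Balaban1983to89.B9SectBGReadCodedY (eta_inv_eq_abs_cf hasMajorant_of_eq GbC_eq_conj_bondOpCoordsRY hasMajorant_diffLetter_inr_mul hasMajorant_mul_diffLetter_inl)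
open Literature.MathematicalPhysics.QuantumFieldTheory.Balaban1983to89.B9RWSumsReadsNbr (nbr)
open Literature.MathematicalPhysics.QuantumFieldTheory.Balaban1983to89.B9SectBGReadYR (eBlock_kernelFamilyB_of_KACU_base)
open Literature.MathematicalPhysics.QuantumFieldTheory.Balaban1983to89.Node00.OpsYRead342CrossB (hasMajorant_conj_cdsB_O_of_eBlockB hasMajorant_conj_O_cdB_of_eBlockB)
open Literature.MathematicalPhysics.QuantumFieldTheory.Balaban1983to89.B9SectBGClassLettersY (stencilFB_blkC stencilSt_blkC stencilLoc_blkC Reg335PlaqY CplxLettersGY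
  VarParBY)
open Literature.MathematicalPhysics.QuantumFieldTheory.Balaban1983to89.B9GeoLemma21KLevelV1 (geo9K_one_le_L)
open Literature.MathematicalPhysics.QuantumFieldTheory.Balaban1983to89.B9Thm31SiteCurvatureCommutatorsY (shiftY_shiftY_comm)
open Literature.MathematicalPhysics.QuantumFieldTheory.Balaban1983to89.B9SectBQSizesY (hasMajorant_QbC hasMajorant_QsbC hasMajorant_abC)
open Literature.MathematicalPhysics.QuantumFieldTheory.Balaban1983to89.B9SectBQVariationY (hasMajorant_F₂C hasMajorant_F₂sC)

variable {d ℓ : ℕ} {hd : 1 ≤ d + 1} {hL : Odd (ℓ + 1) ∧ 1 < ℓ + 1} {b₀ b₁ : ℝ} {Mstar : ℕ}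
variable {𝔸 : Type} [NormedRing 𝔸] (P : RegExtraY d ℓ hd hL b₀ b₁ Mstar 𝔸) [NormedAlgebra ℂ 𝔸] [CompleteSpace 𝔸]

/-! ## §1 The displayed cross-entry law and field-shaped readings at one member -/

section Prep

variable (G : Subgroup 𝔸ˣ) (x : MemberY d ℓ hd hL b₀ b₁ Mstar) (parS : SiteParY 𝔸 x.toKIdx) (parB : BondParY 𝔸 x.toKIdx) {ι : Type} [Fintype ι]
  (b : Module.Basis ι ℝ 𝔸) (ιB : BlkY x.toKIdx → IBondY x.toKIdx) (C37 C38 : ℝ → CfgY 𝔸 x.toKIdx → AfldY 𝔸 x.toKIdx → Prop)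
  [Fintype (geo9Y x).Site] {Rr : ℝ} {Hp : Prop}

/-- **THE CROSS (3.42) READ ENTRIES AS A NAMED LAW** (rate-dependent constant `cX δ`): at a `G`-valued base the (3.42) block of the coded bond family with
`(B₀, δ)` gives block majorants `cX δ·B₀·ℓ(a)·e^{−δd}` of the LEFT-BACKWARD products `conj b (diffLetter … (inr ν)) * GbC` and the RIGHT-FORWARD products
`GbC * conj b (diffLetter … (inl ν))` — the entries print's (3.42) does not list (p.398 l.20–22 licence); node00-def-Y's `OpsYRead342CrossB` supplies it with
`cX δ = O(1)·L·e^{2(d+1)δ}` (LOCATED-13). [cite: Balaban1985BackgroundPropagators, (3.42) p.397, p.398 l.20–22, (3.8) p.392] -/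
def CrossReadY (cX : ℝ → ℝ) : Prop :=
  ∀ (U : CfgY 𝔸 x.toKIdx) (B₀ δ : ℝ), 2 * ((d : ℝ) + 1) < (geo9Y x).M → GVal G x.toKIdx U → 0 ≤ B₀ → 0 < δ →
    EBlock (KACU P G x (GAY x.toKIdx parS parB (GpY x.toKIdx parS)) parB C37 C38) B₀ δ (.base U) →
    (∀ ν : Fin (d + 1), HasMajorant (g := toB6 (geo9Y x) Rr Hp) (fun q : (Fin (d + 1) × SiteY x.toKIdx) × ι => blkC x.toKIdx ιB q.1.2)
        (conj b (diffLetter (bT (shiftY x.toKIdx)) (bU (coordC G x.toKIdx (.base U))) ((((geo9Y x).eta : ℂ))⁻¹) (Sum.inr ν)) *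
          GbC x.toKIdx parS parB b (.base U))
        (fun a a' => cX δ * B₀ * (geo9Y x).len a * Real.exp (-(δ * (geo9Y x).dist a a')))) ∧
    (∀ ν : Fin (d + 1), HasMajorant (g := toB6 (geo9Y x) Rr Hp) (fun q : (Fin (d + 1) × SiteY x.toKIdx) × ι => blkC x.toKIdx ιB q.1.2)
        (GbC x.toKIdx parS parB b (.base U) *
          conj b (diffLetter (bT (shiftY x.toKIdx)) (bU (coordC G x.toKIdx (.base U))) ((((geo9Y x).eta : ℂ))⁻¹) (Sum.inl ν)))
        (fun a a' => cX δ * B₀ * (geo9Y x).len a * Real.exp (-(δ * (geo9Y x).dist a a'))))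

/-- ★ FIELD `readG342` AT ONE MEMBER: print's four entries (`readG342_GbC_printed`, constant `M₂Σ_j‖b_j‖`) and the cross entries (`CrossReadY`, constant `cX δ`)
under the common constant `M₂Σ_j‖b_j‖ + cX δ`. [cite: Balaban1985BackgroundPropagators, Thm 3.3 p.399 with (3.42) p.397; Balaban1984PropagatorsII, (2.51) p.232] -/
theorem readG342_base (hι : ∀ s, β x.toKIdx.hN x.toKIdx.D x.toKIdx.hk (ιB s) = s) {M₂ : ℝ} (hM₂ : 0 ≤ M₂)
    (hrepr : ∀ (v : 𝔸) (j : ι), |b.repr v j| ≤ M₂ * ‖v‖) {cX : ℝ → ℝ} (hcX : ∀ δ, 0 < δ → 0 ≤ cX δ)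
    (hcross : CrossReadY P (Rr := Rr) (Hp := Hp) G x parS parB b ιB C37 C38 cX) (hdM : 2 * ((d : ℝ) + 1) < (geo9Y x).M) (U : CfgY 𝔸 x.toKIdx)
    (hUG : GVal G x.toKIdx U) {B₀ δ : ℝ} (hB₀ : 0 < B₀) (hδ : 0 < δ)
    (hE : EBlock (KACU P G x (GAY x.toKIdx parS parB (GpY x.toKIdx parS)) parB C37 C38) B₀ δ (.base U)) :
    HasMajorant (g := toB6 (geo9Y x) Rr Hp) (fun q : (Fin (d + 1) × SiteY x.toKIdx) × ι => blkC x.toKIdx ιB q.1.2) (GbC x.toKIdx parS parB b (.base U))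
        (fun a a' => (M₂ * (∑ j, ‖b j‖) + cX δ) * B₀ * (geo9Y x).len a ^ 2 * Real.exp (-(δ * (geo9Y x).dist a a'))) ∧
      (∀ k : Fin (d + 1) ⊕ Fin (d + 1), HasMajorant (g := toB6 (geo9Y x) Rr Hp) (fun q : (Fin (d + 1) × SiteY x.toKIdx) × ι => blkC x.toKIdx ιB q.1.2)
        (conj b (diffLetter (bT (shiftY x.toKIdx)) (bU (coordC G x.toKIdx (.base U))) ((((geo9Y x).eta : ℂ))⁻¹) k) * GbC x.toKIdx parS parB b (.base U))
        (fun a a' => (M₂ * (∑ j, ‖b j‖) + cX δ) * B₀ * (geo9Y x).len a * Real.exp (-(δ * (geo9Y x).dist a a')))) ∧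
      (∀ k : Fin (d + 1) ⊕ Fin (d + 1), HasMajorant (g := toB6 (geo9Y x) Rr Hp) (fun q : (Fin (d + 1) × SiteY x.toKIdx) × ι => blkC x.toKIdx ιB q.1.2)
        (GbC x.toKIdx parS parB b (.base U) * conj b (diffLetter (bT (shiftY x.toKIdx)) (bU (coordC G x.toKIdx (.base U))) ((((geo9Y x).eta : ℂ))⁻¹) k))
        (fun a a' => (M₂ * (∑ j, ‖b j‖) + cX δ) * B₀ * (geo9Y x).len a * Real.exp (-(δ * (geo9Y x).dist a a')))) ∧
      HasMajorant (g := toB6 (geo9Y x) Rr Hp) (fun q : (Fin (d + 1) × SiteY x.toKIdx) × ι => blkC x.toKIdx ιB q.1.2)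
        (LapBC x.toKIdx b (.base U) * GbC x.toKIdx parS parB b (.base U))
        (fun a a' => (M₂ * (∑ j, ‖b j‖) + cX δ) * B₀ * 1 * Real.exp (-(δ * (geo9Y x).dist a a'))) := by
  obtain ⟨h0, h1, h2, h3⟩ := readG342_GbC_printed P (Rr := Rr) (Hp := Hp) G x parS parB b ιB C37 C38 hι hM₂ hrepr U hUG hB₀.le hE
  obtain ⟨c1, c2⟩ := hcross U B₀ δ hdM hUG hB₀.le hδ hE
  have hMS : 0 ≤ M₂ * ∑ j, ‖b j‖ := mul_nonneg hM₂ (Finset.sum_nonneg fun j _ => norm_nonneg _)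
  have hcx := hcX δ hδ
  have hlen : ∀ a : (geo9Y x).Site, 0 ≤ (geo9Y x).len a := fun a => (B9GeoLemma21KLevelV1.geo9Y_len_pos x a).le
  have up1 : ∀ (w : (geo9Y x).Site → ℝ), (∀ a, 0 ≤ w a) → ∀ a a' : (geo9Y x).Site,
      M₂ * (∑ j, ‖b j‖) * B₀ * w a * Real.exp (-(δ * (geo9Y x).dist a a')) ≤
        (M₂ * (∑ j, ‖b j‖) + cX δ) * B₀ * w a * Real.exp (-(δ * (geo9Y x).dist a a')) := fun w hw a a' => by
    have : 0 ≤ B₀ * w a * Real.exp (-(δ * (geo9Y x).dist a a')) := mul_nonneg (mul_nonneg hB₀.le (hw a)) (Real.exp_pos _).le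
    nlinarith
  have up2 : ∀ (w : (geo9Y x).Site → ℝ), (∀ a, 0 ≤ w a) → ∀ a a' : (geo9Y x).Site,
      cX δ * B₀ * w a * Real.exp (-(δ * (geo9Y x).dist a a')) ≤
        (M₂ * (∑ j, ‖b j‖) + cX δ) * B₀ * w a * Real.exp (-(δ * (geo9Y x).dist a a')) := fun w hw a a' => by
    have : 0 ≤ B₀ * w a * Real.exp (-(δ * (geo9Y x).dist a a')) := mul_nonneg (mul_nonneg hB₀.le (hw a)) (Real.exp_pos _).le
    nlinarith
  refine ⟨hasMajorant_mono _ h0 (up1 (fun a => (geo9Y x).len a ^ 2) fun a => sq_nonneg _), fun k => ?_, fun k => ?_,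
    hasMajorant_mono _ h3 (up1 (fun _ => (1 : ℝ)) fun _ => zero_le_one)⟩
  · cases k with
    | inl ν => exact hasMajorant_mono _ (h1 ν) (up1 (fun a => (geo9Y x).len a) hlen)
    | inr ν => exact hasMajorant_mono _ (c1 ν) (up2 (fun a => (geo9Y x).len a) hlen)
  · cases k with
    | inl ν => exact hasMajorant_mono _ (c2 ν) (up2 (fun a => (geo9Y x).len a) hlen)
    | inr ν => exact hasMajorant_mono _ (h2 ν) (up1 (fun a => (geo9Y x).len a) hlen)

/-- ★★ **THE CROSS READ LAW DISCHARGED** from node00-def-Y's bond-sector cross entries (`OpsYRead342CrossB`, FILE 63: `∇*_{V,ν}∘O(V)` and `O(V)∘∇_{V,ν}` read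
from the (3.42) block with the shifted-block factor `L·e^{2(d+1)|δ|}`, resp. `m_N·M₂Σ‖b_j‖·e^{2(d+1)|δ|}`), transported to r06's carrier and letters by
`B9SectBGReadCodedY.hasMajorant_diffLetter_inr_mul ∕ hasMajorant_mul_diffLetter_inl`; displayed: `G`-valued bond variables are contractive (`hG1`), the
neighbour count `m_N`. [cite: Balaban1985BackgroundPropagators, (3.42) p.397, p.398 l.20–22, (3.3) p.390, (3.8) p.392; Balaban1984PropagatorsII, (2.51) p.232, (2.60)–(2.61) p.234] -/
theorem crossReadY_KACU (hι : ∀ s, β x.toKIdx.hN x.toKIdx.D x.toKIdx.hk (ιB s) = s) (hG1 : ∀ u : 𝔸ˣ, u ∈ G → ‖(u : 𝔸)‖ ≤ 1) {M₂ : ℝ} (hM₂ : 0 ≤ M₂)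
    (hrepr : ∀ (v : 𝔸) (j : ι), |b.repr v j| ≤ M₂ * ‖v‖) {mN : ℕ}
    (hnbr : ∀ y' : IBondY x.toKIdx, (nbr (geo9Y x) (2 * ((d : ℝ) + 1)) y').card ≤ mN) :
    CrossReadY P (Rr := Rr) (Hp := Hp) G x parS parB b ιB C37 C38 (cXY (d := d) (ℓ := ℓ) b M₂ mN) := by
  intro U B₀ δ hdM hUG hB₀ hδ hE
  letI : Fintype (geo9K x.toKIdx).Site := ‹Fintype (geo9Y x).Site›
  have hEB : EBlock (Node00.kernelFamilyB x.toKIdx (bg9YC 𝔸 G P x) (fun U => U) (GAY x.toKIdx parS parB (GpY x.toKIdx parS)) parB) B₀ δ U :=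
    eBlock_kernelFamilyB_of_KACU_base P G x (GAY x.toKIdx parS parB (GpY x.toKIdx parS)) parB C37 C38 hE
  have hU1 : ∀ (ν : Fin (d + 1)) (s : Site (B6GlobalChartV1.PV d ℓ x.m x.K hd hL) 0),
      ‖((U ν s : 𝔸ˣ) : 𝔸)‖ ≤ 1 ∧ ‖(((U ν s)⁻¹ : 𝔸ˣ) : 𝔸)‖ ≤ 1 := fun ν s => norm_le_one_and_inv_of_mem G hG1 (hUG ν s)
  have hco : coordC G x.toKIdx (.base U) = UboxY x.toKIdx U := coordC_base_eq G x hUG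
  have hη : ((((geo9Y x).eta : ℂ)))⁻¹ = ((|x.toKIdx.cf| : ℝ) : ℂ) := eta_inv_eq_abs_cf x.toKIdx
  have hGb := GbC_eq_conj_bondOpCoordsRY x parS parB b (.base U)
  rw [decY_base] at hGb
  have hMS : 0 ≤ M₂ * ∑ j, ‖b j‖ := mul_nonneg hM₂ (Finset.sum_nonneg fun j _ => norm_nonneg _)
  have hlen : ∀ a : (geo9Y x).Site, 0 ≤ (geo9Y x).len a := fun a => (B9GeoLemma21KLevelV1.geo9Y_len_pos x a).le
  constructor
  · intro ν
    have h := hasMajorant_conj_cdsB_O_of_eBlockB (Rr := Rr) (Hp := Hp) (B := bg9YC 𝔸 G P x) (U₁ := U) x.toKIdx b (fun U => U)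
      (GAY x.toKIdx parS parB (GpY x.toKIdx parS)) parB hEB hB₀ ιB hι hM₂ hrepr hU1 hdM ν
    refine hasMajorant_mono _ (hasMajorant_of_eq x.toKIdx (by rw [hco, hη, hGb]) (hasMajorant_diffLetter_inr_mul x.toKIdx b ιB U ν _ h))
      fun a a' => ?_
    have hw : 0 ≤ B₀ * (geo9Y x).len a * Real.exp (-(δ * (geo9Y x).dist a a')) := mul_nonneg (mul_nonneg hB₀ (hlen a)) (Real.exp_pos _).le
    show M₂ * (∑ j, ‖b j‖) * ((((ℓ + 1 : ℕ) : ℝ) * Real.exp (|δ| * (2 * ((d : ℝ) + 1))) * B₀) * (geo9Y x).len a *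
        Real.exp (-(δ * (geo9Y x).dist a a'))) ≤ cXY (d := d) (ℓ := ℓ) b M₂ mN δ * B₀ * (geo9Y x).len a * Real.exp (-(δ * (geo9Y x).dist a a'))
    unfold cXY
    have h1 : (((ℓ + 1 : ℕ) : ℝ)) ≤ (((ℓ + 1 : ℕ) : ℝ)) + (mN : ℝ) * (M₂ * ∑ j, ‖b j‖) := le_add_of_nonneg_right (by positivity)
    have h2 : 0 ≤ M₂ * (∑ j, ‖b j‖) * Real.exp (|δ| * (2 * ((d : ℝ) + 1))) * (B₀ * (geo9Y x).len a * Real.exp (-(δ * (geo9Y x).dist a a'))) :=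
      mul_nonneg (mul_nonneg hMS (Real.exp_pos _).le) hw
    nlinarith
  · intro ν
    have h := hasMajorant_conj_O_cdB_of_eBlockB (Rr := Rr) (Hp := Hp) (B := bg9YC 𝔸 G P x) (U₁ := U) x.toKIdx b (fun U => U)
      (GAY x.toKIdx parS parB (GpY x.toKIdx parS)) parB hEB hB₀ ιB hι hM₂ hrepr hU1 hnbr ν
    refine hasMajorant_mono _ (hasMajorant_of_eq x.toKIdx (by rw [hco, hη, hGb]) (hasMajorant_mul_diffLetter_inl x.toKIdx b ιB U ν _ h))
      fun a a' => ?_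
    show M₂ * (∑ j, ‖b j‖) * ((((mN : ℝ) * (M₂ * ∑ j, ‖b j‖) * Real.exp (|δ| * (2 * ((d : ℝ) + 1)))) * B₀) * (geo9Y x).len a *
        Real.exp (-(δ * (geo9Y x).dist a a'))) ≤ cXY (d := d) (ℓ := ℓ) b M₂ mN δ * B₀ * (geo9Y x).len a * Real.exp (-(δ * (geo9Y x).dist a a'))
    unfold cXY
    have h1 : (mN : ℝ) * (M₂ * ∑ j, ‖b j‖) ≤ (((ℓ + 1 : ℕ) : ℝ)) + (mN : ℝ) * (M₂ * ∑ j, ‖b j‖) := le_add_of_nonneg_left (by positivity)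
    have hw : 0 ≤ B₀ * (geo9Y x).len a * Real.exp (-(δ * (geo9Y x).dist a a')) := mul_nonneg (mul_nonneg hB₀ (hlen a)) (Real.exp_pos _).le
    have h2 : 0 ≤ M₂ * (∑ j, ‖b j‖) * Real.exp (|δ| * (2 * ((d : ℝ) + 1))) * (B₀ * (geo9Y x).len a * Real.exp (-(δ * (geo9Y x).dist a a'))) :=
      mul_nonneg (mul_nonneg hMS (Real.exp_pos _).le) hw
    nlinarith

end Prep

/-! ## §2 ★★★ The instance over the coded carriers of a subfamily -/

section Instance

variable [NormOneClass 𝔸] [FiniteDimensional ℝ 𝔸] {J : Type} (f : J → MemberY d ℓ hd hL b₀ b₁ Mstar)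
  [∀ x : MemberY d ℓ hd hL b₀ b₁ Mstar, Fintype (geo9Y x).Site]
  [instDS : ∀ x : MemberY d ℓ hd hL b₀ b₁ Mstar, DecidableEq (geo9Y x).Site] [instNE : ∀ x : MemberY d ℓ hd hL b₀ b₁ Mstar, Nonempty (geo9Y x).Site]
  (c35 : ℝ) (G : Subgroup 𝔸ˣ) (par : ∀ j : J, SiteParY 𝔸 (f j).toKIdx) (parB : ∀ j : J, BondParY 𝔸 (f j).toKIdx)
  {ι : Type} [Fintype ι] [DecidableEq ι] (b : Module.Basis ι ℝ 𝔸) (ιB : ∀ j : J, BlkY (f j).toKIdx → IBondY (f j).toKIdx)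
  (C37 C38 : ∀ j : J, ℝ → CfgY 𝔸 (f j).toKIdx → AfldY 𝔸 (f j).toKIdx → Prop)

/-- ★★★ **THE G FRAME OF ROW 13 AT NODE 00's LETTERS**: `GFrame₅` over the coded carriers of the subfamily `f`, site family `KSC` (G′), bond family
`KACU G (f j) (GAY … (par j) (parB j) (GpY (par j))) (parB j) (C37 j) (C38 j)` (G), C⁻¹ kernel `pullS … (CinvY f G par j)`; parent gen 12's `cinvFrame₃CodedOn`;
letters and laws of `B9SectBGWordDeltaAY` ∕ `B9SectBQSizesY` ∕ `B9SectBGClassLettersY` ∕ `B9SectBGReadCodedY`; displayed: the parent's binders and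
`hunitA`, `hparB`, `hb₁`, `hreg335P`, `hC37G`, `hvarB`, `hMd`, `hnbr`. [cite: Balaban1985BackgroundPropagators, Thm 3.4 p.400, Thm 3.3 p.399, (3.15) p.393, (3.24)–(3.27) pp.394–395, (3.35)–(3.37) p.396, (3.42) p.397, (3.80)–(3.81) p.406, (3.82)–(3.86) p.407; Balaban1984PropagatorsII, (2.51) p.232, Lemma 2.1 p.234] -/
noncomputable def gFrame₅CodedOn (hι : ∀ (j : J) (s : BlkY (f j).toKIdx), β (f j).toKIdx.hN (f j).toKIdx.D (f j).toKIdx.hk (ιB j s) = s)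
    (hG1 : ∀ u : 𝔸ˣ, u ∈ G → ‖(u : 𝔸)‖ ≤ 1) (hpar : ∀ j (U : CfgY 𝔸 (f j).toKIdx), GVal G (f j).toKIdx U → ∀ z w, par j U z w ∈ G)
    (hunit : ∀ j (U : CfgY 𝔸 (f j).toKIdx), GVal G (f j).toKIdx U → IsUnit (deltaPrimeAY (f j).toKIdx (par j) U))
    (M₂ : ℝ) (hM₂ : 0 ≤ M₂) (hrepr : ∀ (v : 𝔸) (j : ι), |b.repr v j| ≤ M₂ * ‖v‖) (hcR : 0 < M₂ * ∑ j, ‖b j‖)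
    (Cq : ℝ) (hCq : 0 ≤ Cq) (hC37 : ∀ j β' U a, C37 j β' U a → GVal G (f j).toKIdx U ∧ CplxLettersY G (f j) (par j) (ιB j) Cq β' U a)
    (MInv aInv aW : ℝ) (hMInv : 0 < MInv) (haInv : 0 < aInv) (haW : 0 < aW)
    (hunitX : ∀ j (U : CfgY 𝔸 (f j).toKIdx), GVal G (f j).toKIdx U → IsUnit (XY (f j).toKIdx (par j) (GpY (f j).toKIdx (par j)) U))
    (hsym : ∀ j (U : CfgY 𝔸 (f j).toKIdx) (z w : SiteY (f j).toKIdx), par j U z w = (par j U w z)⁻¹)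
    -- the G-side displayed laws
    (hunitA : ∀ j (α₀ : ℝ) (U : CfgY 𝔸 (f j).toKIdx), (bg9YC 𝔸 G P (f j)).Reg335 c35 α₀ U → IsUnit (deltaAY (f j).toKIdx (par j) (parB j) (GpY (f j).toKIdx (par j)) U))
    (hparB : ∀ j (U : CfgY 𝔸 (f j).toKIdx), GVal G (f j).toKIdx U → ∀ y f', parB j U y f' ∈ G) (hb₁ : 0 ≤ b₁)
    (C₀ : ℝ) (hC₀ : 0 ≤ C₀)
    (hreg335P : ∀ j (α₀ : ℝ) (U : CfgY 𝔸 (f j).toKIdx), MInv ≤ (geo9Y (f j)).M → 0 < α₀ → (geo9Y (f j)).M * α₀ ≤ aInv →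
      (bg9YC 𝔸 G P (f j)).Reg335 c35 α₀ U → Reg335PlaqY G (f j) (ιB j) C₀ U)
    (hC37G : ∀ j β' U a, C37 j β' U a → CplxLettersGY G (f j) (ιB j) β' U a)
    (cVar : ℝ) (hcVar : 0 ≤ cVar) (hvarB : ∀ j β' U a, C37 j β' U a → VarParBY (f j).toKIdx (parB j) cVar β' U a)
    (hMd : 2 * ((d : ℝ) + 1) < MInv) (mN : ℕ) (hnbr : ∀ (j : J) (y' : IBondY (f j).toKIdx), (nbr (geo9Y (f j)) (2 * ((d : ℝ) + 1)) y').card ≤ mN) :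
    GFrame₅ c35 (fun j => geo9Y (f j)) (fun j => (codingYx P G (f j) (C37 j) (C38 j)).bg) (fun j => KSC P G (f j) (par j) (C37 j) (C38 j)) b (Fin (d + 1))
      (fun j => SiteY (f j).toKIdx) (fun j => BlkY (f j).toKIdx × ι)
      (fun j => KACU P G (f j) (GAY (f j).toKIdx (par j) (parB j) (GpY (f j).toKIdx (par j))) (parB j) (C37 j) (C38 j))
      (fun j => pullS (codingYx P G (f j) (C37 j) (C38 j)) (CinvY P f G par j)) :=
  { cinvFrame₃CodedOn P f c35 G par b ιB C37 C38 hι hG1 hpar hunit M₂ hM₂ hrepr hcR Cq hCq hC37 MInv aInv aW hMInv haInv haW hunitX hsym with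
    C₀ := C₀
    κQb := (M₂ * ∑ j, ‖b j‖) * (2 * (((ℓ + 1 : ℕ) : ℝ)) ^ (d + 1)) * Real.exp (1 * ((ℓ : ℝ) + 3))
    cFb := (M₂ * ∑ j, ‖b j‖) * (cVar * (2 * (((ℓ + 1 : ℕ) : ℝ)) ^ (d + 1))) * Real.exp (1 * ((ℓ : ℝ) + 3))
    abar := (M₂ * ∑ j, ‖b j‖) * b₁
    cRG := fun δ => M₂ * (∑ j, ‖b j‖) + cXY (d := d) (ℓ := ℓ) b M₂ mN δ
    wBG := fun B _ => (M₂ * ∑ j, ‖b j‖) * B + 1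
    wδG := fun δ => δ
    C₀_nonneg := hC₀
    κQb_nonneg := by positivity
    cFb_nonneg := by positivity
    abar_nonneg := mul_nonneg hcR.le hb₁
    cRG_pos := fun δ hδ => add_pos_of_pos_of_nonneg hcR (cXY_nonneg (d := d) (ℓ := ℓ) b hM₂ mN δ)
    wBG_pos := fun B _ hB _ => by positivity
    wδG_pos := fun δ hδ => hδ
    rep := fun j => repY (f j).toKIdx ι
    Gb := fun j c => GbC (f j).toKIdx (par j) (parB j) b c
    Qb := fun j c => QbC (f j).toKIdx (parB j) b c
    Qsb := fun j c => QsbC (f j).toKIdx (parB j) b c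
    ab := fun j => abC (f j).toKIdx b
    F₂ := fun j c c' => F₂C (f j).toKIdx (parB j) b c c'
    F₂s := fun j c c' => F₂sC (f j).toKIdx (parB j) b c c'
    LapB := fun j c => LapBC (f j).toKIdx b c
    L_one_le := fun j => geo9K_one_le_L (f j).toKIdx
    T_comm := fun j μ ν z => shiftY_shiftY_comm (f j).toKIdx μ ν z
    hrep := fun j q => blkC_repY (f j).toKIdx ι (ιB j) q
    hinj := fun j => repY_injective (f j).toKIdx ι
    stencilFB := fun j μ ν z => stencilFB_blkC (f j).toKIdx (ιB j) (hι j) μ ν z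
    stencilSt := fun j μ z q hq => stencilSt_blkC (f j).toKIdx (ιB j) (hι j) μ z q hq
    stencilLoc := fun j μ z q hq => stencilLoc_blkC (f j).toKIdx (ιB j) (hι j) μ z q hq
    reg335 := fun j α₀ c hM hα₀ hMa hreg => by
      obtain ⟨U, rfl, hU⟩ := (codingYx P G (f j) (C37 j) (C38 j)).exists_of_bg_Reg335 hreg
      exact hreg335P j α₀ U hM hα₀ hMa hU
    hQb := fun j α₀ c δ hM hα₀ hMa hreg hδ hδ1 => by
      letI : Fintype (geo9K (f j).toKIdx).Site := ‹∀ x : MemberY d ℓ hd hL b₀ b₁ Mstar, Fintype (geo9Y x).Site› (f j)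
      obtain ⟨U, rfl, hU⟩ := (codingYx P G (f j) (C37 j) (C38 j)).exists_of_bg_Reg335 hreg
      have h := hasMajorant_QbC (Rr := 0) (Hp := True) (f j).toKIdx (parB j) b (ιB j) (hι j) hM₂ hrepr
        (parB_contractive G (f j) (parB j) hG1 (hparB j U hU.1.1)) hδ.le
      refine hasMajorant_mono _ h fun a a' => ?_
      have hL1 : (1 : ℝ) ≤ 2 * (((ℓ + 1 : ℕ) : ℝ)) ^ (d + 1) := by
        have : (1 : ℝ) ≤ (((ℓ + 1 : ℕ) : ℝ)) ^ (d + 1) := one_le_pow₀ (by exact_mod_cast Nat.succ_le_succ (Nat.zero_le ℓ))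
        linarith
      have hδ1' : δ ≤ 1 := hδ1
      have hℓ : (0 : ℝ) ≤ (ℓ : ℝ) + 3 := by positivity
      have he : Real.exp (δ * ((ℓ : ℝ) + 3)) ≤ Real.exp (1 * ((ℓ : ℝ) + 3)) := Real.exp_le_exp.2 (by nlinarith)
      have hE0 := (Real.exp_pos (-(δ * (geo9K (f j).toKIdx).dist a a'))).le
      have hMS : 0 ≤ M₂ * ∑ j, ‖b j‖ := hcR.le
      calc M₂ * (∑ j, ‖b j‖) * (Real.exp (δ * ((ℓ : ℝ) + 3)) * Real.exp (-(δ * (geo9K (f j).toKIdx).dist a a')))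
          = M₂ * (∑ j, ‖b j‖) * 1 * Real.exp (δ * ((ℓ : ℝ) + 3)) * Real.exp (-(δ * (geo9K (f j).toKIdx).dist a a')) := by ring
        _ ≤ M₂ * (∑ j, ‖b j‖) * (2 * (((ℓ + 1 : ℕ) : ℝ)) ^ (d + 1)) * Real.exp (1 * ((ℓ : ℝ) + 3)) *
              Real.exp (-(δ * (geo9K (f j).toKIdx).dist a a')) := by gcongr
    hQsb := fun j α₀ c δ hM hα₀ hMa hreg hδ hδ1 => by
      letI : Fintype (geo9K (f j).toKIdx).Site := ‹∀ x : MemberY d ℓ hd hL b₀ b₁ Mstar, Fintype (geo9Y x).Site› (f j)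
      obtain ⟨U, rfl, hU⟩ := (codingYx P G (f j) (C37 j) (C38 j)).exists_of_bg_Reg335 hreg
      have h := hasMajorant_QsbC (Rr := 0) (Hp := True) (f j).toKIdx (parB j) b (ιB j) (hι j) hM₂ hrepr
        (parB_contractive G (f j) (parB j) hG1 (hparB j U hU.1.1)) hδ.le
      refine hasMajorant_mono _ h fun a a' => ?_
      have hδ1' : δ ≤ 1 := hδ1
      have hℓ : (0 : ℝ) ≤ (ℓ : ℝ) + 3 := by positivity
      have he : Real.exp (δ * ((ℓ : ℝ) + 3)) ≤ Real.exp (1 * ((ℓ : ℝ) + 3)) := Real.exp_le_exp.2 (by nlinarith)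
      have hMS : 0 ≤ M₂ * ∑ j, ‖b j‖ := hcR.le
      calc M₂ * (∑ j, ‖b j‖) * (2 * (((ℓ + 1 : ℕ) : ℝ)) ^ (d + 1) * Real.exp (δ * ((ℓ : ℝ) + 3)) * Real.exp (-(δ * (geo9K (f j).toKIdx).dist a a')))
          = M₂ * (∑ j, ‖b j‖) * (2 * (((ℓ + 1 : ℕ) : ℝ)) ^ (d + 1)) * Real.exp (δ * ((ℓ : ℝ) + 3)) * Real.exp (-(δ * (geo9K (f j).toKIdx).dist a a')) := by
            ring
        _ ≤ M₂ * (∑ j, ‖b j‖) * (2 * (((ℓ + 1 : ℕ) : ℝ)) ^ (d + 1)) * Real.exp (1 * ((ℓ : ℝ) + 3)) *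
              Real.exp (-(δ * (geo9K (f j).toKIdx).dist a a')) := by gcongr
    ha324 := fun j => by
      letI : Fintype (geo9K (f j).toKIdx).Site := ‹∀ x : MemberY d ℓ hd hL b₀ b₁ Mstar, Fintype (geo9Y x).Site› (f j)
      refine hasMajorant_mono _ (hasMajorant_abC (Rr := 0) (Hp := True) (f j).toKIdx b (ιB j) (hι j) hM₂ hrepr hb₁) fun a a' => ?_
      split_ifs <;> first | exact le_of_eq (mul_assoc _ _ _).symm | exact le_of_eq (mul_zero _) | simp_all
    reg_ginv := fun j α₀ c hM hα₀ hMa hreg => by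
      obtain ⟨U, rfl, hU⟩ := (codingYx P G (f j) (C37 j) (C38 j)).exists_of_bg_Reg335 hreg
      exact reg_ginv_base G (f j) (par j) (parB j) b U hU.1.1 (hunitA j α₀ U hU)
    gb_eq_cplx := fun j α₁ c c' X hα₁ h37 h1 h2 => by
      obtain ⟨U, a, rfl, rfl, hC⟩ := (codingYx P G (f j) (C37 j) (C38 j)).exists_of_bg_Cplx337 h37
      exact (gb_eq_cplx_pair G (f j) (par j) (parB j) b U (hC37 j α₁ U a hC).1 a X h1 h2).2
    qb_mul := fun j α₁ c c' hα₁ h37 => by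
      obtain ⟨U, a, rfl, rfl, hC⟩ := (codingYx P G (f j) (C37 j) (C38 j)).exists_of_bg_Cplx337 h37
      exact ⟨qbC_prod (f j).toKIdx (parB j) b U a, qsbC_prod (f j).toKIdx (parB j) b U a⟩
    hF₂ := fun j α₁ c c' hα₁ h37 δ hδ hδ1 => by
      letI : Fintype (geo9K (f j).toKIdx).Site := ‹∀ x : MemberY d ℓ hd hL b₀ b₁ Mstar, Fintype (geo9Y x).Site› (f j)
      obtain ⟨U, a, rfl, rfl, hC⟩ := (codingYx P G (f j) (C37 j) (C38 j)).exists_of_bg_Cplx337 h37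
      have hcv : 0 ≤ cVar * α₁ := mul_nonneg hcVar hα₁.le
      have hv := hvarB j α₁ U a hC
      have hδ1' : δ ≤ 1 := hδ1
      have hℓ : (0 : ℝ) ≤ (ℓ : ℝ) + 3 := by positivity
      have he : Real.exp (δ * ((ℓ : ℝ) + 3)) ≤ Real.exp (1 * ((ℓ : ℝ) + 3)) := Real.exp_le_exp.2 (by nlinarith)
      have hL1 : (1 : ℝ) ≤ 2 * (((ℓ + 1 : ℕ) : ℝ)) ^ (d + 1) := by
        have : (1 : ℝ) ≤ (((ℓ + 1 : ℕ) : ℝ)) ^ (d + 1) := one_le_pow₀ (by exact_mod_cast Nat.succ_le_succ (Nat.zero_le ℓ))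
        linarith
      have hMS : 0 ≤ M₂ * ∑ j, ‖b j‖ := hcR.le
      constructor
      · refine hasMajorant_mono _ (hasMajorant_F₂C (Rr := 0) (Hp := True) (f j).toKIdx (parB j) b (ιB j) (hι j) hM₂ hrepr hcv hv hδ.le) fun a a' => ?_
        calc M₂ * (∑ j, ‖b j‖) * (cVar * α₁ * Real.exp (δ * ((ℓ : ℝ) + 3)) * Real.exp (-(δ * (geo9K (f j).toKIdx).dist a a')))
            = M₂ * (∑ j, ‖b j‖) * (cVar * 1) * Real.exp (δ * ((ℓ : ℝ) + 3)) * α₁ * Real.exp (-(δ * (geo9K (f j).toKIdx).dist a a')) := by ring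
          _ ≤ M₂ * (∑ j, ‖b j‖) * (cVar * (2 * (((ℓ + 1 : ℕ) : ℝ)) ^ (d + 1))) * Real.exp (1 * ((ℓ : ℝ) + 3)) * α₁ *
                Real.exp (-(δ * (geo9K (f j).toKIdx).dist a a')) := by gcongr
      · refine hasMajorant_mono _ (hasMajorant_F₂sC (Rr := 0) (Hp := True) (f j).toKIdx (parB j) b (ιB j) (hι j) hM₂ hrepr hcv hv hδ.le) fun a a' => ?_
        calc M₂ * (∑ j, ‖b j‖) * (cVar * α₁ * (2 * (((ℓ + 1 : ℕ) : ℝ)) ^ (d + 1)) * Real.exp (δ * ((ℓ : ℝ) + 3)) *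
              Real.exp (-(δ * (geo9K (f j).toKIdx).dist a a')))
            = M₂ * (∑ j, ‖b j‖) * (cVar * (2 * (((ℓ + 1 : ℕ) : ℝ)) ^ (d + 1))) * Real.exp (δ * ((ℓ : ℝ) + 3)) * α₁ *
                Real.exp (-(δ * (geo9K (f j).toKIdx).dist a a')) := by ring
          _ ≤ M₂ * (∑ j, ‖b j‖) * (cVar * (2 * (((ℓ + 1 : ℕ) : ℝ)) ^ (d + 1))) * Real.exp (1 * ((ℓ : ℝ) + 3)) * α₁ *
                Real.exp (-(δ * (geo9K (f j).toKIdx).dist a a')) := by gcongr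
    cplxG := fun j α₁ c c' hα₁ h37 => by
      obtain ⟨U, a, rfl, rfl, hC⟩ := (codingYx P G (f j) (C37 j) (C38 j)).exists_of_bg_Cplx337 h37
      exact hC37G j α₁ U a hC
    readG342 := fun j α₀ c B₀ δ hM hα₀ hMa hreg hB₀ hδ hE => by
      obtain ⟨U, rfl, hU⟩ := (codingYx P G (f j) (C37 j) (C38 j)).exists_of_bg_Reg335 hreg
      exact readG342_base P G (f j) (par j) (parB j) b (ιB j) (C37 j) (C38 j) (hι j) hM₂ hrepr (fun δ _ => cXY_nonneg (d := d) (ℓ := ℓ) b hM₂ mN δ)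
        (crossReadY_KACU P G (f j) (par j) (parB j) b (ιB j) (C37 j) (C38 j) (hι j) hG1 hM₂ hrepr (hnbr j)) (lt_of_lt_of_le hMd hM) U hU.1.1 hB₀ hδ hE
    writeG342 := fun j c c' α₁ B δ hα₁ hα₁W h37 hB hδ h0 h1 h2 h3 => by
      obtain ⟨U, a, rfl, rfl, hC⟩ := (codingYx P G (f j) (C37 j) (C38 j)).exists_of_bg_Cplx337 h37
      have hw := writeG342_GbC P (Rr := 0) (Hp := True) G (f j) (par j) (parB j) b (ιB j) (C37 j) (C38 j) (hι j) hM₂ hrepr U (hC37 j α₁ U a hC).1 a hB h0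
        (fun ν => h1 (Sum.inl ν)) (fun ν => h2 (Sum.inr ν)) h3
      exact eBlock_mono (f j).toKIdx _ (by linarith) hw }

/-! ## §3 ★★ The (3.42) step of the bond family through the frame -/

/-- ★★ **`StepEPos` OF THE CODED BOND FAMILY `KACU` THROUGH THE G FRAME** (r06's `stepEPos_of_gFrame₅` on `gFrame₅CodedOn`), GIVEN the Lemma-2.1 datum
`(d261, h261)` of the frame.  (Route F landed the same step under the displayed (3.85) pair; this is Route L's, under the displayed laws of the instance.)
[cite: Balaban1985BackgroundPropagators, Thm 3.4 p.400 + Thm 3.3 p.399 + (3.42) p.397 + (3.82)–(3.86) p.407; Balaban1984PropagatorsII, Lemma 2.1 p.234, (2.51) p.232] -/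
theorem stepEPos_KACU_frame_on (hι : ∀ (j : J) (s : BlkY (f j).toKIdx), β (f j).toKIdx.hN (f j).toKIdx.D (f j).toKIdx.hk (ιB j s) = s)
    (hG1 : ∀ u : 𝔸ˣ, u ∈ G → ‖(u : 𝔸)‖ ≤ 1) (hpar : ∀ j (U : CfgY 𝔸 (f j).toKIdx), GVal G (f j).toKIdx U → ∀ z w, par j U z w ∈ G)
    (hunit : ∀ j (U : CfgY 𝔸 (f j).toKIdx), GVal G (f j).toKIdx U → IsUnit (deltaPrimeAY (f j).toKIdx (par j) U))
    (M₂ : ℝ) (hM₂ : 0 ≤ M₂) (hrepr : ∀ (v : 𝔸) (j : ι), |b.repr v j| ≤ M₂ * ‖v‖) (hcR : 0 < M₂ * ∑ j, ‖b j‖)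
    (Cq : ℝ) (hCq : 0 ≤ Cq) (hC37 : ∀ j β' U a, C37 j β' U a → GVal G (f j).toKIdx U ∧ CplxLettersY G (f j) (par j) (ιB j) Cq β' U a)
    (MInv aInv aW : ℝ) (hMInv : 0 < MInv) (haInv : 0 < aInv) (haW : 0 < aW)
    (hunitX : ∀ j (U : CfgY 𝔸 (f j).toKIdx), GVal G (f j).toKIdx U → IsUnit (XY (f j).toKIdx (par j) (GpY (f j).toKIdx (par j)) U))
    (hsym : ∀ j (U : CfgY 𝔸 (f j).toKIdx) (z w : SiteY (f j).toKIdx), par j U z w = (par j U w z)⁻¹)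
    (hunitA : ∀ j (α₀ : ℝ) (U : CfgY 𝔸 (f j).toKIdx), (bg9YC 𝔸 G P (f j)).Reg335 c35 α₀ U → IsUnit (deltaAY (f j).toKIdx (par j) (parB j) (GpY (f j).toKIdx (par j)) U))
    (hparB : ∀ j (U : CfgY 𝔸 (f j).toKIdx), GVal G (f j).toKIdx U → ∀ y f', parB j U y f' ∈ G) (hb₁ : 0 ≤ b₁)
    (C₀ : ℝ) (hC₀ : 0 ≤ C₀)
    (hreg335P : ∀ j (α₀ : ℝ) (U : CfgY 𝔸 (f j).toKIdx), MInv ≤ (geo9Y (f j)).M → 0 < α₀ → (geo9Y (f j)).M * α₀ ≤ aInv →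
      (bg9YC 𝔸 G P (f j)).Reg335 c35 α₀ U → Reg335PlaqY G (f j) (ιB j) C₀ U)
    (hC37G : ∀ j β' U a, C37 j β' U a → CplxLettersGY G (f j) (ιB j) β' U a)
    (cVar : ℝ) (hcVar : 0 ≤ cVar) (hvarB : ∀ j β' U a, C37 j β' U a → VarParBY (f j).toKIdx (parB j) cVar β' U a)
    (hMd : 2 * ((d : ℝ) + 1) < MInv) (mN : ℕ) (hnbr : ∀ (j : J) (y' : IBondY (f j).toKIdx), (nbr (geo9Y (f j)) (2 * ((d : ℝ) + 1)) y').card ≤ mN)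
    (d261 : ℝ → ℕ)
    (h261 : ∀ (j : J) (δ α : ℝ), 0 < δ → δ ≤ 1 → 9 / 5000 ≤ α → α < 1 →
      (gFrame₅CodedOn P f c35 G par parB b ιB C37 C38 hι hG1 hpar hunit M₂ hM₂ hrepr hcR Cq hCq hC37 MInv aInv aW hMInv haInv haW hunitX hsym hunitA hparB hb₁ C₀
        hC₀ hreg335P hC37G cVar hcVar hvarB hMd mN hnbr).M261 δ ≤ (geo9Y (f j)).M →
      Ineq261 (d261 δ) (toB6 (geo9Y (f j)) 0 True) δ α) :
    StepEPos (d + 1) c35 (fun j => geo9Y (f j)) (fun j => (codingYx P G (f j) (C37 j) (C38 j)).bg) (fun j => KSC P G (f j) (par j) (C37 j) (C38 j))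
      (fun j => KACU P G (f j) (GAY (f j).toKIdx (par j) (parB j) (GpY (f j).toKIdx (par j))) (parB j) (C37 j) (C38 j))
      (fun j => pullS (codingYx P G (f j) (C37 j) (C38 j)) (CinvY P f G par j))
      (fun j => KACU P G (f j) (GAY (f j).toKIdx (par j) (parB j) (GpY (f j).toKIdx (par j))) (parB j) (C37 j) (C38 j)) :=
  stepEPos_of_gFrame₅ (F := gFrame₅CodedOn P f c35 G par parB b ιB C37 C38 hι hG1 hpar hunit M₂ hM₂ hrepr hcR Cq hCq hC37 MInv aInv aW hMInv haInv haW hunitX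
    hsym hunitA hparB hb₁ C₀ hC₀ hreg335P hC37G cVar hcVar hvarB hMd mN hnbr) d261 h261

end Instance

end Literature.MathematicalPhysics.QuantumFieldTheory.Balaban1983to89.B9SectBGFrameCodedYR

end

/-!
# `Balaban1983to89.B9SectBH1GReadWriteYR` — THE CLASS-PARAMETRIC TWIN of `B9SectBH1GReadWriteY` (CASCADE-R, director-ym №279 GO-R; №277 (3) `hunitA` cure; dag-n06-d SOCKET-(α) class question)

statement-level skeleton of published theorems with citation tags; proofs where landed; nothing here is a claim about the
Yang–Mills mass gap

WHAT THIS FILE IS.  The original module `B9SectBH1GReadWriteY` types its objects over MODULE 3's member carrier `bg9Y 𝔸 G x` (MODULE 2's small-cube class (3.35)).  This file RE-DECLARES, with UNCHANGED NAMES inside the namespace `…B9SectBH1GReadWriteYR`, exactly its 2 class-dependent declarations over the CLASS-PARAMETRIC carrier `B9SectBCodedClassR.bg9YC 𝔸 G P x` (`P : RegExtraY …` = the two cube conditions of (3.35)∕(3.36) as a parameter; `bg9Y 𝔸 G x = bg9YC 𝔸 G (extraY 𝔸 G) x` by `rfl`, so every declaration here specialises definitionally to its original; at the record's reading of PRINT's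 class, `P := extraYPb 𝔸 G`, the displayed laws `hreg335P` ((3.35) on plaquettes) and the class-keyed `hunitA` become theorems).  The text is the original's VERBATIM under the token surgery `bg9Y 𝔸 G ↦ bg9YC 𝔸 G P`, `NAME ↦ NAME P` for the class-dependent names (P the first explicit argument), and — №277 — the binder `hunitA` re-keyed from «all G-valued U» to «all (3.35)-regular U of the carrier» (`∀ j α₀ U, (bg9YC 𝔸 G P (f j)).Reg335 c35 α₀ U → IsUnit (deltaAY …)`) — a clause IDLE in this twin (no `hunitA` here; v1.1).  Class-free declarations of the original are NOT copied: they are imported and used BY NAME (`open … hiding` the re-declared ones).  Generated by dag-n06-c g16's `gen.py` (HOME `pub-ymgap-dag-n06-c/lean/g16/`); the ORIGINAL MODULE DOCUMENTATION FOLLOWS VERBATIM and describes the mathematics.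

HONEST SCOPE.  Re-typing bookkeeping; nothing of [B9] asserted beyond the original; COUNT-NEUTRAL; N06 NOT discharged; nothing continuum ∕ OS ∕ mass gap ∕ Clay.  Cell `pub-ymgap` (D-0062), Track A node N06 [B9], seat `pub-ymgap-dag-n06-c` g16, 2026-08-29.
-/

/-! Module documentation: that of the original `Balaban1983to89.B9SectBH1GReadWriteY` applies verbatim to this twin (not repeated here). -/

noncomputable section

namespace Literature.MathematicalPhysics.QuantumFieldTheory.Balaban1983to89.B9SectBH1GReadWriteYR

open Literature.MathematicalPhysics.QuantumFieldTheory.Balaban1983to89.B9SectBCodedClassR (RegExtraY bg9YC)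
open Literature.MathematicalPhysics.QuantumFieldTheory.Balaban1983to89.B9SectBH1GReadWriteY hiding KACU_h1_inr_eq KACU_h1_off

open LatticeFieldCalculus (supDist)
open B9Eq39Adjoint (R R_smul R_zero R_sub R_add)
open B6GlobalChartV1 (PV)
open B6KLevelCensusIndexV1 (KIdx Adm)
open B9CoReadingCoords (cdBₗ cdsBₗ cdBₗ_apply cdsBₗ_apply)
open B9PinMembersKLevelV1 (MemberY geo9Y)
open B9Eq360DeltaPrimeAY (AfldY)
open B9SectBGpFrameCodedYR (codingYx)
open B9SectBGpReadingsY (baseY)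
open B9SectBGpLettersY (decY)
open B9SectBCodedReadingsUR (KACU)
open Node00 (FBondY CfgY BallY BondOpY BondParY liftY liftY_apply holderQB cdB cdsB iSup_ball_le)
open Node00.OpsYHolderFar (holderQB_nonneg pair_le_holderQB holderQB_le_of_forall_adm)
open Node00.OpsYRead342 (liftY_eq_sum_repr liftY_smul_right)
open Node00.OpsYULetters (kernelFamilyBU kernelFamilyBU_h1_inr)
open B9Thm314WholeExpansionReads (le_iSup_ball_max)

variable {d ℓ : ℕ} {hd : 1 ≤ d + 1} {hL : Odd (ℓ + 1) ∧ 1 < ℓ + 1} {b₀ b₁ : ℝ} {Mstar : ℕ}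
variable {𝔸 : Type} [NormedRing 𝔸] (P : RegExtraY d ℓ hd hL b₀ b₁ Mstar 𝔸) [NormedAlgebra ℂ 𝔸] [CompleteSpace 𝔸]
variable (i : KIdx d ℓ hd hL b₀ b₁)

/-! ## §1 The pair weight, the pair-probe functional -/

/-! ## §2 The (3.43) bond reading of a fixed operator in the letters of `U` -/

/-- ★ the (3.43) member of the coded bond family `KACU` at a coded configuration `c`: the reading of `OA (dec c)` in the letters of `base c` (`rfl`).
[cite: Balaban1985BackgroundPropagators, (3.43) p.398, Thm 3.4 p.400, bookkeeping] -/
theorem KACU_h1_inr_eq (G : Subgroup 𝔸ˣ) (x : MemberY d ℓ hd hL b₀ b₁ Mstar) (OA : BondOpY 𝔸 x.toKIdx) (parB : BondParY 𝔸 x.toKIdx)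
    (C37 C38 : ℝ → CfgY 𝔸 x.toKIdx → AfldY 𝔸 x.toKIdx → Prop) (c : (codingYx P G x C37 C38).bg.Cfg) (J : FBondY x.toKIdx → ℝ) (α : ℝ)
    (z : FBondY x.toKIdx → ℝ) :
    (KACU P G x OA parB C37 C38).h1 c (.inr J) α (.inr z) =
      h1ReadB x.toKIdx (OA (decY x.toKIdx c)) (parB (baseY x.toKIdx c)) (baseY x.toKIdx c) J α z := rfl

/-- the (3.43) member of `KACU` vanishes OFF the (bond argument, bond cut-off) sector (`rfl` ×3). [cite: Balaban1985BackgroundPropagators, (3.43) p.398, bookkeeping] -/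
theorem KACU_h1_off (G : Subgroup 𝔸ˣ) (x : MemberY d ℓ hd hL b₀ b₁ Mstar) (OA : BondOpY 𝔸 x.toKIdx) (parB : BondParY 𝔸 x.toKIdx)
    (C37 C38 : ℝ → CfgY 𝔸 x.toKIdx → AfldY 𝔸 x.toKIdx → Prop) (c : (codingYx P G x C37 C38).bg.Cfg) (α : ℝ) :
    (∀ (J : FBondY x.toKIdx → ℝ) (zs : Node00.SiteY x.toKIdx → ℝ), (KACU P G x OA parB C37 C38).h1 c (.inr J) α (.inl zs) = 0) ∧
    (∀ (f : Node00.SiteY x.toKIdx → ℝ) (ζ : (geo9Y x).Cut), (KACU P G x OA parB C37 C38).h1 c (.inl f) α ζ = 0) := by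
  refine ⟨fun J zs => rfl, fun f ζ => ?_⟩
  rcases ζ with z | z <;> rfl

/-! ## §3 The uniform bound over the unit ball (the `BddAbove` of the reader's `⨆_E`) -/

section Ball

variable {ι : Type} [Fintype ι] (b : Module.Basis ι ℝ 𝔸) (par : Site (PV d ℓ i.m i.K hd hL) 0 → Site (PV d ℓ i.m i.K hd hL) 0 → 𝔸ˣ)

variable (T : (FBondY i → 𝔸) →ₗ[ℂ] (FBondY i → 𝔸)) (U : CfgY 𝔸 i)

/-! ## §4 READ: every word at a unit-ball direction, and every admissible pair probe of it, is below the reading -/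

end Ball

/-! ## §5 WRITE: a common bound on all admissible pair probes bounds the reading -/

/-! ## §6 General `𝔸`-valued inputs: `Σ_j J_j ⊗ b_j` -/

section General

variable {ι : Type} [Fintype ι] (b : Module.Basis ι ℝ 𝔸) (T : (FBondY i → 𝔸) →ₗ[ℂ] (FBondY i → 𝔸))
  (par : Site (PV d ℓ i.m i.K hd hL) 0 → Site (PV d ℓ i.m i.K hd hL) 0 → 𝔸ˣ) (U : CfgY 𝔸 i)

end General

end Literature.MathematicalPhysics.QuantumFieldTheory.Balaban1983to89.B9SectBH1GReadWriteYR

end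

/-!
# `Balaban1983to89.B9SectBH1GFrameCodedYR` — THE CLASS-PARAMETRIC TWIN of `B9SectBH1GFrameCodedY` (CASCADE-R, director-ym №279 GO-R; №277 (3) `hunitA` cure; dag-n06-d SOCKET-(α) class question)

statement-level skeleton of published theorems with citation tags; proofs where landed; nothing here is a claim about the
Yang–Mills mass gap

WHAT THIS FILE IS.  The original module `B9SectBH1GFrameCodedY` types its objects over MODULE 3's member carrier `bg9Y 𝔸 G x` (MODULE 2's small-cube class (3.35)).  This file RE-DECLARES, with UNCHANGED NAMES inside the namespace `…B9SectBH1GFrameCodedYR`, exactly its 3 class-dependent declarations over the CLASS-PARAMETRIC carrier `B9SectBCodedClassR.bg9YC 𝔸 G P x` (`P : RegExtraY …` = the two cube conditions of (3.35)∕(3.36) as a parameter; `bg9Y 𝔸 G x = bg9YC 𝔸 G (extraY 𝔸 G) x` by `rfl`, so every declaration here WITHOUT the `hunitA` binder specialises definitionally to its original; EXCEPTION (v1.1, №288 (4), ref-E READ-9 HEADER-NIT): `h1GFrame₆CodedOn`, `stepH1Pos_KACU_frame_on` carry the №277 RE-KEYED `hunitA` (WEAKER hypothesis), so at `P := extraY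 𝔸 G` they IMPLY the originals via `fun j α₀ U hU => hunitA j U hU.1.1` (ref-E K3), NOT a definitional specialisation; CAVEAT (LOCATED-18, №290 (1)): no α₀-threshold ⇒ still uninhabitable at `SU(N)` — consumers use the GUARDED `…RG` twin; at the record's reading of PRINT's class, `P := extraYPb 𝔸 G`, the displayed laws `hreg335P` ((3.35) on plaquettes) and the class-keyed `hunitA` become theorems).  The text is the original's VERBATIM under the token surgery `bg9Y 𝔸 G ↦ bg9YC 𝔸 G P`, `NAME ↦ NAME P` for the class-dependent names (P the first explicit argument), and — №277 — the binder `hunitA` re-keyed from «all G-valued U» to «all (3.35)-regular U of the carrier» (`∀ j α₀ U, (bg9YC 𝔸 G P (f j)).Reg335 c35 α₀ U → IsUnit (deltaAY …)`) with its use sites (`hunitA j U hU ↦ hunitA j α₀ U hU`) — NOT verbatim for the declarations named above.  Class-free declarations of the original are NOT copied: they are imported and used BY NAME (`open … hiding` the re-declared ones).  Generated by dag-n06-c g16's `gen.py` (HOME `pub-ymgap-dag-n06-c/lean/g16/`); the ORIGINAL MODULE DOCUMENTATION FOLLOWS VERBATIM and describes the mathematics.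

HONEST SCOPE.  Re-typing bookkeeping; nothing of [B9] asserted beyond the original; COUNT-NEUTRAL; N06 NOT discharged; nothing continuum ∕ OS ∕ mass gap ∕ Clay.  Cell `pub-ymgap` (D-0062), Track A node N06 [B9], seat `pub-ymgap-dag-n06-c` g16, 2026-08-29.
-/

/-! Module documentation: that of the original `Balaban1983to89.B9SectBH1GFrameCodedY` applies verbatim to this twin (not repeated here). -/

noncomputable section

namespace Literature.MathematicalPhysics.QuantumFieldTheory.Balaban1983to89.B9SectBH1GFrameCodedYR

open Literature.MathematicalPhysics.QuantumFieldTheory.Balaban1983to89.B9SectBCodedClassR (RegExtraY bg9YC)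
open Literature.MathematicalPhysics.QuantumFieldTheory.Balaban1983to89.B9SectBH1GFrameCodedY hiding h1G_transfer_KACU h1GFrame₆CodedOn stepH1Pos_KACU_frame_on

open LatticeFieldCalculus (supDist)
open B9Eq39Adjoint (R R_smul R_zero R_sub R_add)
open B6GlobalChartV1 (PV blkV1 boxEquiv)
open B6Geom246MultiLevelTorus (geomT)
open B6Ineq2142KLevelV1 (β beta_level)
open B6KLevelCensusIndexV1 (KIdx Adm kGeo)
open B6RandomWalk (HasMajorant hasMajorant_mono BlockSupp Ineq261)
open B9Thm34Ext (toB6)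
open B9FromB6 (EBlock H1Block)
open B9GeoNormsKLevelV1 (geo9K geo9K_dist_nonneg)
open B9GeoLemma21KLevelV1 (geo9Y_dist_comm geo9Y_dist_triangle geo9Y_len_pos one_le_k)
open B9Eq310Hermitian (norm_R_le)
open B9Eq352DivFormLetters (conj coordEquiv conj_mul)
open B9Eq352GradLetters (diffLetter)
open B9Eq371GradLetters (bT bU)
open B9CoReadingCoords (cdBₗ cdsBₗ cdBₗ_apply cdsBₗ_apply)
open B9PinMembersKLevelV1 (MemberY geo9Y bg9Y)
open B9Eq360DeltaPrimeAY (AfldY)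
open B9SectBGpLettersY (GVal decY decY_base blkC coordC norm_le_one_and_inv_of_mem)
open B9SectBL2DictionaryY (coordC_base_eq)
open B9SectBGpFrameCodedYR (codingYx)
open B9SectBGpFrameCodedY (CplxLettersY)
open B9SectBGpReadingsYR (KSC)
open B9SectBGpReadingsY (baseY)
open B9SectBCodedCarrier (CCfg pullS)
open B9SectBCodedReadingsUR (KACU)
open B9SectBKerFrameCodedYR (CinvY)
open B9SectBStepWhole (StepPos StepH1Pos)
open B9RWSumsReadsNbr (nbr mem_nbr)
open B9RWSumsCompleteGeo9YNbr (len_le_of_dist_lt_M_geo9K)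
open B9GeoNormsKLevelModelSignsV1 (modelSignsOn_geo9K)
open Node00 (SiteY BlkY FBondY IBondY CfgY BallY SiteParY BondParY BondOpY liftY liftY_apply holderQB cdB cdsB UboxY shiftY GAY GpY XY deltaAY deltaPrimeAY
  bondCoordsY bondFunCoordsY)
open B9SectBGWordDeltaAY (bondOpCoordsRY GbC)
open B9SectBGReadCodedY (eta_inv_eq_abs_cf hasMajorant_of_eq hasMajorant_conj_bondOpCoordsRY GbC_eq_conj_bondOpCoordsRY bondOpCoordsRY_mul)
open B9SectBGReadYR (readG342Y_KACU)
open B9SectBGFrameCodedYR (gFrame₅CodedOn)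
open B9SectBGFrameCodedY (cXY cXY_nonneg parB_contractive)
open B9SectBGClassLettersY (Reg335PlaqY CplxLettersGY VarParBY)
open B9SectBH1GFrameV6 (H1GFrame₆ stepH1Pos_of_h1GFrame₆)
open B9SectBH1GReadWriteYR (KACU_h1_inr_eq KACU_h1_off)
open B9SectBH1GReadWriteY (probeB norm_probeB norm_probeB_neg h1ReadB h1ReadB_le_of_probes probeB_apply)
open B9SectBH1GProbesY (lamB lamB_GbC lamB_DL_GbC lamB_GbC_DR lamB_GbC_DF lamB_conj_bondOpCoordsRY lamB_coordEquiv_bondFunCoordsY norm_map_symm_mul_diffLetter_inr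
  norm_map_symm_mul_diffLetter_inl probeBC probeBC_symm blockSupp_coordEquiv_bondFun_liftY probeL_lamB_le probeR_lamB_le norm_lamB_le_of_hasMajorant
  probe_crossB_lamB_le)
open B9SectBH1GUndiffY (HolderLipBY lenB lenB_pos probeB_undiff_le cutH_inr_nonneg)

variable {d ℓ : ℕ} {hd : 1 ≤ d + 1} {hL : Odd (ℓ + 1) ∧ 1 < ℓ + 1} {b₀ b₁ : ℝ} {Mstar : ℕ}
variable {𝔸 : Type} [NormedRing 𝔸] (P : RegExtraY d ℓ hd hL b₀ b₁ Mstar 𝔸) [NormedAlgebra ℂ 𝔸] [CompleteSpace 𝔸]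

/-! ## §1 The output writing function and two real-power bookkeeping lemmas -/

/-! ## §2 ★★ The transfer field of the (3.43) frame PROVED at def-Y's bond letters for `KACU` -/

section Transfer

variable [NormOneClass 𝔸] (c35 : ℝ) (G : Subgroup 𝔸ˣ) (x : MemberY d ℓ hd hL b₀ b₁ Mstar) (par : SiteParY 𝔸 x.toKIdx) (parB : BondParY 𝔸 x.toKIdx)
  {ι : Type} [Fintype ι] (b : Module.Basis ι ℝ 𝔸) (ιB : BlkY x.toKIdx → IBondY x.toKIdx) [Fintype (geo9Y x).Site]
  (C37 C38 : ℝ → CfgY 𝔸 x.toKIdx → AfldY 𝔸 x.toKIdx → Prop)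

set_option maxHeartbeats 1600000 in
/-- ★★ **THE TRANSFER FIELD OF THE (3.43) BOND-SECTOR FRAME, PROVED FOR `KACU` AT def-Y's LETTERS** (see the module header for the proof plan): from r06's per-probe
left and right Hölder transfers for the letter `GbC` of the member (hypotheses `HL`, `HR`, the shapes of `H1GFrame₆.h1G_transfer`), the (3.42)∕(3.43) blocks of
`KACU` at the base, the bond transporter law `HolderLipBY` at the regular base and the neighbour count, the (3.43) block of `KACU` at the coded product with
`(wHG6 … B₀ B δc Bβ, δc∕6)`.
[cite: Balaban1985BackgroundPropagators, Thm 3.4 p.400, Thm 3.3 p.399, (3.43) p.398, (3.40) p.397, p.403 l.1–9, (3.82)–(3.86) p.407; Balaban1984PropagatorsII, (2.51)–(2.52) p.232, Lemma 2.1 p.234, (2.60) p.234] -/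
theorem h1G_transfer_KACU (hι : ∀ s : BlkY x.toKIdx, β x.toKIdx.hN x.toKIdx.D x.toKIdx.hk (ιB s) = s)
    (hG1 : ∀ u : 𝔸ˣ, u ∈ G → ‖(u : 𝔸)‖ ≤ 1) (hparB : ∀ U : CfgY 𝔸 x.toKIdx, GVal G x.toKIdx U → ∀ s s', parB U s s' ∈ G)
    {M₂ : ℝ} (hM₂ : 0 ≤ M₂) (hrepr : ∀ (v : 𝔸) (j : ι), |b.repr v j| ≤ M₂ * ‖v‖)
    {cLip rL : ℝ} (hcLip : 0 ≤ cLip) (hrL : 0 ≤ rL)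
    (hLipB : ∀ (α₀ : ℝ) (U : CfgY 𝔸 x.toKIdx), (bg9YC 𝔸 G P x).Reg335 c35 α₀ U → HolderLipBY x.toKIdx cLip rL (parB U) U)
    {MInv : ℝ} {mN : ℕ} (hnbr : MInv ≤ (geo9Y x).M → ∀ y' : IBondY x.toKIdx, (nbr (geo9Y x) (2 * ((d : ℝ) + 1)) y').card ≤ mN)
    (hMr : rL + 1 < MInv) (cRG : ℝ → ℝ) {aInv aW : ℝ}
    (α₀ : ℝ) (c c' : (codingYx P G x C37 C38).bg.Cfg) (α₁ B₀ B δ δc : ℝ) (Bβ : ℝ → ℝ)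
    (hM : MInv ≤ (geo9Y x).M) (_hα₀ : 0 < α₀) (_hMa : (geo9Y x).M * α₀ ≤ aInv) (hreg : (codingYx P G x C37 C38).bg.Reg335 c35 α₀ c)
    (_hα₁ : 0 < α₁) (_haW : α₁ ≤ aW) (h37 : (codingYx P G x C37 C38).bg.Cplx337 α₁ c c') (hB₀ : 0 < B₀) (hB : 0 ≤ B)
    (_hδ : 0 < δ) (hδc : 0 < δc) (hδcδ : δc ≤ δ) (hcRG : M₂ * (∑ j, ‖b j‖) ≤ cRG δ)
    (hE : EBlock (KACU P G x (GAY x.toKIdx par parB (GpY x.toKIdx par)) parB C37 C38) B₀ δ c)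
    (hH1 : H1Block (KACU P G x (GAY x.toKIdx par parB (GpY x.toKIdx par)) parB C37 C38) Bβ δ c)
    (HL : ∀ (D : Module.End ℝ ((Fin (d + 1) × SiteY x.toKIdx) × ι → ℝ)) (Φ : (Fin (d + 1) × SiteY x.toKIdx → 𝔸) →ₗ[ℝ] 𝔸) (y : IBondY x.toKIdx)
      (p₀ : (Fin (d + 1) × SiteY x.toKIdx) × ι), blkC x.toKIdx ιB p₀.1.2 = y → ∀ (β' Bh cζ : ℝ), 0 ≤ Bh → 0 ≤ cζ →
        (∀ (y' : IBondY x.toKIdx) (μ : (Fin (d + 1) × SiteY x.toKIdx) × ι → ℝ) (M : ℝ),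
          BlockSupp (g := toB6 (geo9Y x) (0 : ℝ) True) (fun q : (Fin (d + 1) × SiteY x.toKIdx) × ι => blkC x.toKIdx ιB q.1.2) μ y' M →
          ‖Φ ((coordEquiv b).symm (D (GbC x.toKIdx par parB b c μ)))‖ ≤
            Bh * (geo9Y x).len y ^ (1 - β') * cζ * Real.exp (-(δc * (geo9Y x).dist y y')) * M) →
        ∀ (y' : IBondY x.toKIdx) (μ : (Fin (d + 1) × SiteY x.toKIdx) × ι → ℝ) (M : ℝ),
          BlockSupp (g := toB6 (geo9Y x) (0 : ℝ) True) (fun q : (Fin (d + 1) × SiteY x.toKIdx) × ι => blkC x.toKIdx ιB q.1.2) μ y' M →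
          ‖Φ ((coordEquiv b).symm (D (GbC x.toKIdx par parB b ((codingYx P G x C37 C38).bg.mul c' c) μ)))‖ ≤
            B * Bh * (geo9Y x).len y ^ (1 - β') * cζ * Real.exp (-(δc / 6 * (geo9Y x).dist y y')) * M)
    (HR : ∀ (Ds : Module.End ℝ ((Fin (d + 1) × SiteY x.toKIdx) × ι → ℝ)),
      HasMajorant (g := toB6 (geo9Y x) (0 : ℝ) True) (fun q : (Fin (d + 1) × SiteY x.toKIdx) × ι => blkC x.toKIdx ιB q.1.2)
        (GbC x.toKIdx par parB b c * Ds) (fun a a' => cRG δ * B₀ * (geo9Y x).len a * Real.exp (-(δc * (geo9Y x).dist a a'))) →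
      ∀ (Φ : (Fin (d + 1) × SiteY x.toKIdx → 𝔸) →ₗ[ℝ] 𝔸) (y : IBondY x.toKIdx) (p₀ : (Fin (d + 1) × SiteY x.toKIdx) × ι),
      blkC x.toKIdx ιB p₀.1.2 = y → ∀ (γ Bh cζ : ℝ), 0 ≤ Bh → 0 ≤ cζ →
        (∀ (y' : IBondY x.toKIdx) (μ : (Fin (d + 1) × SiteY x.toKIdx) × ι → ℝ) (M : ℝ),
          BlockSupp (g := toB6 (geo9Y x) (0 : ℝ) True) (fun q : (Fin (d + 1) × SiteY x.toKIdx) × ι => blkC x.toKIdx ιB q.1.2) μ y' M →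
          ‖Φ ((coordEquiv b).symm (GbC x.toKIdx par parB b c μ))‖ ≤
            Bh * (geo9Y x).len y ^ (2 - γ) * cζ * Real.exp (-(δc * (geo9Y x).dist y y')) * M) →
        (∀ (k : Fin (d + 1) ⊕ Fin (d + 1)) (y' : IBondY x.toKIdx) (μ : (Fin (d + 1) × SiteY x.toKIdx) × ι → ℝ) (M : ℝ),
          BlockSupp (g := toB6 (geo9Y x) (0 : ℝ) True) (fun q : (Fin (d + 1) × SiteY x.toKIdx) × ι => blkC x.toKIdx ιB q.1.2) μ y' M →
          ‖Φ ((coordEquiv b).symm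
              ((GbC x.toKIdx par parB b c * conj b (diffLetter (bT (shiftY x.toKIdx)) (bU (coordC G x.toKIdx c)) ((((geo9Y x).eta : ℂ))⁻¹) k)) μ))‖ ≤
            Bh * (geo9Y x).len y ^ (1 - γ) * cζ * Real.exp (-(δc * (geo9Y x).dist y y')) * M) →
        (∀ (y' : IBondY x.toKIdx) (μ : (Fin (d + 1) × SiteY x.toKIdx) × ι → ℝ) (M : ℝ),
          BlockSupp (g := toB6 (geo9Y x) (0 : ℝ) True) (fun q : (Fin (d + 1) × SiteY x.toKIdx) × ι => blkC x.toKIdx ιB q.1.2) μ y' M →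
          ‖Φ ((coordEquiv b).symm ((GbC x.toKIdx par parB b c * Ds) μ))‖ ≤
            Bh * (geo9Y x).len y ^ (1 - γ) * cζ * Real.exp (-(δc * (geo9Y x).dist y y')) * M) →
        ∀ (y' : IBondY x.toKIdx) (μ : (Fin (d + 1) × SiteY x.toKIdx) × ι → ℝ) (M : ℝ),
          BlockSupp (g := toB6 (geo9Y x) (0 : ℝ) True) (fun q : (Fin (d + 1) × SiteY x.toKIdx) × ι => blkC x.toKIdx ιB q.1.2) μ y' M →
          ‖Φ ((coordEquiv b).symm ((GbC x.toKIdx par parB b ((codingYx P G x C37 C38).bg.mul c' c) * Ds) μ))‖ ≤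
            B * Bh * (geo9Y x).len y ^ (1 - γ) * cζ * Real.exp (-(δc / 6 * (geo9Y x).dist y y')) * M) :
    H1Block (KACU P G x (GAY x.toKIdx par parB (GpY x.toKIdx par)) parB C37 C38)
      (wHG6 (2 * ((d : ℝ) + 1)) (((ℓ + 1 : ℕ) : ℝ)) (∑ j, ‖b j‖) M₂ (M₂ * ∑ j, ‖b j‖) cLip rL mN B₀ B δc Bβ) (δc / 6)
      ((codingYx P G x C37 C38).bg.mul c' c) := by
  classical
  letI : Fintype (B9GeoNormsKLevelV1.geo9K x.toKIdx).Site := ‹Fintype (geo9Y x).Site›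
  -- the coded pair is (base U, mult a); the product is `prod U a`
  obtain ⟨U, a, rfl, rfl, hCa⟩ := (codingYx P G x C37 C38).exists_of_bg_Cplx337 h37
  have hU335 : (bg9YC 𝔸 G P x).Reg335 c35 α₀ U := by
    obtain ⟨U', h1, h2⟩ := (codingYx P G x C37 C38).exists_of_bg_Reg335 hreg
    cases h1
    exact h2
  have hU : GVal G x.toKIdx U := hU335.1.1
  -- notation and elementary facts
  set Sb : ℝ := ∑ j, ‖b j‖ with hSb
  have hSb0 : 0 ≤ Sb := Finset.sum_nonneg fun j _ => norm_nonneg _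
  set L : ℝ := (((ℓ + 1 : ℕ) : ℝ)) with hLdef
  have hL1 : 1 ≤ L := by rw [hLdef]; exact_mod_cast Nat.succ_le_succ (Nat.zero_le ℓ)
  have hL0 : 0 ≤ L := le_trans zero_le_one hL1
  set OA : BondOpY 𝔸 x.toKIdx := GAY x.toKIdx par parB (GpY x.toKIdx par) with hOA
  set TU : (FBondY x.toKIdx → 𝔸) →ₗ[ℂ] (FBondY x.toKIdx → 𝔸) := OA U with hTU
  set TW : (FBondY x.toKIdx → 𝔸) →ₗ[ℂ] (FBondY x.toKIdx → 𝔸) := OA (decY x.toKIdx (.prod U a)) with hTW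
  have hco : coordC G x.toKIdx (.base U) = UboxY x.toKIdx U := coordC_base_eq G x hU
  have hη : ((((geo9Y x).eta : ℂ)))⁻¹ = ((|x.toKIdx.cf| : ℝ) : ℂ) := eta_inv_eq_abs_cf x.toKIdx
  have hDk : ∀ k : Fin (d + 1) ⊕ Fin (d + 1),
      diffLetter (bT (shiftY x.toKIdx)) (bU (coordC G x.toKIdx (.base U))) ((((geo9Y x).eta : ℂ))⁻¹) k =
        diffLetter (bT (shiftY x.toKIdx)) (bU (UboxY x.toKIdx U)) ((|x.toKIdx.cf| : ℝ) : ℂ) k := by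
    intro k; rw [hco, hη]
  have hUu : ∀ (ν : Fin (d + 1)) (s : Site (PV d ℓ x.m x.K hd hL) 0),
      ‖((U ν s : 𝔸ˣ) : 𝔸)‖ ≤ 1 ∧ ‖(((U ν s)⁻¹ : 𝔸ˣ) : 𝔸)‖ ≤ 1 := fun ν s => norm_le_one_and_inv_of_mem G hG1 (hU ν s)
  have hparU : ∀ s s' : Site (PV d ℓ x.m x.K hd hL) 0, ‖((parB U s s' : 𝔸ˣ) : 𝔸)‖ ≤ 1 ∧ ‖(((parB U s s')⁻¹ : 𝔸ˣ) : 𝔸)‖ ≤ 1 :=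
    parB_contractive G x parB hG1 (hparB U hU)
  have hLipU : HolderLipBY x.toKIdx cLip rL (parB U) U := hLipB α₀ U hU335
  have hnbrU := hnbr hM
  have hMgeo : rL + 1 < (geo9Y x).M := lt_of_lt_of_le hMr hM
  have hM1 : (1 : ℝ) < (geo9Y x).M := lt_of_le_of_lt (le_add_of_nonneg_left hrL) hMgeo
  have hdd : 0 ≤ 2 * ((d : ℝ) + 1) := by positivity
  have hdn : ∀ a a' : IBondY x.toKIdx, 0 ≤ (geo9Y x).dist a a' := fun a a' => geo9K_dist_nonneg x.toKIdx a a'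
  have hk1 : 1 ≤ x.toKIdx.k := one_le_k x.toKIdx
  have htri := (B6Geom246MultiLevelTorus.triangle_refl_nonneg_T x.toKIdx.D (B9GeoLemma21KLevelV1.one_le_Mh x.toKIdx)
    (B9GeoLemma21KLevelV1.one_le_P x.toKIdx)).1
  -- the (3.42) majorants of the bond letters at the base (def-Y's carrier, rate δ), transported to r06's carrier and lowered to the call rate δc
  have cR0 : 0 ≤ M₂ * Sb := mul_nonneg hM₂ hSb0
  have hcB : 0 ≤ M₂ * Sb * B₀ := mul_nonneg cR0 hB₀.le
  obtain ⟨g0, g1, g2, -⟩ := readG342Y_KACU P (Rr := 0) (Hp := True) b G x OA parB C37 C38 ιB hι hM₂ hrepr hB₀.le hE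
  have lower : ∀ (w : IBondY x.toKIdx → ℝ) (hw : ∀ a, 0 ≤ w a) {T : Module.End ℝ ((Fin (d + 1) × SiteY x.toKIdx) × ι → ℝ)},
      HasMajorant (g := toB6 (geo9Y x) (0 : ℝ) True) (fun q : (Fin (d + 1) × SiteY x.toKIdx) × ι => blkC x.toKIdx ιB q.1.2) T
        (fun a a' => M₂ * Sb * (B₀ * w a * Real.exp (-(δ * (geo9Y x).dist a a')))) →
      HasMajorant (g := toB6 (geo9Y x) (0 : ℝ) True) (fun q : (Fin (d + 1) × SiteY x.toKIdx) × ι => blkC x.toKIdx ιB q.1.2) T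
        (fun a a' => M₂ * Sb * B₀ * w a * Real.exp (-(δc * (geo9Y x).dist a a'))) := by
    intro w hw T h
    refine hasMajorant_mono _ h fun a a' => ?_
    have hexp : Real.exp (-(δ * (geo9Y x).dist a a')) ≤ Real.exp (-(δc * (geo9Y x).dist a a')) :=
      Real.exp_le_exp.2 (by nlinarith [hdn a a'])
    calc M₂ * Sb * (B₀ * w a * Real.exp (-(δ * (geo9Y x).dist a a'))) = (M₂ * Sb * B₀ * w a) * Real.exp (-(δ * (geo9Y x).dist a a')) := by ring
      _ ≤ (M₂ * Sb * B₀ * w a) * Real.exp (-(δc * (geo9Y x).dist a a')) :=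
        mul_le_mul_of_nonneg_left hexp (mul_nonneg hcB (hw a))
  have hm0 : HasMajorant (g := toB6 (geo9Y x) (0 : ℝ) True) (fun q : (Fin (d + 1) × SiteY x.toKIdx) × ι => blkC x.toKIdx ιB q.1.2)
      (conj b (bondOpCoordsRY x.toKIdx (TU.restrictScalars ℝ)))
      (fun a a' => M₂ * Sb * B₀ * (geo9Y x).len a ^ 2 * Real.exp (-(δc * (geo9Y x).dist a a'))) :=
    lower (fun a => (geo9Y x).len a ^ 2) (fun a => sq_nonneg _) (hasMajorant_conj_bondOpCoordsRY x.toKIdx b ιB _ g0)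
  have hm1 : ∀ ν : Fin (d + 1), HasMajorant (g := toB6 (geo9Y x) (0 : ℝ) True) (fun q : (Fin (d + 1) × SiteY x.toKIdx) × ι => blkC x.toKIdx ιB q.1.2)
      (conj b (bondOpCoordsRY x.toKIdx (cdBₗ x.toKIdx U ν ∘ₗ TU.restrictScalars ℝ)))
      (fun a a' => M₂ * Sb * B₀ * (geo9Y x).len a * Real.exp (-(δc * (geo9Y x).dist a a'))) := fun ν =>
    lower (fun a => (geo9Y x).len a) (fun a => (geo9Y_len_pos x a).le) (hasMajorant_conj_bondOpCoordsRY x.toKIdx b ιB _ (g1 ν))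
  have hGbU : GbC x.toKIdx par parB b (.base U) = conj b (bondOpCoordsRY x.toKIdx (TU.restrictScalars ℝ)) := by
    rw [GbC_eq_conj_bondOpCoordsRY, decY_base]
  have hm2 : ∀ ν : Fin (d + 1), HasMajorant (g := toB6 (geo9Y x) (0 : ℝ) True) (fun q : (Fin (d + 1) × SiteY x.toKIdx) × ι => blkC x.toKIdx ιB q.1.2)
      (GbC x.toKIdx par parB b (.base U) * conj b (bondOpCoordsRY x.toKIdx (cdsBₗ x.toKIdx U ν)))
      (fun a a' => cRG δ * B₀ * (geo9Y x).len a * Real.exp (-(δc * (geo9Y x).dist a a'))) := by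
    intro ν
    have h := lower (fun a => (geo9Y x).len a) (fun a => (geo9Y_len_pos x a).le) (hasMajorant_conj_bondOpCoordsRY x.toKIdx b ιB _ (g2 ν))
    have heq : conj b (bondOpCoordsRY x.toKIdx (TU.restrictScalars ℝ ∘ₗ cdsBₗ x.toKIdx U ν)) =
        GbC x.toKIdx par parB b (.base U) * conj b (bondOpCoordsRY x.toKIdx (cdsBₗ x.toKIdx U ν)) := by
      rw [hGbU, ← B9Eq352DivFormLetters.conj_mul, ← bondOpCoordsRY_mul]; rfl
    refine hasMajorant_mono _ (hasMajorant_of_eq x.toKIdx heq.symm h) fun a a' => ?_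
    have hfac : 0 ≤ B₀ * (geo9Y x).len a * Real.exp (-(δc * (geo9Y x).dist a a')) := mul_nonneg (mul_nonneg hB₀.le (geo9Y_len_pos x a).le) (Real.exp_pos _).le
    calc M₂ * Sb * B₀ * (geo9Y x).len a * Real.exp (-(δc * (geo9Y x).dist a a')) = (M₂ * Sb) * (B₀ * (geo9Y x).len a * Real.exp (-(δc * (geo9Y x).dist a a'))) := by
          ring
      _ ≤ cRG δ * (B₀ * (geo9Y x).len a * Real.exp (-(δc * (geo9Y x).dist a a'))) := mul_le_mul_of_nonneg_right hcRG hfac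
      _ = _ := by ring
  -- the output block
  intro α lam ζ y y' hα0 hα1 hζ hlam
  set W5 : ℝ := wHG6 (2 * ((d : ℝ) + 1)) L Sb M₂ (M₂ * Sb) cLip rL mN B₀ B δc Bβ α with hW5def
  have hW5 : 0 ≤ W5 := wHG6_nonneg mN Bβ hL0 hSb0 hM₂ cR0 hcLip hB₀.le hB α
  have hleny : 0 < (geo9Y x).len y := geo9Y_len_pos x y
  have hcutH : 0 ≤ (geo9Y x).cutH α ζ := (modelSignsOn_geo9K x.toKIdx).cutH_nonneg α ζ
  have hsupN : 0 ≤ (geo9Y x).supNorm lam := (modelSignsOn_geo9K x.toKIdx).supNorm_nonneg lam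
  have hRHS : 0 ≤ W5 * (geo9Y x).len y ^ (1 - α) * (geo9Y x).cutH α ζ * Real.exp (-(δc / 6 * (geo9Y x).dist y y')) * (geo9Y x).supNorm lam :=
    mul_nonneg (mul_nonneg (mul_nonneg (mul_nonneg hW5 (Real.rpow_nonneg hleny.le _)) hcutH) (Real.exp_pos _).le) hsupN
  -- only (bond argument, bond cut-off) is nontrivial
  rcases lam with f | J
  · rw [(KACU_h1_off P G x OA parB C37 C38 _ α).2 f ζ]; exact hRHS
  rcases ζ with zs | z
  · rw [(KACU_h1_off P G x OA parB C37 C38 _ α).1 J zs]; exact hRHS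
  -- the U-letter reading of `G(U′U)` at the base `U`
  rw [KACU_h1_inr_eq]
  show h1ReadB x.toKIdx TW (parB U) U J α z ≤ _
  have hζ' : ∀ q, z q ≠ 0 → (geomT x.toKIdx.D).dist (blkV1 x.toKIdx.hN x.toKIdx.D q) (β x.toKIdx.hN x.toKIdx.D x.toKIdx.hk y) ≤ 1 := hζ
  -- the anchor: the labelled block of `y`, through a site `w₀` of the block `βy`
  obtain ⟨w₀, hw₀⟩ := B6Geom246MultiLevelBox.exists_blkOf_eq x.toKIdx.D.toDomains (β x.toKIdx.hN x.toKIdx.D x.toKIdx.hk y)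
  set y₁ : IBondY x.toKIdx := blkC x.toKIdx ιB w₀ with hy₁
  have hy₁' : y₁ = ιB (β x.toKIdx.hN x.toKIdx.D x.toKIdx.hk y) := by rw [hy₁]; show ιB (B9Eq360DeltaPrimeAY.blkY x.toKIdx w₀) = _; rw [← hw₀]; rfl
  have hy₁β : β x.toKIdx.hN x.toKIdx.D x.toKIdx.hk y₁ = β x.toKIdx.hN x.toKIdx.D x.toKIdx.hk y := by rw [hy₁', hι]
  have hlen : (geo9Y x).len y₁ = (geo9Y x).len y := Node00.OpsYRead342.geo9K_len_congr x.toKIdx hy₁β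
  have hdist : ∀ t : IBondY x.toKIdx, (geo9Y x).dist y₁ t = (geo9Y x).dist y t := fun t => Node00.OpsYRead342.geo9K_dist_congr x.toKIdx hy₁β rfl
  set yL : IBondY x.toKIdx := ιB (β x.toKIdx.hN x.toKIdx.D x.toKIdx.hk y') with hyL
  have hdistL : (geo9Y x).dist y₁ yL = (geo9Y x).dist y y' := Node00.OpsYRead342.geo9K_dist_congr x.toKIdx hy₁β (hι _)
  have hleny₁ : 0 < (geo9Y x).len y₁ := geo9Y_len_pos x y₁
  haveI : Nontrivial 𝔸 := NormOneClass.nontrivial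
  obtain ⟨j₀⟩ := b.index_nonempty
  have hp₀ : blkC x.toKIdx ιB ((((0 : Fin (d + 1)), w₀), j₀) : (Fin (d + 1) × SiteY x.toKIdx) × ι).1.2 = y₁ := rfl
  -- geometry near the anchor: blocks within `< M` of `βy` have comparable lengths and shifted decay
  have hnear : ∀ (q : FBondY x.toKIdx) (r : ℝ), (geomT x.toKIdx.D).dist (blkV1 x.toKIdx.hN x.toKIdx.D q) (β x.toKIdx.hN x.toKIdx.D x.toKIdx.hk y) ≤ r →
      r < (geo9Y x).M →
      (geo9Y x).len (ιB (blkV1 x.toKIdx.hN x.toKIdx.D q)) ≤ L * (geo9Y x).len y₁ ∧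
      (geo9Y x).len y₁ ≤ L * (geo9Y x).len (ιB (blkV1 x.toKIdx.hN x.toKIdx.D q)) ∧
      ∀ y'' : IBondY x.toKIdx, Real.exp (-(δc * (geo9Y x).dist (ιB (blkV1 x.toKIdx.hN x.toKIdx.D q)) y'')) ≤
        Real.exp (δc * r) * Real.exp (-(δc * (geo9Y x).dist y₁ y'')) := by
    intro q r hq hr
    have hdq : (geo9Y x).dist (ιB (blkV1 x.toKIdx.hN x.toKIdx.D q)) y₁ = (geomT x.toKIdx.D).dist (blkV1 x.toKIdx.hN x.toKIdx.D q) (β x.toKIdx.hN x.toKIdx.D x.toKIdx.hk y) := by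
      show (geomT x.toKIdx.D).dist (β x.toKIdx.hN x.toKIdx.D x.toKIdx.hk (ιB _)) (β x.toKIdx.hN x.toKIdx.D x.toKIdx.hk y₁) = _
      rw [hι, hy₁β]
    have hlt : (geo9Y x).dist (ιB (blkV1 x.toKIdx.hN x.toKIdx.D q)) y₁ < (geo9Y x).M := by rw [hdq]; exact lt_of_le_of_lt hq hr
    have hlt' : (geo9Y x).dist y₁ (ιB (blkV1 x.toKIdx.hN x.toKIdx.D q)) < (geo9Y x).M := by rw [geo9Y_dist_comm]; exact hlt
    refine ⟨len_le_of_dist_lt_M_geo9K x.toKIdx hlt, len_le_of_dist_lt_M_geo9K x.toKIdx hlt', fun y'' => ?_⟩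
    rw [← Real.exp_add]
    refine Real.exp_le_exp.2 ?_
    have ht := geo9Y_dist_triangle x y₁ (ιB (blkV1 x.toKIdx.hN x.toKIdx.D q)) y''
    rw [geo9Y_dist_comm x y₁ (ιB _), hdq] at ht
    nlinarith [hdn (ιB (blkV1 x.toKIdx.hN x.toKIdx.D q)) y'']
  -- constants
  set cζ : ℝ := (geo9Y x).cutH α (Sum.inr z) with hcζ
  have hcζ0 : 0 ≤ cζ := hcutH
  set Bp : ℝ := max (Bβ α) 0 with hBp
  have hBp0 : 0 ≤ Bp := le_max_right _ _
  set BhL : ℝ := Sb * Bp with hBhL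
  have hBhL0 : 0 ≤ BhL := mul_nonneg hSb0 hBp0
  set BhA : ℝ := Sb * (M₂ * Sb * B₀) * (L ^ 3 * Real.exp δc + cLip * L ^ 2 * Real.exp (δc * (rL + 1))) with hBhA
  have hBhA0 : 0 ≤ BhA := by positivity
  set BhX : ℝ := Sb * Bp * (1 + (mN : ℝ) * (M₂ * Sb) * Real.exp (δc * (2 * ((d : ℝ) + 1)))) with hBhX
  have hBhX0 : 0 ≤ BhX := by positivity
  set BhR : ℝ := BhX + BhA with hBhR
  have hBhR0 : 0 ≤ BhR := add_nonneg hBhX0 hBhA0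
  -- the (3.43) block at the base, READ: reading bounds for scalar inputs supported in a block, at the call rate δc
  set Wf : IBondY x.toKIdx → ℝ := fun a' => Bp * (geo9Y x).len y₁ ^ (1 - α) * cζ * Real.exp (-(δc * (geo9Y x).dist y₁ a')) with hWf
  have hWf0 : ∀ a', 0 ≤ Wf a' := fun a' =>
    mul_nonneg (mul_nonneg (mul_nonneg hBp0 (Real.rpow_nonneg hleny₁.le _)) hcζ0) (Real.exp_pos _).le
  have hreadU : ∀ (g : FBondY x.toKIdx → ℝ) (a' : IBondY x.toKIdx), (geo9Y x).suppIn (Sum.inr g) a' →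
      h1ReadB x.toKIdx TU (parB U) U g α z ≤ Wf a' * (geo9Y x).supNorm (Sum.inr g) := by
    intro g a' hg
    have h := hH1 α (Sum.inr g) (Sum.inr z) y a' hα0 hα1 hζ hg
    rw [KACU_h1_inr_eq] at h
    have hN : 0 ≤ (geo9Y x).supNorm (Sum.inr g) := (modelSignsOn_geo9K x.toKIdx).supNorm_nonneg _
    refine (show h1ReadB x.toKIdx TU (parB U) U g α z ≤ _ from h).trans ?_
    rw [← hlen, ← hdist]
    have hP : 0 ≤ (geo9Y x).len y₁ ^ (1 - α) * cζ := mul_nonneg (Real.rpow_nonneg hleny₁.le _) hcζ0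
    have hexp : Real.exp (-(δ * (geo9Y x).dist y₁ a')) ≤ Real.exp (-(δc * (geo9Y x).dist y₁ a')) :=
      Real.exp_le_exp.2 (by nlinarith [hdn y₁ a'])
    calc Bβ α * (geo9Y x).len y₁ ^ (1 - α) * (geo9Y x).cutH α (Sum.inr z) * Real.exp (-(δ * (geo9Y x).dist y₁ a')) *
          (geo9Y x).supNorm (Sum.inr g)
        = Bβ α * (((geo9Y x).len y₁ ^ (1 - α) * cζ) * Real.exp (-(δ * (geo9Y x).dist y₁ a')) * (geo9Y x).supNorm (Sum.inr g)) := by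
          rw [hcζ]; ring
      _ ≤ Bp * (((geo9Y x).len y₁ ^ (1 - α) * cζ) * Real.exp (-(δc * (geo9Y x).dist y₁ a')) * (geo9Y x).supNorm (Sum.inr g)) := by
          refine mul_le_mul (le_max_left _ _) ?_ (mul_nonneg (mul_nonneg hP (Real.exp_pos _).le) hN) hBp0
          exact mul_le_mul_of_nonneg_right (mul_le_mul_of_nonneg_left hexp hP) hN
      _ = Wf a' * (geo9Y x).supNorm (Sum.inr g) := by rw [hWf]; ring
  -- the block support of the coordinates of the output input `J ⊗ E`
  have hBS : ∀ {E : 𝔸}, ‖E‖ ≤ 1 → BlockSupp (g := toB6 (geo9Y x) (0 : ℝ) True) (fun q : (Fin (d + 1) × SiteY x.toKIdx) × ι => blkC x.toKIdx ιB q.1.2)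
      (coordEquiv b (bondFunCoordsY x.toKIdx (liftY J E))) yL (M₂ * (geo9Y x).supNorm (Sum.inr J)) := fun hE1 =>
    blockSupp_coordEquiv_bondFun_liftY x.toKIdx b ιB hM₂ hrepr J y' hlam hE1
  ------------------------------------------------------------------
  -- LEFT WORDS: `∇_{U,ν}G(U′U)(J ⊗ E)`
  ------------------------------------------------------------------
  have hLeft : ∀ (E : BallY 𝔸) (ν : Fin (d + 1)) (q q' : FBondY x.toKIdx), Adm x.toKIdx q q' →
      ‖probeB x.toKIdx (parB U) α z q q' (cdB x.toKIdx U ν (TW (liftY J (E : 𝔸))))‖ ≤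
        B * BhL * (geo9Y x).len y₁ ^ (1 - α) * cζ * Real.exp (-(δc / 6 * (geo9Y x).dist y₁ yL)) * (M₂ * (geo9Y x).supNorm (Sum.inr J)) := by
    intro E ν q q' hadm
    have hE1 : ‖(E : 𝔸)‖ ≤ 1 := mem_closedBall_zero_iff.1 E.2
    set D : Module.End ℝ ((Fin (d + 1) × SiteY x.toKIdx) × ι → ℝ) := conj b (bondOpCoordsRY x.toKIdx (cdBₗ x.toKIdx U ν)) with hD
    set Φ : (Fin (d + 1) × SiteY x.toKIdx → 𝔸) →ₗ[ℝ] 𝔸 := probeBC x.toKIdx (parB U) α z q q' with hΦ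
    -- the premise at the base
    have prem : ∀ (y'' : IBondY x.toKIdx) (μ : (Fin (d + 1) × SiteY x.toKIdx) × ι → ℝ) (M : ℝ),
        BlockSupp (g := toB6 (geo9Y x) (0 : ℝ) True) (fun q : (Fin (d + 1) × SiteY x.toKIdx) × ι => blkC x.toKIdx ιB q.1.2) μ y'' M →
        ‖Φ ((coordEquiv b).symm (D (GbC x.toKIdx par parB b (.base U) μ)))‖ ≤
          BhL * (geo9Y x).len y₁ ^ (1 - α) * cζ * Real.exp (-(δc * (geo9Y x).dist y₁ y'')) * M := by
      intro y'' μ M hμ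
      calc ‖Φ ((coordEquiv b).symm (D (GbC x.toKIdx par parB b (.base U) μ)))‖
          = ‖probeB x.toKIdx (parB U) α z q q' (cdB x.toKIdx U ν (TU (lamB x.toKIdx b μ)))‖ := by
            rw [hΦ, probeBC_symm, ← Module.End.mul_apply, hD, lamB_DL_GbC, decY_base]
        _ ≤ Sb * (Wf y'' * M) := probeL_lamB_le x.toKIdx b ιB TU (parB U) U hι hM₂ hrepr α z hWf0 hreadU hμ ν hadm
        _ = BhL * (geo9Y x).len y₁ ^ (1 - α) * cζ * Real.exp (-(δc * (geo9Y x).dist y₁ y'')) * M := by rw [hWf, hBhL]; ring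
    have concl := HL D Φ y₁ _ hp₀ α BhL cζ hBhL0 hcζ0 prem yL (coordEquiv b (bondFunCoordsY x.toKIdx (liftY J (E : 𝔸)))) _ (hBS hE1)
    calc ‖probeB x.toKIdx (parB U) α z q q' (cdB x.toKIdx U ν (TW (liftY J (E : 𝔸))))‖
        = ‖Φ ((coordEquiv b).symm (D (GbC x.toKIdx par parB b ((codingYx P G x C37 C38).bg.mul (.mult a) (.base U))
            (coordEquiv b (bondFunCoordsY x.toKIdx (liftY J (E : 𝔸)))))))‖ := by
          rw [hΦ, probeBC_symm, ← Module.End.mul_apply, hD, lamB_DL_GbC, lamB_coordEquiv_bondFunCoordsY]; rfl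
      _ ≤ _ := concl
  ------------------------------------------------------------------
  -- RIGHT WORDS: `G(U′U)∇*_{U,ν}(J ⊗ E)`
  ------------------------------------------------------------------
  have hRight : ∀ (E : BallY 𝔸) (ν : Fin (d + 1)) (q q' : FBondY x.toKIdx), Adm x.toKIdx q q' →
      ‖probeB x.toKIdx (parB U) α z q q' (TW (cdsB x.toKIdx U ν (liftY J (E : 𝔸))))‖ ≤
        B * BhR * (geo9Y x).len y₁ ^ (1 - α) * cζ * Real.exp (-(δc / 6 * (geo9Y x).dist y₁ yL)) * (M₂ * (geo9Y x).supNorm (Sum.inr J)) := by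
    intro E ν q q' hadm
    have hE1 : ‖(E : 𝔸)‖ ≤ 1 := mem_closedBall_zero_iff.1 E.2
    set Ds : Module.End ℝ ((Fin (d + 1) × SiteY x.toKIdx) × ι → ℝ) := conj b (bondOpCoordsRY x.toKIdx (cdsBₗ x.toKIdx U ν)) with hDs
    set Φ : (Fin (d + 1) × SiteY x.toKIdx → 𝔸) →ₗ[ℝ] 𝔸 := probeBC x.toKIdx (parB U) α z q q' with hΦ
    have hfac1 : ∀ (y'' : IBondY x.toKIdx) (M : ℝ), 0 ≤ M → 0 ≤ (geo9Y x).len y₁ ^ (1 - α) * cζ * Real.exp (-(δc * (geo9Y x).dist y₁ y'')) * M :=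
      fun y'' M hM => mul_nonneg (mul_nonneg (mul_nonneg (Real.rpow_nonneg hleny₁.le _) hcζ0) (Real.exp_pos _).le) hM
    -- (1) the right-word premise at a backward letter (shared by (b′)-inr and (c′))
    have hbinr : ∀ (ν' : Fin (d + 1)) (y'' : IBondY x.toKIdx) (μ : (Fin (d + 1) × SiteY x.toKIdx) × ι → ℝ) (M : ℝ),
        BlockSupp (g := toB6 (geo9Y x) (0 : ℝ) True) (fun q : (Fin (d + 1) × SiteY x.toKIdx) × ι => blkC x.toKIdx ιB q.1.2) μ y'' M →
        ‖Φ ((coordEquiv b).symm ((GbC x.toKIdx par parB b (.base U) * conj b (bondOpCoordsRY x.toKIdx (cdsBₗ x.toKIdx U ν'))) μ))‖ ≤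
          BhR * (geo9Y x).len y₁ ^ (1 - α) * cζ * Real.exp (-(δc * (geo9Y x).dist y₁ y'')) * M := by
      intro ν' y'' μ M hμ
      calc ‖Φ ((coordEquiv b).symm ((GbC x.toKIdx par parB b (.base U) * conj b (bondOpCoordsRY x.toKIdx (cdsBₗ x.toKIdx U ν'))) μ))‖
          = ‖probeB x.toKIdx (parB U) α z q q' (TU (cdsB x.toKIdx U ν' (lamB x.toKIdx b μ)))‖ := by
            rw [hΦ, probeBC_symm, lamB_GbC_DR, decY_base]
        _ ≤ Sb * (Wf y'' * M) := probeR_lamB_le x.toKIdx b ιB TU (parB U) U hι hM₂ hrepr α z hWf0 hreadU hμ ν' hadm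
        _ = (Sb * Bp) * ((geo9Y x).len y₁ ^ (1 - α) * cζ * Real.exp (-(δc * (geo9Y x).dist y₁ y'')) * M) := by rw [hWf]; ring
        _ ≤ BhR * ((geo9Y x).len y₁ ^ (1 - α) * cζ * Real.exp (-(δc * (geo9Y x).dist y₁ y'')) * M) := by
            refine mul_le_mul_of_nonneg_right ?_ (hfac1 y'' M hμ.nonneg)
            rw [hBhR, hBhX]
            have h2 : Sb * Bp ≤ Sb * Bp * (1 + (mN : ℝ) * (M₂ * Sb) * Real.exp (δc * (2 * ((d : ℝ) + 1)))) :=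
              le_mul_of_one_le_right hBhL0 (le_add_of_nonneg_right (by positivity))
            linarith
        _ = BhR * (geo9Y x).len y₁ ^ (1 - α) * cζ * Real.exp (-(δc * (geo9Y x).dist y₁ y'')) * M := by ring
    -- (2) premise (a′): the undifferentiated probe (`probeB_undiff_le` with the (3.42) majorants, the law and the level comparability)
    have prema : ∀ (y'' : IBondY x.toKIdx) (μ : (Fin (d + 1) × SiteY x.toKIdx) × ι → ℝ) (M : ℝ),
        BlockSupp (g := toB6 (geo9Y x) (0 : ℝ) True) (fun q : (Fin (d + 1) × SiteY x.toKIdx) × ι => blkC x.toKIdx ιB q.1.2) μ y'' M →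
        ‖Φ ((coordEquiv b).symm (GbC x.toKIdx par parB b (.base U) μ))‖ ≤
          BhR * (geo9Y x).len y₁ ^ (2 - α) * cζ * Real.exp (-(δc * (geo9Y x).dist y₁ y'')) * M := by
      intro y'' μ M hμ
      have hM0 : 0 ≤ M := hμ.nonneg
      set Ed : ℝ := Real.exp (-(δc * (geo9Y x).dist y₁ y'')) with hEd
      have hEd0 : 0 < Ed := Real.exp_pos _
      set Ψ : FBondY x.toKIdx → 𝔸 := TU (lamB x.toKIdx b μ) with hΨ
      -- values of Ψ and of its covariant differences near `βy`
      set A₀ : ℝ := Sb * (M₂ * Sb * B₀ * (L * (geo9Y x).len y₁) ^ 2 * (Real.exp (δc * 1) * Ed) * M) with hA₀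
      have hA₀0 : 0 ≤ A₀ := by positivity
      set A₁ : ℝ := Sb * (M₂ * Sb * B₀ * (L * (geo9Y x).len y₁) * (Real.exp (δc * (rL + 1)) * Ed) * M) with hA₁
      have hA₁0 : 0 ≤ A₁ := by positivity
      have h0 : ∀ q' : FBondY x.toKIdx, (geomT x.toKIdx.D).dist (blkV1 x.toKIdx.hN x.toKIdx.D q') (β x.toKIdx.hN x.toKIdx.D x.toKIdx.hk y) ≤ 1 → ‖Ψ q'‖ ≤ A₀ := by
        intro q' hq'
        obtain ⟨hl1, -, hex⟩ := hnear q' 1 hq' hM1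
        have hv := norm_lamB_le_of_hasMajorant x.toKIdx b ιB hm0 hμ q'
        rw [lamB_conj_bondOpCoordsRY] at hv
        refine (show ‖Ψ q'‖ ≤ _ from hv).trans ?_
        rw [hA₀]
        refine mul_le_mul_of_nonneg_left ?_ hSb0
        have hl2 : (geo9Y x).len (ιB (blkV1 x.toKIdx.hN x.toKIdx.D q')) ^ 2 ≤ (L * (geo9Y x).len y₁) ^ 2 :=
          pow_le_pow_left₀ (geo9Y_len_pos x _).le hl1 2
        have hstep : M₂ * Sb * B₀ * (geo9Y x).len (ιB (blkV1 x.toKIdx.hN x.toKIdx.D q')) ^ 2 *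
              Real.exp (-(δc * (geo9Y x).dist (ιB (blkV1 x.toKIdx.hN x.toKIdx.D q')) y'')) * M
            ≤ M₂ * Sb * B₀ * (L * (geo9Y x).len y₁) ^ 2 * (Real.exp (δc * 1) * Ed) * M :=
          mul_le_mul (mul_le_mul (mul_le_mul_of_nonneg_left hl2 hcB) (hex y'') (Real.exp_pos _).le (by positivity)) le_rfl hM0 (by positivity)
        exact hstep
      have h1 : ∀ (q' : FBondY x.toKIdx) (μ' : Fin (d + 1)),
          (geomT x.toKIdx.D).dist (blkV1 x.toKIdx.hN x.toKIdx.D q') (β x.toKIdx.hN x.toKIdx.D x.toKIdx.hk y) ≤ rL + 1 → ‖cdB x.toKIdx U μ' Ψ q'‖ ≤ A₁ := by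
        intro q' μ' hq'
        obtain ⟨hl1, -, hex⟩ := hnear q' (rL + 1) hq' hMgeo
        have hv := norm_lamB_le_of_hasMajorant x.toKIdx b ιB (hm1 μ') hμ q'
        rw [lamB_conj_bondOpCoordsRY] at hv
        refine (show ‖cdB x.toKIdx U μ' Ψ q'‖ ≤ _ from hv).trans ?_
        rw [hA₁]
        refine mul_le_mul_of_nonneg_left ?_ hSb0
        have hstep : M₂ * Sb * B₀ * (geo9Y x).len (ιB (blkV1 x.toKIdx.hN x.toKIdx.D q')) *
              Real.exp (-(δc * (geo9Y x).dist (ιB (blkV1 x.toKIdx.hN x.toKIdx.D q')) y'')) * M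
            ≤ M₂ * Sb * B₀ * (L * (geo9Y x).len y₁) * (Real.exp (δc * (rL + 1)) * Ed) * M :=
          mul_le_mul (mul_le_mul (mul_le_mul_of_nonneg_left hl1 hcB) (hex y'') (Real.exp_pos _).le (by positivity)) le_rfl hM0 (by positivity)
        exact hstep
      -- the scale lengths of the blocks within 1 of `βy`
      have hlenq : ∀ q' : FBondY x.toKIdx, (geo9Y x).len (ιB (blkV1 x.toKIdx.hN x.toKIdx.D q')) = lenB x.toKIdx q' := by
        intro q'
        show (kGeo x.toKIdx).len (ιB (blkV1 x.toKIdx.hN x.toKIdx.D q')) = _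
        rw [B6KLevelCensusIndexV1.len_eq, ← beta_level x.toKIdx.hN x.toKIdx.D x.toKIdx.hk hk1, div_eq_mul_inv, hι]
        rfl
      have hlo : ∀ q' : FBondY x.toKIdx, (geomT x.toKIdx.D).dist (blkV1 x.toKIdx.hN x.toKIdx.D q') (β x.toKIdx.hN x.toKIdx.D x.toKIdx.hk y) ≤ 1 →
          (geo9Y x).len y₁ / L ≤ lenB x.toKIdx q' := by
        intro q' hq'
        obtain ⟨-, hl2, -⟩ := hnear q' 1 hq' hM1
        rw [← hlenq, div_le_iff₀ (lt_of_lt_of_le one_pos hL1)]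
        linarith
      have hhi : ∀ q' : FBondY x.toKIdx, (geomT x.toKIdx.D).dist (blkV1 x.toKIdx.hN x.toKIdx.D q') (β x.toKIdx.hN x.toKIdx.D x.toKIdx.hk y) ≤ 1 →
          lenB x.toKIdx q' ≤ L * (geo9Y x).len y₁ := by
        intro q' hq'
        obtain ⟨hl1, -, -⟩ := hnear q' 1 hq' hM1
        rw [← hlenq]; exact hl1
      have hLam0 : 0 < (geo9Y x).len y₁ / L := div_pos hleny₁ (lt_of_lt_of_le one_pos hL1)
      have hLam1 : 0 ≤ L * (geo9Y x).len y₁ := mul_nonneg hL0 hleny₁.le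
      have hu := probeB_undiff_le x.toKIdx (parB U) U hcLip hLipU hparU hα0 hα1.le z y hζ' Ψ hA₀0 hA₁0 hLam0 hLam1 h0 h1 hlo hhi hadm
      have hbr : ‖Φ ((coordEquiv b).symm (GbC x.toKIdx par parB b (.base U) μ))‖ = ‖probeB x.toKIdx (parB U) α z q q' Ψ‖ := by
        rw [hΦ, probeBC_symm, lamB_GbC, decY_base]
      rw [hbr]
      refine hu.trans ?_
      -- arithmetic: `cζ·(Λ₀^{−α}A₀ + c_Lip Λ₁^{1−α} A₁) ≦ B_hA·ℓ^{2−α}·cζ·E″·M ≦ B_hR·…`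
      have hP1 : ((geo9Y x).len y₁ / L) ^ (-α) * A₀ ≤ Sb * (M₂ * Sb * B₀) * (L ^ 3 * Real.exp δc) * ((geo9Y x).len y₁ ^ (2 - α) * Ed * M) := by
        have hr := div_rpow_neg_mul_sq_le hleny₁ hL1 hα1.le
        have hq : 0 ≤ Sb * (M₂ * Sb * B₀) * L ^ 2 * (Real.exp (δc * 1) * Ed) * M := by positivity
        calc ((geo9Y x).len y₁ / L) ^ (-α) * A₀
            = (((geo9Y x).len y₁ / L) ^ (-α) * (geo9Y x).len y₁ ^ 2) * (Sb * (M₂ * Sb * B₀) * L ^ 2 * (Real.exp (δc * 1) * Ed) * M) := by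
              rw [hA₀]; ring
          _ ≤ (L * (geo9Y x).len y₁ ^ (2 - α)) * (Sb * (M₂ * Sb * B₀) * L ^ 2 * (Real.exp (δc * 1) * Ed) * M) :=
              mul_le_mul_of_nonneg_right hr hq
          _ = Sb * (M₂ * Sb * B₀) * (L ^ 3 * Real.exp δc) * ((geo9Y x).len y₁ ^ (2 - α) * Ed * M) := by rw [mul_one]; ring
      have hP2 : cLip * (L * (geo9Y x).len y₁) ^ (1 - α) * A₁ ≤
          Sb * (M₂ * Sb * B₀) * (cLip * L ^ 2 * Real.exp (δc * (rL + 1))) * ((geo9Y x).len y₁ ^ (2 - α) * Ed * M) := by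
        have hr := mul_rpow_mul_le hleny₁ hL1 hα0
        have hq : 0 ≤ cLip * (Sb * (M₂ * Sb * B₀) * L * (Real.exp (δc * (rL + 1)) * Ed) * M) := by positivity
        calc cLip * (L * (geo9Y x).len y₁) ^ (1 - α) * A₁
            = ((L * (geo9Y x).len y₁) ^ (1 - α) * (geo9Y x).len y₁) * (cLip * (Sb * (M₂ * Sb * B₀) * L * (Real.exp (δc * (rL + 1)) * Ed) * M)) := by
              rw [hA₁]; ring
          _ ≤ (L * (geo9Y x).len y₁ ^ (2 - α)) * (cLip * (Sb * (M₂ * Sb * B₀) * L * (Real.exp (δc * (rL + 1)) * Ed) * M)) :=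
              mul_le_mul_of_nonneg_right hr hq
          _ = Sb * (M₂ * Sb * B₀) * (cLip * L ^ 2 * Real.exp (δc * (rL + 1))) * ((geo9Y x).len y₁ ^ (2 - α) * Ed * M) := by ring
      have hfac2 : 0 ≤ (geo9Y x).len y₁ ^ (2 - α) * Ed * M := mul_nonneg (mul_nonneg (Real.rpow_nonneg hleny₁.le _) hEd0.le) hM0
      have hAle : BhA ≤ BhR := by rw [hBhR]; exact le_add_of_nonneg_left hBhX0
      calc (geo9Y x).cutH α (Sum.inr z) * (((geo9Y x).len y₁ / L) ^ (-α) * A₀ + cLip * (L * (geo9Y x).len y₁) ^ (1 - α) * A₁)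
          ≤ cζ * (Sb * (M₂ * Sb * B₀) * (L ^ 3 * Real.exp δc) * ((geo9Y x).len y₁ ^ (2 - α) * Ed * M) +
              Sb * (M₂ * Sb * B₀) * (cLip * L ^ 2 * Real.exp (δc * (rL + 1))) * ((geo9Y x).len y₁ ^ (2 - α) * Ed * M)) := by
            rw [← hcζ]; exact mul_le_mul_of_nonneg_left (add_le_add hP1 hP2) hcζ0
        _ = BhA * ((geo9Y x).len y₁ ^ (2 - α) * cζ * Ed * M) := by rw [hBhA]; ring
        _ ≤ BhR * ((geo9Y x).len y₁ ^ (2 - α) * cζ * Ed * M) :=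
            mul_le_mul_of_nonneg_right hAle (mul_nonneg (mul_nonneg (mul_nonneg (Real.rpow_nonneg hleny₁.le _) hcζ0) hEd0.le) hM0)
        _ = BhR * (geo9Y x).len y₁ ^ (2 - α) * cζ * Real.exp (-(δc * (geo9Y x).dist y₁ y'')) * M := by rw [hEd]; ring
    -- (3) premise (b′): every letter `∇♯_k` on the right of `G(U)` (forward letters through the CROSS read)
    have premb : ∀ (k : Fin (d + 1) ⊕ Fin (d + 1)) (y'' : IBondY x.toKIdx) (μ : (Fin (d + 1) × SiteY x.toKIdx) × ι → ℝ) (M : ℝ),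
        BlockSupp (g := toB6 (geo9Y x) (0 : ℝ) True) (fun q : (Fin (d + 1) × SiteY x.toKIdx) × ι => blkC x.toKIdx ιB q.1.2) μ y'' M →
        ‖Φ ((coordEquiv b).symm ((GbC x.toKIdx par parB b (.base U) *
            conj b (diffLetter (bT (shiftY x.toKIdx)) (bU (coordC G x.toKIdx (.base U))) ((((geo9Y x).eta : ℂ))⁻¹) k)) μ))‖ ≤
          BhR * (geo9Y x).len y₁ ^ (1 - α) * cζ * Real.exp (-(δc * (geo9Y x).dist y₁ y'')) * M := by
      intro k y'' μ M hμ
      rcases k with ν' | ν'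
      · -- forward letter: the cross word
        rw [hDk, norm_map_symm_mul_diffLetter_inl, hΦ, probeBC_symm, lamB_GbC_DF, decY_base]
        set W₀ : ℝ := Bp * (geo9Y x).len y₁ ^ (1 - α) * cζ * (Real.exp (δc * (2 * ((d : ℝ) + 1))) * Real.exp (-(δc * (geo9Y x).dist y₁ y''))) with hW₀
        have hWnbr : ∀ a' ∈ nbr (geo9Y x) (2 * ((d : ℝ) + 1)) y'', Wf a' ≤ W₀ := by
          intro a' ha'
          have hda : (geo9Y x).dist a' y'' ≤ 2 * ((d : ℝ) + 1) := mem_nbr.1 ha'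
          have htri' := geo9Y_dist_triangle x y₁ a' y''
          rw [hWf, hW₀]
          refine mul_le_mul_of_nonneg_left ?_ (mul_nonneg (mul_nonneg hBp0 (Real.rpow_nonneg hleny₁.le _)) hcζ0)
          rw [← Real.exp_add]
          exact Real.exp_le_exp.2 (by nlinarith)
        have h := probe_crossB_lamB_le x.toKIdx b ιB TU (parB U) U hι hM₂ hrepr hUu hnbrU α z y'' hWf0 hWnbr hreadU μ hμ ν' hadm
        refine h.trans ?_
        have hle : Sb * (((mN : ℝ) * (M₂ * Sb) * W₀) * M) = (Sb * Bp * ((mN : ℝ) * (M₂ * Sb) * Real.exp (δc * (2 * ((d : ℝ) + 1))))) *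
            ((geo9Y x).len y₁ ^ (1 - α) * cζ * Real.exp (-(δc * (geo9Y x).dist y₁ y'')) * M) := by rw [hW₀]; ring
        rw [hle]
        have hco2 : Sb * Bp * ((mN : ℝ) * (M₂ * Sb) * Real.exp (δc * (2 * ((d : ℝ) + 1)))) ≤ BhR := by
          rw [hBhR, hBhX]
          have : Sb * Bp * ((mN : ℝ) * (M₂ * Sb) * Real.exp (δc * (2 * ((d : ℝ) + 1)))) ≤
              Sb * Bp * (1 + (mN : ℝ) * (M₂ * Sb) * Real.exp (δc * (2 * ((d : ℝ) + 1)))) :=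
            mul_le_mul_of_nonneg_left (le_add_of_nonneg_left zero_le_one) hBhL0
          linarith
        calc (Sb * Bp * ((mN : ℝ) * (M₂ * Sb) * Real.exp (δc * (2 * ((d : ℝ) + 1))))) *
              ((geo9Y x).len y₁ ^ (1 - α) * cζ * Real.exp (-(δc * (geo9Y x).dist y₁ y'')) * M)
            ≤ BhR * ((geo9Y x).len y₁ ^ (1 - α) * cζ * Real.exp (-(δc * (geo9Y x).dist y₁ y'')) * M) :=
              mul_le_mul_of_nonneg_right hco2 (hfac1 y'' M hμ.nonneg)
          _ = _ := by ring
      · -- backward letter: the printed right word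
        rw [hDk, norm_map_symm_mul_diffLetter_inr]
        exact hbinr ν' y'' μ M hμ
    -- (4) premise (c′) and the conclusion of the right transfer
    have concl := HR Ds (hm2 ν) Φ y₁ _ hp₀ α BhR cζ hBhR0 hcζ0 prema premb (fun y'' μ M hμ => by rw [hDs]; exact hbinr ν y'' μ M hμ)
      yL (coordEquiv b (bondFunCoordsY x.toKIdx (liftY J (E : 𝔸)))) _ (hBS hE1)
    calc ‖probeB x.toKIdx (parB U) α z q q' (TW (cdsB x.toKIdx U ν (liftY J (E : 𝔸))))‖
        = ‖Φ ((coordEquiv b).symm ((GbC x.toKIdx par parB b ((codingYx P G x C37 C38).bg.mul (.mult a) (.base U)) * Ds)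
            (coordEquiv b (bondFunCoordsY x.toKIdx (liftY J (E : 𝔸))))))‖ := by
          rw [hΦ, probeBC_symm, hDs, lamB_GbC_DR, lamB_coordEquiv_bondFunCoordsY]; rfl
      _ ≤ _ := concl
  ------------------------------------------------------------------
  -- WRITE the (3.43) block of the reading at the product
  ------------------------------------------------------------------
  have hfacN : 0 ≤ (geo9Y x).len y ^ (1 - α) * cζ * Real.exp (-(δc / 6 * (geo9Y x).dist y y')) * (geo9Y x).supNorm (Sum.inr J) :=
    mul_nonneg (mul_nonneg (mul_nonneg (Real.rpow_nonneg hleny.le _) hcζ0) (Real.exp_pos _).le) hsupN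
  have hfinal : ∀ {Bh : ℝ}, 0 ≤ Bh → M₂ * (B * Bh) ≤ W5 →
      B * Bh * (geo9Y x).len y₁ ^ (1 - α) * cζ * Real.exp (-(δc / 6 * (geo9Y x).dist y₁ yL)) * (M₂ * (geo9Y x).supNorm (Sum.inr J)) ≤
        W5 * (geo9Y x).len y ^ (1 - α) * (geo9Y x).cutH α (Sum.inr z) * Real.exp (-(δc / 6 * (geo9Y x).dist y y')) * (geo9Y x).supNorm (Sum.inr J) := by
    intro Bh hBh hle
    rw [hlen, hdistL, ← hcζ]
    calc B * Bh * (geo9Y x).len y ^ (1 - α) * cζ * Real.exp (-(δc / 6 * (geo9Y x).dist y y')) * (M₂ * (geo9Y x).supNorm (Sum.inr J))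
        = (M₂ * (B * Bh)) * ((geo9Y x).len y ^ (1 - α) * cζ * Real.exp (-(δc / 6 * (geo9Y x).dist y y')) * (geo9Y x).supNorm (Sum.inr J)) := by ring
      _ ≤ W5 * ((geo9Y x).len y ^ (1 - α) * cζ * Real.exp (-(δc / 6 * (geo9Y x).dist y y')) * (geo9Y x).supNorm (Sum.inr J)) :=
          mul_le_mul_of_nonneg_right hle hfacN
      _ = _ := by ring
  have hwL : M₂ * (B * BhL) ≤ W5 := by
    rw [hW5def, wHG6, hBhL, ← hBp]
    have h1 : 0 ≤ Sb * Bp * (1 + (mN : ℝ) * (M₂ * Sb) * Real.exp (δc * (2 * ((d : ℝ) + 1)))) +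
        Sb * (M₂ * Sb * B₀) * (L ^ 3 * Real.exp δc + cLip * L ^ 2 * Real.exp (δc * (rL + 1))) := by positivity
    have h2 : M₂ * (B * (Sb * Bp)) = M₂ * B * (Sb * Bp) := by ring
    rw [h2]
    exact mul_le_mul_of_nonneg_left (le_add_of_nonneg_right h1) (mul_nonneg hM₂ hB)
  have hwR : M₂ * (B * BhR) ≤ W5 := by
    rw [hW5def, wHG6, hBhR, hBhX, hBhA, ← hBp]
    have h2 : M₂ * (B * (Sb * Bp * (1 + (mN : ℝ) * (M₂ * Sb) * Real.exp (δc * (2 * ((d : ℝ) + 1)))) +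
        Sb * (M₂ * Sb * B₀) * (L ^ 3 * Real.exp δc + cLip * L ^ 2 * Real.exp (δc * (rL + 1))))) =
        M₂ * B * (Sb * Bp * (1 + (mN : ℝ) * (M₂ * Sb) * Real.exp (δc * (2 * ((d : ℝ) + 1)))) +
          Sb * (M₂ * Sb * B₀) * (L ^ 3 * Real.exp δc + cLip * L ^ 2 * Real.exp (δc * (rL + 1)))) := by ring
    rw [h2]
    exact mul_le_mul_of_nonneg_left (le_add_of_nonneg_left hBhL0) (mul_nonneg hM₂ hB)
  exact h1ReadB_le_of_probes x.toKIdx TW (parB U) U J α z hRHS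
    (fun E ν q q' hadm => (hLeft E ν q q' hadm).trans (hfinal hBhL0 hwL))
    (fun E ν q q' hadm => (hRight E ν q q' hadm).trans (hfinal hBhR0 hwR))

end Transfer

/-! ## §3 ★★★ The frame instance over the coded carriers of a subfamily and the (3.43) block-step of the bond family -/

section Steps

variable [NormOneClass 𝔸] [FiniteDimensional ℝ 𝔸] {J : Type} (f : J → MemberY d ℓ hd hL b₀ b₁ Mstar)
  [∀ x : MemberY d ℓ hd hL b₀ b₁ Mstar, Fintype (geo9Y x).Site]
  [instDS : ∀ x : MemberY d ℓ hd hL b₀ b₁ Mstar, DecidableEq (geo9Y x).Site] [instNE : ∀ x : MemberY d ℓ hd hL b₀ b₁ Mstar, Nonempty (geo9Y x).Site]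
  (c35 : ℝ) (G : Subgroup 𝔸ˣ) (par : ∀ j : J, SiteParY 𝔸 (f j).toKIdx) (parB : ∀ j : J, BondParY 𝔸 (f j).toKIdx)
  {ι : Type} [Fintype ι] [DecidableEq ι] (b : Module.Basis ι ℝ 𝔸) (ιB : ∀ j : J, BlkY (f j).toKIdx → IBondY (f j).toKIdx)
  (C37 C38 : ∀ j : J, ℝ → CfgY 𝔸 (f j).toKIdx → AfldY 𝔸 (f j).toKIdx → Prop)

/-- ★★★ **THE (3.43) BOND-SECTOR FRAME OVER THE CODED CARRIERS OF A SUBFAMILY, INHABITED FOR `KACU`**: gen 13's instance `gFrame₅CodedOn` (40 fields: the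
letters `GbC ∕ QbC ∕ QsbC ∕ abC ∕ F₂C ∕ F₂sC ∕ LapBC`, the laws, the (3.42) read ∕ write fields) extended by the writing function `wHG6`, `wHGδ δc = δc∕6`, and the transfer
field `h1G_transfer_KACU`.  Displayed beyond `gFrame₅CodedOn`'s binders: the bond transporter law `hLipB` (`Reg335 ⇒ HolderLipBY c_Lip r_L (parB U) U`) and
`hMr : r_L + 1 < MInv`. [cite: Balaban1985BackgroundPropagators, Thm 3.4 p.400, Thm 3.3 p.399, (3.43) p.398, p.403 l.1–9, (3.82)–(3.86) p.407; Balaban1984PropagatorsII, Lemma 2.1 p.234, (2.51)–(2.52) p.232] -/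
noncomputable def h1GFrame₆CodedOn (hι : ∀ (j : J) (s : BlkY (f j).toKIdx), β (f j).toKIdx.hN (f j).toKIdx.D (f j).toKIdx.hk (ιB j s) = s)
    (hG1 : ∀ u : 𝔸ˣ, u ∈ G → ‖(u : 𝔸)‖ ≤ 1) (hpar : ∀ j (U : CfgY 𝔸 (f j).toKIdx), GVal G (f j).toKIdx U → ∀ z w, par j U z w ∈ G)
    (hunit : ∀ j (U : CfgY 𝔸 (f j).toKIdx), GVal G (f j).toKIdx U → IsUnit (deltaPrimeAY (f j).toKIdx (par j) U))
    (M₂ : ℝ) (hM₂ : 0 ≤ M₂) (hrepr : ∀ (v : 𝔸) (j : ι), |b.repr v j| ≤ M₂ * ‖v‖) (hcR : 0 < M₂ * ∑ j, ‖b j‖)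
    (Cq : ℝ) (hCq : 0 ≤ Cq) (hC37 : ∀ j β' U a, C37 j β' U a → GVal G (f j).toKIdx U ∧ CplxLettersY G (f j) (par j) (ιB j) Cq β' U a)
    (MInv aInv aW : ℝ) (hMInv : 0 < MInv) (haInv : 0 < aInv) (haW : 0 < aW)
    (hunitX : ∀ j (U : CfgY 𝔸 (f j).toKIdx), GVal G (f j).toKIdx U → IsUnit (XY (f j).toKIdx (par j) (GpY (f j).toKIdx (par j)) U))
    (hsym : ∀ j (U : CfgY 𝔸 (f j).toKIdx) (z w : SiteY (f j).toKIdx), par j U z w = (par j U w z)⁻¹)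
    (hunitA : ∀ j (α₀ : ℝ) (U : CfgY 𝔸 (f j).toKIdx), (bg9YC 𝔸 G P (f j)).Reg335 c35 α₀ U → IsUnit (deltaAY (f j).toKIdx (par j) (parB j) (GpY (f j).toKIdx (par j)) U))
    (hparB : ∀ j (U : CfgY 𝔸 (f j).toKIdx), GVal G (f j).toKIdx U → ∀ y f', parB j U y f' ∈ G) (hb₁ : 0 ≤ b₁)
    (C₀ : ℝ) (hC₀ : 0 ≤ C₀)
    (hreg335P : ∀ j (α₀ : ℝ) (U : CfgY 𝔸 (f j).toKIdx), MInv ≤ (geo9Y (f j)).M → 0 < α₀ → (geo9Y (f j)).M * α₀ ≤ aInv →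
      (bg9YC 𝔸 G P (f j)).Reg335 c35 α₀ U → Reg335PlaqY G (f j) (ιB j) C₀ U)
    (hC37G : ∀ j β' U a, C37 j β' U a → CplxLettersGY G (f j) (ιB j) β' U a)
    (cVar : ℝ) (hcVar : 0 ≤ cVar) (hvarB : ∀ j β' U a, C37 j β' U a → VarParBY (f j).toKIdx (parB j) cVar β' U a)
    (hMd : 2 * ((d : ℝ) + 1) < MInv) (mN : ℕ) (hnbr : ∀ (j : J) (y' : IBondY (f j).toKIdx), (nbr (geo9Y (f j)) (2 * ((d : ℝ) + 1)) y').card ≤ mN)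
    {cLip rL : ℝ} (hcLip : 0 ≤ cLip) (hrL : 0 ≤ rL)
    (hLipB : ∀ (j : J) (α₀ : ℝ) (U : CfgY 𝔸 (f j).toKIdx), (bg9YC 𝔸 G P (f j)).Reg335 c35 α₀ U → HolderLipBY (f j).toKIdx cLip rL (parB j U) U)
    (hMr : rL + 1 < MInv) :
    H1GFrame₆ c35 (fun j => geo9Y (f j)) (fun j => (codingYx P G (f j) (C37 j) (C38 j)).bg) (fun j => KSC P G (f j) (par j) (C37 j) (C38 j)) b (Fin (d + 1))
      (fun j => SiteY (f j).toKIdx) (fun j => BlkY (f j).toKIdx × ι)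
      (fun j => KACU P G (f j) (GAY (f j).toKIdx (par j) (parB j) (GpY (f j).toKIdx (par j))) (parB j) (C37 j) (C38 j))
      (fun j => pullS (codingYx P G (f j) (C37 j) (C38 j)) (CinvY P f G par j)) :=
  { gFrame₅CodedOn P f c35 G par parB b ιB C37 C38 hι hG1 hpar hunit M₂ hM₂ hrepr hcR Cq hCq hC37 MInv aInv aW hMInv haInv haW hunitX hsym hunitA hparB hb₁ C₀
      hC₀ hreg335P hC37G cVar hcVar hvarB hMd mN hnbr with
    wHG := fun B₀ B δc Bβ => wHG6 (2 * ((d : ℝ) + 1)) (((ℓ + 1 : ℕ) : ℝ)) (∑ j, ‖b j‖) M₂ (M₂ * ∑ j, ‖b j‖) cLip rL mN B₀ B δc Bβ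
    wHGδ := fun δc => δc / 6
    wHGδ_pos := fun δc hδc => by positivity
    h1G_transfer := fun j α₀ c c' α₁ B₀ B δ δc Bβ hM hα₀ hMa hreg hα₁ haW' h37 hB₀ hB hδ hδc hδcδ hE hH1 HL HR =>
      h1G_transfer_KACU P c35 G (f j) (par j) (parB j) b (ιB j) (C37 j) (C38 j) (hι j) hG1 (hparB j) hM₂ hrepr hcLip hrL (hLipB j)
        (fun _ => hnbr j) hMr (fun δ' => M₂ * (∑ j, ‖b j‖) + cXY (d := d) (ℓ := ℓ) b M₂ mN δ') α₀ c c' α₁ B₀ B δ δc Bβ hM hα₀ hMa hreg hα₁ haW' h37 hB₀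
        hB hδ hδc hδcδ (le_add_of_nonneg_right (cXY_nonneg (d := d) (ℓ := ℓ) b hM₂ mN δ)) hE hH1 HL HR }

/-- ★★ **`StepH1Pos` OF THE CODED BOND FAMILY `KACU` THROUGH THE (3.43) FRAME — THE (3.43) MEMBER OF THE SECT.-B STEP OF RECORD, G SIDE** (r06's
`stepH1Pos_of_h1GFrame₆` on `h1GFrame₆CodedOn`), GIVEN the Lemma-2.1 datum `(d261, h261)` of the frame; site family `KSC`, output family
`KACU G (f j) (GAY … (par j) (parB j) (GpY (par j))) (parB j) …`. [cite: Balaban1985BackgroundPropagators, Thm 3.4 p.400, Thm 3.3 p.399, (3.43) p.398, (3.82)–(3.86) p.407; Balaban1984PropagatorsII, Lemma 2.1 p.234, (2.51) p.232] -/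
theorem stepH1Pos_KACU_frame_on (hι : ∀ (j : J) (s : BlkY (f j).toKIdx), β (f j).toKIdx.hN (f j).toKIdx.D (f j).toKIdx.hk (ιB j s) = s)
    (hG1 : ∀ u : 𝔸ˣ, u ∈ G → ‖(u : 𝔸)‖ ≤ 1) (hpar : ∀ j (U : CfgY 𝔸 (f j).toKIdx), GVal G (f j).toKIdx U → ∀ z w, par j U z w ∈ G)
    (hunit : ∀ j (U : CfgY 𝔸 (f j).toKIdx), GVal G (f j).toKIdx U → IsUnit (deltaPrimeAY (f j).toKIdx (par j) U))
    (M₂ : ℝ) (hM₂ : 0 ≤ M₂) (hrepr : ∀ (v : 𝔸) (j : ι), |b.repr v j| ≤ M₂ * ‖v‖) (hcR : 0 < M₂ * ∑ j, ‖b j‖)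
    (Cq : ℝ) (hCq : 0 ≤ Cq) (hC37 : ∀ j β' U a, C37 j β' U a → GVal G (f j).toKIdx U ∧ CplxLettersY G (f j) (par j) (ιB j) Cq β' U a)
    (MInv aInv aW : ℝ) (hMInv : 0 < MInv) (haInv : 0 < aInv) (haW : 0 < aW)
    (hunitX : ∀ j (U : CfgY 𝔸 (f j).toKIdx), GVal G (f j).toKIdx U → IsUnit (XY (f j).toKIdx (par j) (GpY (f j).toKIdx (par j)) U))
    (hsym : ∀ j (U : CfgY 𝔸 (f j).toKIdx) (z w : SiteY (f j).toKIdx), par j U z w = (par j U w z)⁻¹)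
    (hunitA : ∀ j (α₀ : ℝ) (U : CfgY 𝔸 (f j).toKIdx), (bg9YC 𝔸 G P (f j)).Reg335 c35 α₀ U → IsUnit (deltaAY (f j).toKIdx (par j) (parB j) (GpY (f j).toKIdx (par j)) U))
    (hparB : ∀ j (U : CfgY 𝔸 (f j).toKIdx), GVal G (f j).toKIdx U → ∀ y f', parB j U y f' ∈ G) (hb₁ : 0 ≤ b₁)
    (C₀ : ℝ) (hC₀ : 0 ≤ C₀)
    (hreg335P : ∀ j (α₀ : ℝ) (U : CfgY 𝔸 (f j).toKIdx), MInv ≤ (geo9Y (f j)).M → 0 < α₀ → (geo9Y (f j)).M * α₀ ≤ aInv →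
      (bg9YC 𝔸 G P (f j)).Reg335 c35 α₀ U → Reg335PlaqY G (f j) (ιB j) C₀ U)
    (hC37G : ∀ j β' U a, C37 j β' U a → CplxLettersGY G (f j) (ιB j) β' U a)
    (cVar : ℝ) (hcVar : 0 ≤ cVar) (hvarB : ∀ j β' U a, C37 j β' U a → VarParBY (f j).toKIdx (parB j) cVar β' U a)
    (hMd : 2 * ((d : ℝ) + 1) < MInv) (mN : ℕ) (hnbr : ∀ (j : J) (y' : IBondY (f j).toKIdx), (nbr (geo9Y (f j)) (2 * ((d : ℝ) + 1)) y').card ≤ mN)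
    {cLip rL : ℝ} (hcLip : 0 ≤ cLip) (hrL : 0 ≤ rL)
    (hLipB : ∀ (j : J) (α₀ : ℝ) (U : CfgY 𝔸 (f j).toKIdx), (bg9YC 𝔸 G P (f j)).Reg335 c35 α₀ U → HolderLipBY (f j).toKIdx cLip rL (parB j U) U)
    (hMr : rL + 1 < MInv) (d261 : ℝ → ℕ)
    (h261 : ∀ (j : J) (δ α : ℝ), 0 < δ → δ ≤ 1 → 9 / 5000 ≤ α → α < 1 →
      (h1GFrame₆CodedOn P f c35 G par parB b ιB C37 C38 hι hG1 hpar hunit M₂ hM₂ hrepr hcR Cq hCq hC37 MInv aInv aW hMInv haInv haW hunitX hsym hunitA hparB hb₁ C₀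
        hC₀ hreg335P hC37G cVar hcVar hvarB hMd mN hnbr hcLip hrL hLipB hMr).M261 δ ≤ (geo9Y (f j)).M →
      Ineq261 (d261 δ) (toB6 (geo9Y (f j)) 0 True) δ α) :
    StepH1Pos (d + 1) c35 (fun j => geo9Y (f j)) (fun j => (codingYx P G (f j) (C37 j) (C38 j)).bg) (fun j => KSC P G (f j) (par j) (C37 j) (C38 j))
      (fun j => KACU P G (f j) (GAY (f j).toKIdx (par j) (parB j) (GpY (f j).toKIdx (par j))) (parB j) (C37 j) (C38 j))
      (fun j => pullS (codingYx P G (f j) (C37 j) (C38 j)) (CinvY P f G par j))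
      (fun j => KACU P G (f j) (GAY (f j).toKIdx (par j) (parB j) (GpY (f j).toKIdx (par j))) (parB j) (C37 j) (C38 j)) :=
  stepH1Pos_of_h1GFrame₆ (F := h1GFrame₆CodedOn P f c35 G par parB b ιB C37 C38 hι hG1 hpar hunit M₂ hM₂ hrepr hcR Cq hCq hC37 MInv aInv aW hMInv haInv haW
    hunitX hsym hunitA hparB hb₁ C₀ hC₀ hreg335P hC37G cVar hcVar hvarB hMd mN hnbr hcLip hrL hLipB hMr) d261 h261

end Steps

end Literature.MathematicalPhysics.QuantumFieldTheory.Balaban1983to89.B9SectBH1GFrameCodedYR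

end

/-!
# `Balaban1983to89.B9Eq340HolderLipParBYR` — THE CLASS-PARAMETRIC TWIN of `B9Eq340HolderLipParBY` (CASCADE-R, director-ym №279 GO-R; №277 (3) `hunitA` cure; dag-n06-d SOCKET-(α) class question)

statement-level skeleton of published theorems with citation tags; proofs where landed; nothing here is a claim about the
Yang–Mills mass gap

WHAT THIS FILE IS.  The original module `B9Eq340HolderLipParBY` types its objects over MODULE 3's member carrier `bg9Y 𝔸 G x` (MODULE 2's small-cube class (3.35)).  This file RE-DECLARES, with UNCHANGED NAMES inside the namespace `…B9Eq340HolderLipParBYR`, exactly its 2 class-dependent declarations over the CLASS-PARAMETRIC carrier `B9SectBCodedClassR.bg9YC 𝔸 G P x` (`P : RegExtraY …` = the two cube conditions of (3.35)∕(3.36) as a parameter; `bg9Y 𝔸 G x = bg9YC 𝔸 G (extraY 𝔸 G) x` by `rfl`, so every declaration here WITHOUT the `hunitA` binder specialises definitionally to its original; EXCEPTION (v1.1, №288 (4), ref-E READ-9 HEADER-NIT): `stepH1Pos_KACU_frame_parBY_on` carries the №277 RE-KEYED `hunitA` (WEAKER hypothesis), so at `P := extraY 𝔸 G` it IMPLIES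 the original via `fun j α₀ U hU => hunitA j U hU.1.1` (ref-E K3), NOT a definitional specialisation; CAVEAT (LOCATED-18, №290 (1)): no α₀-threshold ⇒ still uninhabitable at `SU(N)` — consumers use the GUARDED `…RG` twin; at the record's reading of PRINT's class, `P := extraYPb 𝔸 G`, the displayed laws `hreg335P` ((3.35) on plaquettes) and the class-keyed `hunitA` become theorems).  The text is the original's VERBATIM under the token surgery `bg9Y 𝔸 G ↦ bg9YC 𝔸 G P`, `NAME ↦ NAME P` for the class-dependent names (P the first explicit argument), and — №277 — the binder `hunitA` re-keyed from «all G-valued U» to «all (3.35)-regular U of the carrier» (`∀ j α₀ U, (bg9YC 𝔸 G P (f j)).Reg335 c35 α₀ U → IsUnit (deltaAY …)`) with its use sites (`hunitA j U hU ↦ hunitA j α₀ U hU`) — NOT verbatim for the declaration named above.  Class-free declarations of the original are NOT copied: they are imported and used BY NAME (`open … hiding` the re-declared ones).  Generated by dag-n06-c g16's `gen.py` (HOME `pub-ymgap-dag-n06-c/lean/g16/`); the ORIGINAL MODULE DOCUMENTATION FOLLOWS VERBATIM and describes the mathematics.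

HONEST SCOPE.  Re-typing bookkeeping; nothing of [B9] asserted beyond the original; COUNT-NEUTRAL; N06 NOT discharged; nothing continuum ∕ OS ∕ mass gap ∕ Clay.  Cell `pub-ymgap` (D-0062), Track A node N06 [B9], seat `pub-ymgap-dag-n06-c` g16, 2026-08-29.
-/

/-! Module documentation: that of the original `Balaban1983to89.B9Eq340HolderLipParBY` applies verbatim to this twin (not repeated here). -/

noncomputable section

namespace Literature.MathematicalPhysics.QuantumFieldTheory.Balaban1983to89.B9Eq340HolderLipParBYR

open Literature.MathematicalPhysics.QuantumFieldTheory.Balaban1983to89.B9SectBCodedClassR (RegExtraY bg9YC)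
open Literature.MathematicalPhysics.QuantumFieldTheory.Balaban1983to89.B9Eq340HolderLipParBY hiding hLipB_parBY stepH1Pos_KACU_frame_parBY_on

open LatticeFieldCalculus (supDist)
open T4RelativeLadder (UnitaryLike)
open B9BackgroundsKLevelV1 (shiftsV1)
open B9Eq39Adjoint (R covD)
open B6GlobalChartV1 (PV blkV1)
open B6Geom246MultiLevelBox (bset)
open B6Geom246MultiLevelTorus (geomT)
open B6Ineq2142KLevelV1 (β)
open B6KLevelCensusIndexV1 (KIdx Adm)
open B6RandomWalk (Ineq261)
open B9Thm34Ext (toB6)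
open B9Eq340StepLasso (rungSites taxiSteps)
open B9Eq340TaxiTelescope (norm_covD_slice_eq norm_sub_R_parTaxiV_le_supDist_of_rungs)
open B9Eq340TaxiContourLocalityY (rLB rLB_nonneg geomT_dist_blkV1_rung_le)
open B9PinMembersKLevelV1 (MemberY geo9Y bg9Y)
open B9Eq360DeltaPrimeAY (AfldY)
open B9SectBGpLettersY (GVal norm_le_one_and_inv_of_mem)
open B9SectBGpFrameCodedYR (codingYx)
open B9SectBGpFrameCodedY (CplxLettersY)
open B9SectBGpReadingsYR (KSC)
open B9SectBCodedCarrier (pullS)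
open B9SectBCodedReadingsUR (KACU)
open B9SectBKerFrameCodedYR (CinvY)
open B9SectBStepWhole (StepH1Pos)
open B9RWSumsReadsNbr (nbr)
open B9SectBGClassLettersY (Reg335PlaqY CplxLettersGY VarParBY)
open B9SectBH1GUndiffY (HolderLipBY gradSupB gradSupB_nonneg)
open B9SectBH1GFrameCodedYR (h1GFrame₆CodedOn stepH1Pos_KACU_frame_on)
open Node00 (SiteY BlkY FBondY IBondY CfgY SiteParY BondParY cdB parBY parBY_mem GAY GpY XY deltaAY deltaPrimeAY)

variable {d ℓ : ℕ} {hd : 1 ≤ d + 1} {hL : Odd (ℓ + 1) ∧ 1 < ℓ + 1} {b₀ b₁ : ℝ} {Mstar : ℕ}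
variable {𝔸 : Type} [NormedRing 𝔸] (P : RegExtraY d ℓ hd hL b₀ b₁ Mstar 𝔸) [NormedAlgebra ℂ 𝔸] [CompleteSpace 𝔸]

/-! ## §1 The law for def-Y's `parBY` -/

section Law

variable (i : KIdx d ℓ hd hL b₀ b₁)

/-- ★ **THE BINDER `hLipB` OF `…B9SectBH1GFrameCodedY.h1GFrame₆CodedOn` ∕ `stepH1Pos_KACU_frame_on` AT def-Y's BOND TRANSPORTER**: for a subfamily `f`
with `parB j := parBY (f j).toKIdx`, at every (3.35)-regular configuration (hence `G`-valued) the law holds with `c_Lip = d + 1`, `r_L = (d+1)(L+2)`.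
[cite: Balaban1985BackgroundPropagators, (3.40) p.397, (3.35) p.396, Thm 3.4 p.400] -/
theorem hLipB_parBY {J : Type} (f : J → MemberY d ℓ hd hL b₀ b₁ Mstar) (c35 : ℝ) (G : Subgroup 𝔸ˣ)
    (hG1 : ∀ u : 𝔸ˣ, u ∈ G → ‖(u : 𝔸)‖ ≤ 1) :
    ∀ (j : J) (α₀ : ℝ) (U : CfgY 𝔸 (f j).toKIdx), (bg9YC 𝔸 G P (f j)).Reg335 c35 α₀ U →
      HolderLipBY (f j).toKIdx ((d : ℝ) + 1) (rLB d ℓ) (parBY (f j).toKIdx U) U :=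
  fun j _ _ hreg => holderLipBY_parBY_of_gVal (f j).toKIdx G hG1 hreg.1.1

end Law

/-! ## §2 The (3.43) member of the Sect.-B step (G side) at def-Y's bond transporter, `hLipB` and `hparB` discharged -/

section Step

variable [NormOneClass 𝔸] [FiniteDimensional ℝ 𝔸] {J : Type} (f : J → MemberY d ℓ hd hL b₀ b₁ Mstar)
  [∀ x : MemberY d ℓ hd hL b₀ b₁ Mstar, Fintype (geo9Y x).Site]
  [instDS : ∀ x : MemberY d ℓ hd hL b₀ b₁ Mstar, DecidableEq (geo9Y x).Site] [instNE : ∀ x : MemberY d ℓ hd hL b₀ b₁ Mstar, Nonempty (geo9Y x).Site]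
  (c35 : ℝ) (G : Subgroup 𝔸ˣ) (par : ∀ j : J, SiteParY 𝔸 (f j).toKIdx)
  {ι : Type} [Fintype ι] [DecidableEq ι] (b : Module.Basis ι ℝ 𝔸) (ιB : ∀ j : J, BlkY (f j).toKIdx → IBondY (f j).toKIdx)
  (C37 C38 : ∀ j : J, ℝ → CfgY 𝔸 (f j).toKIdx → AfldY 𝔸 (f j).toKIdx → Prop)

/-- ★★ **`StepH1Pos` OF THE CODED BOND FAMILY `KACU` AT def-Y's BOND TRANSPORTER `parBY`, THE LAW `hLipB` DISCHARGED** (gen 14's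
`stepH1Pos_KACU_frame_on` at `parB j := parBY (f j).toKIdx` with `hLipB := hLipB_parBY`, `hparB := hparB_parBY`, `c_Lip = d + 1`, `r_L = (d+1)(L+2)`);
displayed: the cell threshold `rLB d ℓ + 1 < MInv`, the Lemma-2.1 datum `(d261, h261)` and gen 13's `gFrame₅CodedOn` laws.
[cite: Balaban1985BackgroundPropagators, Thm 3.4 p.400, Thm 3.3 p.399, (3.43) p.398, (3.40) p.397; Balaban1984PropagatorsII, Lemma 2.1 p.234, (2.51) p.232] -/
theorem stepH1Pos_KACU_frame_parBY_on (hι : ∀ (j : J) (s : BlkY (f j).toKIdx), β (f j).toKIdx.hN (f j).toKIdx.D (f j).toKIdx.hk (ιB j s) = s)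
    (hG1 : ∀ u : 𝔸ˣ, u ∈ G → ‖(u : 𝔸)‖ ≤ 1) (hpar : ∀ j (U : CfgY 𝔸 (f j).toKIdx), GVal G (f j).toKIdx U → ∀ z w, par j U z w ∈ G)
    (hunit : ∀ j (U : CfgY 𝔸 (f j).toKIdx), GVal G (f j).toKIdx U → IsUnit (deltaPrimeAY (f j).toKIdx (par j) U))
    (M₂ : ℝ) (hM₂ : 0 ≤ M₂) (hrepr : ∀ (v : 𝔸) (j : ι), |b.repr v j| ≤ M₂ * ‖v‖) (hcR : 0 < M₂ * ∑ j, ‖b j‖)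
    (Cq : ℝ) (hCq : 0 ≤ Cq) (hC37 : ∀ j β' U a, C37 j β' U a → GVal G (f j).toKIdx U ∧ CplxLettersY G (f j) (par j) (ιB j) Cq β' U a)
    (MInv aInv aW : ℝ) (hMInv : 0 < MInv) (haInv : 0 < aInv) (haW : 0 < aW)
    (hunitX : ∀ j (U : CfgY 𝔸 (f j).toKIdx), GVal G (f j).toKIdx U → IsUnit (XY (f j).toKIdx (par j) (GpY (f j).toKIdx (par j)) U))
    (hsym : ∀ j (U : CfgY 𝔸 (f j).toKIdx) (z w : SiteY (f j).toKIdx), par j U z w = (par j U w z)⁻¹)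
    (hunitA : ∀ j (α₀ : ℝ) (U : CfgY 𝔸 (f j).toKIdx), (bg9YC 𝔸 G P (f j)).Reg335 c35 α₀ U →
      IsUnit (deltaAY (f j).toKIdx (par j) (parBY (f j).toKIdx) (GpY (f j).toKIdx (par j)) U)) (hb₁ : 0 ≤ b₁)
    (C₀ : ℝ) (hC₀ : 0 ≤ C₀)
    (hreg335P : ∀ j (α₀ : ℝ) (U : CfgY 𝔸 (f j).toKIdx), MInv ≤ (geo9Y (f j)).M → 0 < α₀ → (geo9Y (f j)).M * α₀ ≤ aInv →
      (bg9YC 𝔸 G P (f j)).Reg335 c35 α₀ U → Reg335PlaqY G (f j) (ιB j) C₀ U)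
    (hC37G : ∀ j β' U a, C37 j β' U a → CplxLettersGY G (f j) (ιB j) β' U a)
    (cVar : ℝ) (hcVar : 0 ≤ cVar) (hvarB : ∀ j β' U a, C37 j β' U a → VarParBY (f j).toKIdx (parBY (f j).toKIdx) cVar β' U a)
    (hMd : 2 * ((d : ℝ) + 1) < MInv) (mN : ℕ) (hnbr : ∀ (j : J) (y' : IBondY (f j).toKIdx), (nbr (geo9Y (f j)) (2 * ((d : ℝ) + 1)) y').card ≤ mN)
    (hMr : rLB d ℓ + 1 < MInv) (d261 : ℝ → ℕ)
    (h261 : ∀ (j : J) (δ α : ℝ), 0 < δ → δ ≤ 1 → 9 / 5000 ≤ α → α < 1 →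
      (h1GFrame₆CodedOn P f c35 G par (fun j => parBY (f j).toKIdx) b ιB C37 C38 hι hG1 hpar hunit M₂ hM₂ hrepr hcR Cq hCq hC37 MInv aInv aW hMInv haInv
        haW hunitX hsym hunitA (hparB_parBY f G) hb₁ C₀ hC₀ hreg335P hC37G cVar hcVar hvarB hMd mN hnbr (by positivity : (0 : ℝ) ≤ (d : ℝ) + 1)
        (rLB_nonneg d ℓ) (hLipB_parBY P f c35 G hG1) hMr).M261 δ ≤ (geo9Y (f j)).M →
      Ineq261 (d261 δ) (toB6 (geo9Y (f j)) 0 True) δ α) :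
    StepH1Pos (d + 1) c35 (fun j => geo9Y (f j)) (fun j => (codingYx P G (f j) (C37 j) (C38 j)).bg) (fun j => KSC P G (f j) (par j) (C37 j) (C38 j))
      (fun j => KACU P G (f j) (GAY (f j).toKIdx (par j) (parBY (f j).toKIdx) (GpY (f j).toKIdx (par j))) (parBY (f j).toKIdx) (C37 j) (C38 j))
      (fun j => pullS (codingYx P G (f j) (C37 j) (C38 j)) (CinvY P f G par j))
      (fun j => KACU P G (f j) (GAY (f j).toKIdx (par j) (parBY (f j).toKIdx) (GpY (f j).toKIdx (par j))) (parBY (f j).toKIdx) (C37 j) (C38 j)) :=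
  stepH1Pos_KACU_frame_on P f c35 G par (fun j => parBY (f j).toKIdx) b ιB C37 C38 hι hG1 hpar hunit M₂ hM₂ hrepr hcR Cq hCq hC37 MInv aInv aW hMInv
    haInv haW hunitX hsym hunitA (hparB_parBY f G) hb₁ C₀ hC₀ hreg335P hC37G cVar hcVar hvarB hMd mN hnbr (by positivity : (0 : ℝ) ≤ (d : ℝ) + 1)
    (rLB_nonneg d ℓ) (hLipB_parBY P f c35 G hG1) hMr d261 h261

end Step

end Literature.MathematicalPhysics.QuantumFieldTheory.Balaban1983to89.B9Eq340HolderLipParBYR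

end

/-!
# `Balaban1983to89.B9SectBL2StepCodedOnR` — THE CLASS-PARAMETRIC TWIN of `B9SectBL2StepCodedOn` (CASCADE-R, director-ym №279 GO-R; №277 (3) `hunitA` cure; dag-n06-d SOCKET-(α) class question)

statement-level skeleton of published theorems with citation tags; proofs where landed; nothing here is a claim about the
Yang–Mills mass gap

WHAT THIS FILE IS.  The original module `B9SectBL2StepCodedOn` types its objects over MODULE 3's member carrier `bg9Y 𝔸 G x` (MODULE 2's small-cube class (3.35)).  This file RE-DECLARES, with UNCHANGED NAMES inside the namespace `…B9SectBL2StepCodedOnR`, exactly its 2 class-dependent declarations over the CLASS-PARAMETRIC carrier `B9SectBCodedClassR.bg9YC 𝔸 G P x` (`P : RegExtraY …` = the two cube conditions of (3.35)∕(3.36) as a parameter; `bg9Y 𝔸 G x = bg9YC 𝔸 G (extraY 𝔸 G) x` by `rfl`, so every declaration here specialises definitionally to its original; at the record's reading of PRINT's class, `P := extraYPb 𝔸 G`, the displayed laws `hreg335P` ((3.35) on plaquettes) and the class-keyed `hunitA` become theorems).  The text is the original's VERBATIM under the token surgery `bg9Y 𝔸 G ↦ bg9YC 𝔸 G P`, `NAME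 ↦ NAME P` for the class-dependent names (P the first explicit argument), and — №277 — the binder `hunitA` re-keyed from «all G-valued U» to «all (3.35)-regular U of the carrier» (`∀ j α₀ U, (bg9YC 𝔸 G P (f j)).Reg335 c35 α₀ U → IsUnit (deltaAY …)`) — a clause IDLE in this twin (no `hunitA` here; v1.1).  Class-free declarations of the original are NOT copied: they are imported and used BY NAME (`open … hiding` the re-declared ones).  Generated by dag-n06-c g16's `gen.py` (HOME `pub-ymgap-dag-n06-c/lean/g16/`); the ORIGINAL MODULE DOCUMENTATION FOLLOWS VERBATIM and describes the mathematics.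

HONEST SCOPE.  Re-typing bookkeeping; nothing of [B9] asserted beyond the original; COUNT-NEUTRAL; N06 NOT discharged; nothing continuum ∕ OS ∕ mass gap ∕ Clay.  Cell `pub-ymgap` (D-0062), Track A node N06 [B9], seat `pub-ymgap-dag-n06-c` g16, 2026-08-29.
-/

/-! Module documentation: that of the original `Balaban1983to89.B9SectBL2StepCodedOn` applies verbatim to this twin (not repeated here). -/

noncomputable section

namespace Literature.MathematicalPhysics.QuantumFieldTheory.Balaban1983to89.B9SectBL2StepCodedOnR

open Literature.MathematicalPhysics.QuantumFieldTheory.Balaban1983to89.B9SectBCodedClassR (RegExtraY bg9YC)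
open Literature.MathematicalPhysics.QuantumFieldTheory.Balaban1983to89.B9SectBL2StepCodedOn hiding stepL2nPos_KSC₃_on stepL2Pos_KSC₃_on

open Literature.MathematicalPhysics.QuantumFieldTheory.Balaban1983to89
open Literature.MathematicalPhysics.QuantumFieldTheory.Balaban1983to89.B6Ineq2142KLevelV1 (β)
open Literature.MathematicalPhysics.QuantumFieldTheory.Balaban1983to89.B9Eq360DeltaPrimeAY (AfldY)
open Literature.MathematicalPhysics.QuantumFieldTheory.Balaban1983to89.B9PinMembersKLevelV1 (MemberY geo9Y bg9Y)
open Literature.MathematicalPhysics.QuantumFieldTheory.Balaban1983to89.B9SectBGpLettersY (GVal)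
open Literature.MathematicalPhysics.QuantumFieldTheory.Balaban1983to89.B9SectBGpFrameCodedYR (codingYx)
open Literature.MathematicalPhysics.QuantumFieldTheory.Balaban1983to89.B9SectBGpFrameCodedY (CplxLettersY)
open Literature.MathematicalPhysics.QuantumFieldTheory.Balaban1983to89.B9SectBL2DictionaryYR (KSC₃ l2Frame₂CodedOn readL2_two_KSC₃ readL2_three_KSC₃ readL2_four_KSC₃ readL2_five_KSC₃ writeL2_two_KSC₃ writeL2_three_KSC₃ writeL2_four_KSC₃ writeL2_five_KSC₃)
open Literature.MathematicalPhysics.QuantumFieldTheory.Balaban1983to89.B9SectBStepWhole (StepL2nPos StepL2Pos stepL2Pos_of_members)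
open Literature.MathematicalPhysics.QuantumFieldTheory.Balaban1983to89.B9GeoNormsKLevelModelSignsV1 (modelSignsOn_geo9K)
open Literature.MathematicalPhysics.QuantumFieldTheory.Balaban1983to89.Node00 (SiteY BlkY IBondY CfgY SiteParY)

variable {d ℓ : ℕ} {hd : 1 ≤ d + 1} {hL : Odd (ℓ + 1) ∧ 1 < ℓ + 1} {b₀ b₁ : ℝ} {Mstar : ℕ}
variable {𝔸 : Type} [NormedRing 𝔸] (P : RegExtraY d ℓ hd hL b₀ b₁ Mstar 𝔸) [NormedAlgebra ℂ 𝔸] [CompleteSpace 𝔸] [NormOneClass 𝔸] [FiniteDimensional ℝ 𝔸]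

variable {J : Type} (f : J → MemberY d ℓ hd hL b₀ b₁ Mstar)
  (c35 : ℝ) (G : Subgroup 𝔸ˣ) {ι : Type} [Fintype ι] [DecidableEq ι] (b : Module.Basis ι ℝ 𝔸)
  [∀ x : MemberY d ℓ hd hL b₀ b₁ Mstar, Fintype (geo9Y x).Site] [∀ x : MemberY d ℓ hd hL b₀ b₁ Mstar, DecidableEq (geo9Y x).Site]
  [∀ x : MemberY d ℓ hd hL b₀ b₁ Mstar, Nonempty (geo9Y x).Site]
  (C37 C38 : ∀ j : J, ℝ → CfgY 𝔸 (f j).toKIdx → AfldY 𝔸 (f j).toKIdx → Prop)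
  (par : ∀ j : J, SiteParY 𝔸 (f j).toKIdx)
  (ιB : ∀ j : J, BlkY (f j).toKIdx → IBondY (f j).toKIdx)

/-- ★★ **THE POSITIVE-INPUT (3.46) BLOCK-STEP OF `KSC₃`, MEMBER BY MEMBER, ON A SUBFAMILY** (all six members), from the letters-level frames over the
coded carrier (`l2Frame₂CodedOn`) and the six tautological read/write fields of the augmented readings; any `GA`, `Cinv`.
[cite: Balaban1985BackgroundPropagators, Thm 3.1 (3.46) p.398, Thm 3.4 p.400, (3.63)–(3.67) pp.402–403, p.403 l.1–9; Balaban1984PropagatorsII, Prop. 2.6 (2.140)–(2.141) p.247, Lemma 2.1 p.234] -/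
theorem stepL2nPos_KSC₃_on (hι : ∀ (j : J) (s : BlkY (f j).toKIdx), β (f j).toKIdx.hN (f j).toKIdx.D (f j).toKIdx.hk (ιB j s) = s)
    (hG1 : ∀ u : 𝔸ˣ, u ∈ G → ‖(u : 𝔸)‖ ≤ 1) (hpar : ∀ j (U : CfgY 𝔸 (f j).toKIdx), GVal G (f j).toKIdx U → ∀ z w, par j U z w ∈ G)
    (hunit : ∀ j (U : CfgY 𝔸 (f j).toKIdx), GVal G (f j).toKIdx U → IsUnit (Node00.deltaPrimeAY (f j).toKIdx (par j) U))
    (dB : ℕ) (M₂ : ℝ) (hM₂ : 0 ≤ M₂) (hrepr : ∀ (v : 𝔸) (j : ι), |b.repr v j| ≤ M₂ * ‖v‖) (hcR : 0 < M₂ * ∑ j, ‖b j‖)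
    (hcL : 0 < Real.sqrt (Fintype.card ι) * M₂ * ∑ j, ‖b j‖)
    (Cq : ℝ) (hCq : 0 ≤ Cq) (hC37 : ∀ j β' U a, C37 j β' U a → GVal G (f j).toKIdx U ∧ CplxLettersY G (f j) (par j) (ιB j) Cq β' U a)
    (MInv aInv aW : ℝ) (hMInv : 0 < MInv) (haInv : 0 < aInv) (haW : 0 < aW)
    (GA : ∀ j : J, B9.KernelFamily (geo9Y (f j)) (codingYx P G (f j) (C37 j) (C38 j)).bg)
    (Cinv : ∀ j : J, B9.SiteKernel (geo9Y (f j)) (codingYx P G (f j) (C37 j) (C38 j)).bg) (n : Fin 6) :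
    StepL2nPos dB c35 (fun j => geo9Y (f j)) (fun j => (codingYx P G (f j) (C37 j) (C38 j)).bg) (fun j => KSC₃ P G (f j) (par j) (C37 j) (C38 j)) GA Cinv
      (fun j => KSC₃ P G (f j) (par j) (C37 j) (C38 j)) n := by
  set F := l2Frame₂CodedOn P f c35 G b C37 C38 par ιB hι hG1 hpar hunit dB M₂ hM₂ hrepr hcR hcL Cq hCq hC37 MInv aInv aW hMInv haInv haW with hF
  -- the six tautological fields of the augmented readings, in the frames' binder shapes
  have r2 : ∀ j (α₀ : ℝ) (c : (codingYx P G (f j) (C37 j) (C38 j)).bg.Cfg) (B₀ δ : ℝ), F.MInv ≤ (geo9Y (f j)).M → 0 < α₀ → (geo9Y (f j)).M * α₀ ≤ F.aInv →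
      (codingYx P G (f j) (C37 j) (C38 j)).bg.Reg335 c35 α₀ c → 0 < B₀ → 0 < δ → B9FromB6.L2Block (KSC₃ P G (f j) (par j) (C37 j) (C38 j)) B₀ δ c →
      ∀ k : Fin (d + 1) ⊕ Fin (d + 1), B6RandomWalkL2.HasL2Majorant (g := B9Thm34Ext.toB6 (geo9Y (f j)) (F.Rr j) (F.Hp j))
        (fun p : SiteY (f j).toKIdx × ι => F.blk j p.1)
        (F.Gop j c * B9Eq352DivFormLetters.conj b (B9Eq352GradLetters.diffLetter (F.T j) (F.coord j c) ((((geo9Y (f j)).eta : ℂ))⁻¹) k))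
        (fun a a' => F.cL * B₀ * (geo9Y (f j)).len a * Real.exp (-(δ * (geo9Y (f j)).dist a a'))) := by
    intro j α₀ c B₀ δ _ _ _ hreg hB₀ _ hL2 k
    obtain ⟨U, rfl, hU⟩ := (codingYx P G (f j) (C37 j) (C38 j)).exists_of_bg_Reg335 hreg
    exact readL2_two_KSC₃ P G (f j) (par j) (C37 j) (C38 j) b (ιB j) (hι j) hM₂ hrepr hU.1.1 hB₀.le hL2 k
  have r3 : ∀ j (α₀ : ℝ) (c : (codingYx P G (f j) (C37 j) (C38 j)).bg.Cfg) (B₀ δ : ℝ), F.MInv ≤ (geo9Y (f j)).M → 0 < α₀ → (geo9Y (f j)).M * α₀ ≤ F.aInv →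
      (codingYx P G (f j) (C37 j) (C38 j)).bg.Reg335 c35 α₀ c → 0 < B₀ → 0 < δ → B9FromB6.L2Block (KSC₃ P G (f j) (par j) (C37 j) (C38 j)) B₀ δ c →
      ∀ k l : Fin (d + 1) ⊕ Fin (d + 1), B6RandomWalkL2.HasL2Majorant (g := B9Thm34Ext.toB6 (geo9Y (f j)) (F.Rr j) (F.Hp j))
        (fun p : SiteY (f j).toKIdx × ι => F.blk j p.1)
        (B9Eq352DivFormLetters.conj b (B9Eq352GradLetters.diffLetter (F.T j) (F.coord j c) ((((geo9Y (f j)).eta : ℂ))⁻¹) k) *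
          B9Eq352DivFormLetters.conj b (B9Eq352GradLetters.diffLetter (F.T j) (F.coord j c) ((((geo9Y (f j)).eta : ℂ))⁻¹) l) * F.Gop j c)
        (fun a a' => F.cL * B₀ * 1 * Real.exp (-(δ * (geo9Y (f j)).dist a a'))) := by
    intro j α₀ c B₀ δ _ _ _ hreg hB₀ _ hL2 k l
    obtain ⟨U, rfl, hU⟩ := (codingYx P G (f j) (C37 j) (C38 j)).exists_of_bg_Reg335 hreg
    exact readL2_three_KSC₃ P G (f j) (par j) (C37 j) (C38 j) b (ιB j) (hι j) hM₂ hrepr hU.1.1 hB₀.le hL2 k l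
  have r4 : ∀ j (α₀ : ℝ) (c : (codingYx P G (f j) (C37 j) (C38 j)).bg.Cfg) (B₀ δ : ℝ), F.MInv ≤ (geo9Y (f j)).M → 0 < α₀ → (geo9Y (f j)).M * α₀ ≤ F.aInv →
      (codingYx P G (f j) (C37 j) (C38 j)).bg.Reg335 c35 α₀ c → 0 < B₀ → 0 < δ → B9FromB6.L2Block (KSC₃ P G (f j) (par j) (C37 j) (C38 j)) B₀ δ c →
      ∀ k l : Fin (d + 1) ⊕ Fin (d + 1), B6RandomWalkL2.HasL2Majorant (g := B9Thm34Ext.toB6 (geo9Y (f j)) (F.Rr j) (F.Hp j))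
        (fun p : SiteY (f j).toKIdx × ι => F.blk j p.1)
        (B9Eq352DivFormLetters.conj b (B9Eq352GradLetters.diffLetter (F.T j) (F.coord j c) ((((geo9Y (f j)).eta : ℂ))⁻¹) k) * F.Gop j c *
          B9Eq352DivFormLetters.conj b (B9Eq352GradLetters.diffLetter (F.T j) (F.coord j c) ((((geo9Y (f j)).eta : ℂ))⁻¹) l))
        (fun a a' => F.cL * B₀ * 1 * Real.exp (-(δ * (geo9Y (f j)).dist a a'))) := by
    intro j α₀ c B₀ δ _ _ _ hreg hB₀ _ hL2 k l
    obtain ⟨U, rfl, hU⟩ := (codingYx P G (f j) (C37 j) (C38 j)).exists_of_bg_Reg335 hreg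
    exact readL2_four_KSC₃ P G (f j) (par j) (C37 j) (C38 j) b (ιB j) (hι j) hM₂ hrepr hU.1.1 hB₀.le hL2 k l
  have r5 : ∀ j (α₀ : ℝ) (c : (codingYx P G (f j) (C37 j) (C38 j)).bg.Cfg) (B₀ δ : ℝ), F.MInv ≤ (geo9Y (f j)).M → 0 < α₀ → (geo9Y (f j)).M * α₀ ≤ F.aInv →
      (codingYx P G (f j) (C37 j) (C38 j)).bg.Reg335 c35 α₀ c → 0 < B₀ → 0 < δ → B9FromB6.L2Block (KSC₃ P G (f j) (par j) (C37 j) (C38 j)) B₀ δ c →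
      ∀ k l : Fin (d + 1) ⊕ Fin (d + 1), B6RandomWalkL2.HasL2Majorant (g := B9Thm34Ext.toB6 (geo9Y (f j)) (F.Rr j) (F.Hp j))
        (fun p : SiteY (f j).toKIdx × ι => F.blk j p.1)
        (F.Gop j c * B9Eq352DivFormLetters.conj b (B9Eq352GradLetters.diffLetter (F.T j) (F.coord j c) ((((geo9Y (f j)).eta : ℂ))⁻¹) k) *
          B9Eq352DivFormLetters.conj b (B9Eq352GradLetters.diffLetter (F.T j) (F.coord j c) ((((geo9Y (f j)).eta : ℂ))⁻¹) l))
        (fun a a' => F.cL * B₀ * 1 * Real.exp (-(δ * (geo9Y (f j)).dist a a'))) := by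
    intro j α₀ c B₀ δ _ _ _ hreg hB₀ _ hL2 k l
    obtain ⟨U, rfl, hU⟩ := (codingYx P G (f j) (C37 j) (C38 j)).exists_of_bg_Reg335 hreg
    exact readL2_five_KSC₃ P G (f j) (par j) (C37 j) (C38 j) b (ιB j) (hι j) hM₂ hrepr hU.1.1 hB₀.le hL2 k l
  have w2 : ∀ j (c c' : (codingYx P G (f j) (C37 j) (C38 j)).bg.Cfg) (α₁ B δ : ℝ), 0 < α₁ → α₁ ≤ F.aW →
      (codingYx P G (f j) (C37 j) (C38 j)).bg.Cplx337 α₁ c c' → 0 ≤ B → 0 < δ →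
      (∀ k : Fin (d + 1) ⊕ Fin (d + 1), B6RandomWalkL2.HasL2Majorant (g := B9Thm34Ext.toB6 (geo9Y (f j)) (F.Rr j) (F.Hp j))
          (fun p : SiteY (f j).toKIdx × ι => F.blk j p.1)
          (F.Gop j ((codingYx P G (f j) (C37 j) (C38 j)).bg.mul c' c) *
            B9Eq352DivFormLetters.conj b (B9Eq352GradLetters.diffLetter (F.T j) (F.coord j c) ((((geo9Y (f j)).eta : ℂ))⁻¹) k))
          (fun a a' => B * (geo9Y (f j)).len a * Real.exp (-(δ * (geo9Y (f j)).dist a a')))) →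
      ∀ (lam : (geo9Y (f j)).Loc) (h : (geo9Y (f j)).Cut) (y y' : (geo9Y (f j)).Site), (geo9Y (f j)).cutIn h y → (geo9Y (f j)).suppIn lam y' →
        (KSC₃ P G (f j) (par j) (C37 j) (C38 j)).l2 2 ((codingYx P G (f j) (C37 j) (C38 j)).bg.mul c' c) lam h ≤
          F.wL B δ * B9.pref6 ((geo9Y (f j)).len y) 2 * (geo9Y (f j)).cutSup h * Real.exp (-(F.wLδ δ * (geo9Y (f j)).dist y y')) *
            (geo9Y (f j)).l2Norm lam := by
    intro j c c' α₁ B δ _ _ h37 hB _ hG lam h y y' hc hs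
    obtain ⟨U, a, rfl, rfl, hC⟩ := (codingYx P G (f j) (C37 j) (C38 j)).exists_of_bg_Cplx337 h37
    exact writeL2_two_KSC₃ P G (f j) (par j) (C37 j) (C38 j) b (ιB j) (hι j) hM₂ hrepr (hC37 j _ U a hC).1 a hB hG lam h y y' hc hs
  have w3 : ∀ j (c c' : (codingYx P G (f j) (C37 j) (C38 j)).bg.Cfg) (α₁ B δ : ℝ), 0 < α₁ → α₁ ≤ F.aW →
      (codingYx P G (f j) (C37 j) (C38 j)).bg.Cplx337 α₁ c c' → 0 ≤ B → 0 < δ →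
      (∀ k l : Fin (d + 1) ⊕ Fin (d + 1), B6RandomWalkL2.HasL2Majorant (g := B9Thm34Ext.toB6 (geo9Y (f j)) (F.Rr j) (F.Hp j))
          (fun p : SiteY (f j).toKIdx × ι => F.blk j p.1)
          (B9Eq352DivFormLetters.conj b (B9Eq352GradLetters.diffLetter (F.T j) (F.coord j c) ((((geo9Y (f j)).eta : ℂ))⁻¹) k) *
            B9Eq352DivFormLetters.conj b (B9Eq352GradLetters.diffLetter (F.T j) (F.coord j c) ((((geo9Y (f j)).eta : ℂ))⁻¹) l) *
            F.Gop j ((codingYx P G (f j) (C37 j) (C38 j)).bg.mul c' c))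
          (fun a a' => B * 1 * Real.exp (-(δ * (geo9Y (f j)).dist a a')))) →
      ∀ (lam : (geo9Y (f j)).Loc) (h : (geo9Y (f j)).Cut) (y y' : (geo9Y (f j)).Site), (geo9Y (f j)).cutIn h y → (geo9Y (f j)).suppIn lam y' →
        (KSC₃ P G (f j) (par j) (C37 j) (C38 j)).l2 3 ((codingYx P G (f j) (C37 j) (C38 j)).bg.mul c' c) lam h ≤
          F.wL B δ * B9.pref6 ((geo9Y (f j)).len y) 3 * (geo9Y (f j)).cutSup h * Real.exp (-(F.wLδ δ * (geo9Y (f j)).dist y y')) *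
            (geo9Y (f j)).l2Norm lam := by
    intro j c c' α₁ B δ _ _ h37 hB _ hG lam h y y' hc hs
    obtain ⟨U, a, rfl, rfl, hC⟩ := (codingYx P G (f j) (C37 j) (C38 j)).exists_of_bg_Cplx337 h37
    exact writeL2_three_KSC₃ P G (f j) (par j) (C37 j) (C38 j) b (ιB j) (hι j) hM₂ hrepr (hC37 j _ U a hC).1 a hB hG lam h y y' hc hs
  have w4 : ∀ j (c c' : (codingYx P G (f j) (C37 j) (C38 j)).bg.Cfg) (α₁ B δ : ℝ), 0 < α₁ → α₁ ≤ F.aW →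
      (codingYx P G (f j) (C37 j) (C38 j)).bg.Cplx337 α₁ c c' → 0 ≤ B → 0 < δ →
      (∀ k l : Fin (d + 1) ⊕ Fin (d + 1), B6RandomWalkL2.HasL2Majorant (g := B9Thm34Ext.toB6 (geo9Y (f j)) (F.Rr j) (F.Hp j))
          (fun p : SiteY (f j).toKIdx × ι => F.blk j p.1)
          (B9Eq352DivFormLetters.conj b (B9Eq352GradLetters.diffLetter (F.T j) (F.coord j c) ((((geo9Y (f j)).eta : ℂ))⁻¹) k) *
            F.Gop j ((codingYx P G (f j) (C37 j) (C38 j)).bg.mul c' c) *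
            B9Eq352DivFormLetters.conj b (B9Eq352GradLetters.diffLetter (F.T j) (F.coord j c) ((((geo9Y (f j)).eta : ℂ))⁻¹) l))
          (fun a a' => B * 1 * Real.exp (-(δ * (geo9Y (f j)).dist a a')))) →
      ∀ (lam : (geo9Y (f j)).Loc) (h : (geo9Y (f j)).Cut) (y y' : (geo9Y (f j)).Site), (geo9Y (f j)).cutIn h y → (geo9Y (f j)).suppIn lam y' →
        (KSC₃ P G (f j) (par j) (C37 j) (C38 j)).l2 4 ((codingYx P G (f j) (C37 j) (C38 j)).bg.mul c' c) lam h ≤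
          F.wL B δ * B9.pref6 ((geo9Y (f j)).len y) 4 * (geo9Y (f j)).cutSup h * Real.exp (-(F.wLδ δ * (geo9Y (f j)).dist y y')) *
            (geo9Y (f j)).l2Norm lam := by
    intro j c c' α₁ B δ _ _ h37 hB _ hG lam h y y' hc hs
    obtain ⟨U, a, rfl, rfl, hC⟩ := (codingYx P G (f j) (C37 j) (C38 j)).exists_of_bg_Cplx337 h37
    exact writeL2_four_KSC₃ P G (f j) (par j) (C37 j) (C38 j) b (ιB j) (hι j) hM₂ hrepr (hC37 j _ U a hC).1 a hB hG lam h y y' hc hs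
  have w5 : ∀ j (c c' : (codingYx P G (f j) (C37 j) (C38 j)).bg.Cfg) (α₁ B δ : ℝ), 0 < α₁ → α₁ ≤ F.aW →
      (codingYx P G (f j) (C37 j) (C38 j)).bg.Cplx337 α₁ c c' → 0 ≤ B → 0 < δ →
      (∀ k l : Fin (d + 1) ⊕ Fin (d + 1), B6RandomWalkL2.HasL2Majorant (g := B9Thm34Ext.toB6 (geo9Y (f j)) (F.Rr j) (F.Hp j))
          (fun p : SiteY (f j).toKIdx × ι => F.blk j p.1)
          (F.Gop j ((codingYx P G (f j) (C37 j) (C38 j)).bg.mul c' c) *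
            B9Eq352DivFormLetters.conj b (B9Eq352GradLetters.diffLetter (F.T j) (F.coord j c) ((((geo9Y (f j)).eta : ℂ))⁻¹) k) *
            B9Eq352DivFormLetters.conj b (B9Eq352GradLetters.diffLetter (F.T j) (F.coord j c) ((((geo9Y (f j)).eta : ℂ))⁻¹) l))
          (fun a a' => B * 1 * Real.exp (-(δ * (geo9Y (f j)).dist a a')))) →
      ∀ (lam : (geo9Y (f j)).Loc) (h : (geo9Y (f j)).Cut) (y y' : (geo9Y (f j)).Site), (geo9Y (f j)).cutIn h y → (geo9Y (f j)).suppIn lam y' →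
        (KSC₃ P G (f j) (par j) (C37 j) (C38 j)).l2 5 ((codingYx P G (f j) (C37 j) (C38 j)).bg.mul c' c) lam h ≤
          F.wL B δ * B9.pref6 ((geo9Y (f j)).len y) 5 * (geo9Y (f j)).cutSup h * Real.exp (-(F.wLδ δ * (geo9Y (f j)).dist y y')) *
            (geo9Y (f j)).l2Norm lam := by
    intro j c c' α₁ B δ _ _ h37 hB _ hG lam h y y' hc hs
    obtain ⟨U, a, rfl, rfl, hC⟩ := (codingYx P G (f j) (C37 j) (C38 j)).exists_of_bg_Cplx337 h37
    exact writeL2_five_KSC₃ P G (f j) (par j) (C37 j) (C38 j) b (ιB j) (hι j) hM₂ hrepr (hC37 j _ U a hC).1 a hB hG lam h y y' hc hs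
  match n with
  | 0 => exact B9SectBL2StepAtLettersV2.stepL2nPos_zero_of_l2Frame₂ F GA Cinv
  | 1 => exact B9SectBL2StepAtLettersV2.stepL2nPos_one_of_l2Frame₂ F GA Cinv
  | 2 => exact B9SectBL2StepAtLettersV2Right.stepL2nPos_two_of_l2Frame₂ F r2 w2 GA Cinv
  | 3 => exact B9SectBL2StepAtLettersV2Second.stepL2nPos_three_of_l2Frame₂ F r3 w3 GA Cinv
  | 4 => exact B9SectBL2StepAtLettersV2Mixed.stepL2nPos_four_of_l2Frame₂ F r2 r4 w4 GA Cinv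
  | 5 => exact B9SectBL2StepAtLettersV2Second.stepL2nPos_five_of_l2Frame₂ F r2 r5 w5 GA Cinv

/-- ★★ **THE POSITIVE-INPUT (3.46) BLOCK-STEP `StepL2Pos` OF `KSC₃` ON A SUBFAMILY** (the six members assembled by `B9SectBStepWhole.stepL2Pos_of_members` at
the model signs of the record geometry). [cite: Balaban1985BackgroundPropagators, Thm 3.1 (3.46) p.398, Thm 3.4 p.400, p.403 l.1–9] -/
theorem stepL2Pos_KSC₃_on (hι : ∀ (j : J) (s : BlkY (f j).toKIdx), β (f j).toKIdx.hN (f j).toKIdx.D (f j).toKIdx.hk (ιB j s) = s)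
    (hG1 : ∀ u : 𝔸ˣ, u ∈ G → ‖(u : 𝔸)‖ ≤ 1) (hpar : ∀ j (U : CfgY 𝔸 (f j).toKIdx), GVal G (f j).toKIdx U → ∀ z w, par j U z w ∈ G)
    (hunit : ∀ j (U : CfgY 𝔸 (f j).toKIdx), GVal G (f j).toKIdx U → IsUnit (Node00.deltaPrimeAY (f j).toKIdx (par j) U))
    (dB : ℕ) (M₂ : ℝ) (hM₂ : 0 ≤ M₂) (hrepr : ∀ (v : 𝔸) (j : ι), |b.repr v j| ≤ M₂ * ‖v‖) (hcR : 0 < M₂ * ∑ j, ‖b j‖)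
    (hcL : 0 < Real.sqrt (Fintype.card ι) * M₂ * ∑ j, ‖b j‖)
    (Cq : ℝ) (hCq : 0 ≤ Cq) (hC37 : ∀ j β' U a, C37 j β' U a → GVal G (f j).toKIdx U ∧ CplxLettersY G (f j) (par j) (ιB j) Cq β' U a)
    (MInv aInv aW : ℝ) (hMInv : 0 < MInv) (haInv : 0 < aInv) (haW : 0 < aW)
    (GA : ∀ j : J, B9.KernelFamily (geo9Y (f j)) (codingYx P G (f j) (C37 j) (C38 j)).bg)
    (Cinv : ∀ j : J, B9.SiteKernel (geo9Y (f j)) (codingYx P G (f j) (C37 j) (C38 j)).bg) :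
    StepL2Pos dB c35 (fun j => geo9Y (f j)) (fun j => (codingYx P G (f j) (C37 j) (C38 j)).bg) (fun j => KSC₃ P G (f j) (par j) (C37 j) (C38 j)) GA Cinv
      (fun j => KSC₃ P G (f j) (par j) (C37 j) (C38 j)) :=
  stepL2Pos_of_members (d := dB) (c35 := c35) (geo := fun j => geo9Y (f j)) (bg := fun j => (codingYx P G (f j) (C37 j) (C38 j)).bg)
    (Gp := fun j => KSC₃ P G (f j) (par j) (C37 j) (C38 j)) (GA := GA) (Cinv := Cinv) (fun j => modelSignsOn_geo9K (f j).toKIdx)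
    fun n => stepL2nPos_KSC₃_on P f c35 G b C37 C38 par ιB hι hG1 hpar hunit dB M₂ hM₂ hrepr hcR hcL Cq hCq hC37 MInv aInv aW hMInv haInv haW GA Cinv n

end Literature.MathematicalPhysics.QuantumFieldTheory.Balaban1983to89.B9SectBL2StepCodedOnR

end
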